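import Mathlib
import Literature.MathematicalPhysics.QuantumFieldTheory.Balaban1983to89.T4ConvexResponse

/-!
# T4ConstrainedAgmon — the CONSTRAINED AGMON BOUND of the energy-convexity route to NE3: tangent-only coercivity, finite-range tangent corrections, source in the dual weighted gauge, discharged in the block model with every constant uniform in the mesh and the volume (cell `pub-balaban`, T4-DAG node U1 (b), spine estimate NE3, row T4-U1b.NE3-PROVE-P2b*; folklore algebra + lattice bookkeeping; continuation of `T4ConvexResponse` §8–§8f as a separate file only because of the gate's file-size limit)

HONEST FRAMING (cell `pub-balaban`, T4-DAG PAGE 1).  The cell's T4 target is the existence AND uniqueness of the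
continuum limit of Bałaban's unit-scale averaged loop expectations on a FINITE torus T⁴ — a constructive-QFT
statement strictly beyond ultraviolet stability; there is NO mass gap statement here, it is NOT the Clay problem and
NOT summit progress.  This module is kernel work of ONE technique seat (energy-convexity, P2) for the cell's NEW
ESTIMATE NE3 = "η-rate of the minimisers" (node U1 (b); NE3 is by the cell's DAG §3 free of the conditionals
BetaPertH, (B), (B^μ), and nothing below mentions them).  It continues items (δ1)–(δ2) of the LOCALISATION input δ
of the energy route (`T4ConvexResponse` §8, §8d: `agmon_weighted_response`, `ConjugationDefect`, `WeightedDualBound`,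
`agmon_constrained`; §7b/§8d lattice model `LatticeWitness.latticeForm`, `mulOp`, `fwdDiff`).  EVERYTHING below is
[folklore]: two abstract theorems over a bare real vector space with an abstract gauge (no topology), and their
complete discharge on the finite-lattice model ℓ²(G) — energy gauge, block-tangent space, exact profile families,
tangent corrections, and the one-dimensional instance on Z/(Kn).  NOTHING is asserted about Bałaban's
configurations, operators or norms; every `(h… : …)` binder that a dictionary would have to supply is named as such in
the docstrings, and whether the dictionary holds is the paper-level content of the record HOME/t4/T4-EST-NE3-P2.md
(items (δ1′), (δ3)–(δ5)), where the first non-following step is localised.  Value = kernel certificate that the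
mechanism «Agmon conjugation + finite-range tangent correction» closes with mesh- and volume-free constants; NOT
summit progress.

CITATION HEADER (lean-in-tree rule 2026-08-18).  Source whose displayed formulas are READ (never cited as
establishing a disputed step — it is a manuscript under audit): T. Bałaban, *The variational problem and background
fields in renormalization group method for lattice gauge theories*, Commun. Math. Phys. **102** (1985) 277–309,
doi:10.1007/bf01229381 = [Balaban1985Variational] (cell paper B11, held `paper:balaban1985-cmp102-variational-
background`; pages below read by this seat on the rendered journal pages, PDF page = journal page − 276).

PRINTED CONTEXT (verbatim; the same sentences `T4ConvexResponse` reads — repeated here because the tangent space (83)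
and the fixed-point equation (116) are what the block-tangent space and the weak equation below MODEL).
* p. 289: "We make the change of variables (47) and we consider the functional 𝔉(A′) = A(U₀) + ⟨A′ − HD(A′), J⟩ +
  ½⟨A′ − HD(A′), Δ_π(A′ − HD(A′))⟩ + V₀(A′ − HD(A′)) (74) on the space of field configurations A′ satisfying
  L^jηQ_jA′ = B on Λ_j, j = 0, 1, …, k, |B| < 2dLC₁ε₁, (75) RD*(A′ − HD(A′)) = RD*A′ = 0, (76)"; p. 290: "|A′| <
  ε₃(L^jη)^{−1}, |∇A′| < ε₃(L^jη)^{−2} on Ω_j, j = 0, 1, …, k. (77)" … "Now let us write higher order terms. They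
  determine the functional V(A′) = −⟨HD₃(A′), J⟩ − ⟨A′, Δ_πHD(A′)⟩ + ½⟨HD(A′), Δ_πHD(A′)⟩ + V₀(A′ − HD(A′)). (80)
  It is analytic in A′ for A′ with values in the complexified algebra and satisfying (77). We consider the functional
  𝔉(A′) = A(U₀) + ⟨A′, J⟩ + ½⟨A′, Δ₁A′⟩ + V(A′) (81) on the space of configurations A′ satisfying (75)–(77). To
  find critical points of this functional we have to find A′ in the considered space, such that the equation
  ⟨(δ/δA′)𝔉(A′), δA′⟩ = 0 (82) holds for all δA′ in the tangent space, that is δA′ satisfying the conditions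
  QδA′ = 0, RD*δA′ = 0. (83) We have to calculate the functional derivative of 𝔉(A′). From (81) we have
  ⟨(δ/δA′)𝔉(A′), δA′⟩ = ⟨δA′, J⟩ + ⟨δA′, Δ₁A′⟩ + ⟨(δ/δA′)V(A′), δA′⟩. (84)"
  [cite: Balaban1985Variational, (74)–(76) p. 289; (77), (80)–(84) p. 290]
* p. 295: "A solution of Eq. (111) is a fixed point of the transformation A₁ → −𝔊J − 𝔊((δ/δA′)V)(A₁ + H₁B). (116)"
  … "Proposition 6. There exists a positive, absolute constant a₄ such, that for ε₄ ≤ a₄ and ε₁ satisfying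
  2B₀C₁B₃ε₁ ≤ ε₄ Eq. (111) has exactly one solution in the space (115). This solution satisfies the bounds (115)
  with ε₄ = 3B₀C₁B₃ε₁."  [cite: Balaban1985Variational, (116), Prop. 6 p. 295]
READ AS CONTEXT ONLY (pointers, no sentence used as a fact): the averaging constraints (19)–(21) p. 281 (what the
block-sum constraint models); the Green's functions of (44)–(47) p. 285 and the decay input quoted there from the
paper's reference [5] (the printed TYPE of the gauge re-projection cost, item (δ5) — NOT modelled here).

WHAT IS CELL-SUPPLIED, NOT PRINTED (never cited as a fact; enters below ONLY as the hypothesis shape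
`StrongSecondVariation`, modulus `m`): the lemma ML of the cell record HOME/b2b-balaban-b11-g5/ML-SUPPLIED.md
(kernel skeleton = tree module `…B11HessianL2`, p180426): for ε₁, ε₃ below a (d, L, N)-threshold (its smallness
clause S-B11.12), d²/dt²|₀ 𝔉(A′ + tW) ≥ ½c_* N(W)² for every A′ in the chart K = {(75), (76), (77)} and every
tangent direction W ∈ T = {QW = 0, RD*W = 0}, with N(W)² = ‖D_{U₀}W‖² + Σ_j (L^jη)^{−2}‖W‖²_{Ω_j∖Ω_{j+1}} and
c_* = ¼ min{1, (L B₀ c₁(½))^{−1}}.  In the dictionary below m = ½c_*, so the response modulus is 1/m = 2/c_* =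
8 max{1, L B₀ c₁(½)}.  Below, this is the
DICTIONARY for the hypothesis `hcoerT` (coercivity on the tangent space T only) of `agmon_constrained_tangent`; the
lattice model does not use it (its gauge is the energy gauge of the model form, coercive by definition).  v1.1 (§8h): the model now ALSO
carries a SUB-MASS / MASSLESS form `latticeForm c e s₀`, `0 ≤ s₀ ≤ s`, measured in the gauge `energyNorm c e s` —
for `s₀ = 0` the massless difference form, NOT coercive on all of ℓ²(G) (constants) but `1/(1+s)`-coercive on the
block tangent space by the BLOCK POINCARÉ INEQUALITY `block_poincare_1D` (zero block sums ⇒ ‖v‖² ≤ Σ‖c∇v‖², interior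
bonds only): the model analogue of ML's tangent-only coercivity, uniform in mesh and volume.

WHAT IS PROVED (all [folklore], sorry-free; plan and honest scope in the §8g section docstring below).  Abstract:
`agmon_constrained_tangent`, `agmon_constrained_tangent_dual`.  Model, energy gauge: `energyNorm`,
`latticeForm_self_eq`, `latticeForm_abs_le` (Cauchy–Schwarz), `energyNorm_add_le`, `energyNorm_sub_rev`,
`latticeForm_conjugationDefect_energy` (κ = #ι·μ²/s), `weighted_bond_identity`, `weighted_dir_defect`,
`latticeForm_weighted_continuity` (Λ_w = (1 + μ√(#ι/s))²).  Blocks: `fiber`, `blockSum`, `blockTangent`,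
`profileLift`, `ProfileExact`, `blockCorr`, `mulOp_sub_blockCorr_mem` (tangency), `energyNorm_sq_le_of_support`,
`energyNorm_sq_sum_le_mult`, `blockCorr_energy_le`, `weight_block_compare`, `constrained_lattice_agmon` (generic
assembly).  One dimension: `hprof` (+ `sum_hprof`, `hprof_bounds`, `abs_hprof_succ_sub`), `theta`
(+ `theta_profileExact`, `theta_support`, `abs_theta_le`, `abs_diff_theta_le`, `theta_energy_le`,
`theta_weighted_energy_le`), `constrained_lattice_agmon_1D`.  v1.1 (§8h, APPEND-ONLY; (δ2′)+(δ1′) in the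
model): sub-mass gauge lemmas `latticeForm_eq_add_inner`, `latticeForm_abs_le_of_le`,
`latticeForm_conjugationDefect_energy_of_le`, `latticeForm_weighted_continuity_of_le`, `coercive_of_poincare`; generic
`constrained_lattice_agmon_of_le` (tangent-only coercivity as a HYPOTHESIS on `T_Q`); tangent projection `tangentProj`
(+ `tangentProj_apply`, `tangentProj_of_mem`, `tangentProj_mem`), `profileLift_blockSum_energy_le`,
`tangent_source_extension`; one dimension: `poincare_range`, `finProdFinEquiv_succ`, `block_poincare_1D`,
`coercive_blockTangent_1D`, `constrained_lattice_agmon_1D_of_le`, `constrained_lattice_agmon_1D_tangentSource`.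
Record: HOME/t4/T4-EST-NE3-P2.md (v1.11/v1.12, §5 (5.3)–(5.3″) items (δ1′), (δ2), (δ2′), (δ5)).
-/

noncomputable section

namespace Literature.MathematicalPhysics.QuantumFieldTheory.Balaban1983to89.T4ConstrainedAgmon

open Literature.MathematicalPhysics.QuantumFieldTheory.Balaban1983to89.T4ConvexResponse
open Literature.MathematicalPhysics.QuantumFieldTheory.Balaban1983to89.T4ConvexResponse.LatticeWitness

/-! ### §8g (module `T4ConstrainedAgmon` v1; continues `T4ConvexResponse` §8–§8f) Items (δ1)+(δ2) REPAIRED AND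
DISCHARGED IN THE BLOCK MODEL: constrained Agmon bound with TANGENT-ONLY coercivity, finite-range tangent corrections,
source in the dual weighted gauge; the one-dimensional instance with every constant uniform in the mesh n = η⁻¹ and
the volume K

WHY.  Two gaps of the shape `T4ConvexResponse.agmon_constrained` (v1.8) (record §5 (5.3), items (δ1)–(δ2)), located by this lineage
when trying to discharge it on the §7b lattice:
(gap-a) the SOURCE COST of the tangent correction, `|J (corr u)| ≤ ρ₂ N(wu)`, is controlled by nothing printed and not by
the weighted dual bound — the correction `corr u` is not of the form `w v`, so the weighted dual bound does not apply to it.  REPAIR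
(`agmon_constrained_tangent_dual`): measure the source in the DUAL WEIGHTED GAUGE N′ = N ∘ w⁻¹ (`|J h| ≤ ρ N′ h` for
all h; at h = w v it is the weighted dual bound), measure the correction of the test field in N′ (`N′ c₂ ≤ θ₂ N(wu)`,
an energy estimate), and pay the form side with WEIGHTED CONTINUITY `|B u h| ≤ Λ_w N(wu) N′ h`.  Dictionary (record
(δ1′)): J is the REDUCED source J̃ = J − (DQ_k)^*μ, which agrees with J on T_Q and is what the weak equation on T_Q
actually determines; ρ is ITS weighted dual gauge.
(gap-b) `agmon_constrained.hcoer` asks m-coercivity of B on ALL of E, whereas the coercivity that is available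
([ML-SUPPLIED §4 Step B]: ½c_* N(W)² ≤ B[W, W]) holds only on the tangent space T = {Q W = 0, R D* W = 0}, and the
conjugated field w u is NOT in T.  REPAIR (`agmon_constrained_tangent`): coercivity on T only; w u is corrected into T
(`w u − c₁ ∈ T`, `N c₁ ≤ θ₁ N(wu)`) and plain continuity `|B v h| ≤ Λ N v N h` pays for the correction:
N(wu) ≤ (ρ + ρ₂)/(m(1−θ₁)² − Λθ₁(2+θ₁) − κ − κ₂).  (A penalised form B + λQ*Q does NOT repair gap-b uniformly in the
mesh — the penalty scales with the block cardinality; recorded dead end.)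
THE MODEL (all [folklore], sorry-free).  E = ℓ²(G), G a finite abelian group; B = `latticeForm c e s`
(Σ_i ‖c∇_i v‖² + s‖v‖², `T4ConvexResponse` §8d); the ENERGY GAUGE N = √B(v, v) (`energyNorm`: Cauchy–Schwarz `latticeForm_abs_le`,
subadditivity, conjugation defect κ = #ι·μ²/s `latticeForm_conjugationDefect_energy`, WEIGHTED CONTINUITY
Λ_w = (1 + μ√(#ι/s))² `latticeForm_weighted_continuity` from the bond identity `weighted_bond_identity`);
T_Q = `blockTangent` (zero block sums; dictionary ker Q_k); tangent corrections `blockCorr` = lift of block sums along an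
EXACT PROFILE FAMILY θ_b (`ProfileExact`, `profileLift`, `mulOp_sub_blockCorr_mem`) — a FINITE-RANGE right inverse
of the block-sum map, chosen instead of the B-orthogonal one (whose weighted bounds would be circular) — with energy
controlled by localisation and bounded multiplicity (`energyNorm_sq_le_of_support`, `energyNorm_sq_sum_le_mult`,
`blockCorr_energy_le`); weight hypotheses: mesh-Lipschitz |c∇_i ω| ≤ μω at both ends of every bond (as in `T4ConvexResponse` §8d) and
BLOCK NEAR-CONSTANCY |ω² − ω̄_b²| ≤ ϑ ω̄_b² (`weight_block_compare`).  GENERIC ASSEMBLY `constrained_lattice_agmon`: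
N(ωu) ≤ ρ(1+θ₂)/((1−θ₁)² − θ₁(2+θ₁) − #ι·μ²/s − Λ_w θ₂) with θ₁² ≥ Mϑ²C_u/((1−ϑ)s), θ₂² ≥ Mϑ²C_w/((1−ϑ)s), where
M is the multiplicity of the profile supports and C_u, C_w bound the (weighted) profile energies × block cardinality.
ONE-DIMENSIONAL INSTANCE `constrained_lattice_agmon_1D`: G = Z/(Kn), K blocks of n ≥ 3 sites (`Fin.divNat`), c = n
(block = unit length), IN-BLOCK PARABOLA profiles θ_b = h(pos)/n, h(j) = 6j(n−1−j)/((n−1)(n−2)) (`hprof`, `theta`: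
exact mass `sum_hprof`, |θ_b| ≤ 3/n, n|∇θ_b| ≤ 12/n, ZERO AT BOTH BLOCK FACES — a block indicator /n has two face jumps
of energy ≍ 1 and fails, recorded dead end): M = 1, C_u = 144 + 9s (`theta_energy_le`), C_w = ((12+3μ)² + 9s)/(1−ϑ)
(`theta_weighted_energy_le`), so N(ωu) ≤ ρ(1+θ₂)/((1−θ₁)² − θ₁(2+θ₁) − μ²/s − (1 + μ√(1/s))²θ₂) with
θ₁² ≥ ϑ²(144+9s)/((1−ϑ)s), θ₂² ≥ ϑ²((12+3μ)²+9s)/((1−ϑ)²s): EVERY CONSTANT INDEPENDENT OF n AND K — the Agmon rate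
per unit block survives η = 1/n → 0 and K → ∞, which is what item (δ2) («local response uniformly in η and the
volume») asks of the kernel.
HONEST SCOPE.  (i) d = 1 instance; the d-dimensional profile family (θ in one direction ⊗ block indicator in the
others has face jumps — use ⊗_ν θ, still multiplicity 1) is routine and NOT done here [analysis]; (ii) in the model
the gauge is the energy gauge of B itself, so coercivity is global (m = 1) and the tangent-only hypothesis of
`agmon_constrained_tangent` is exercised only abstractly — the faithful variant (B a pure difference form, N carrying
a mass, coercivity on T_Q from the block Poincaré inequality) is the next kernel step, item (δ2′); (iii) the
transport-dressed and kernel terms of `T4ConvexResponse` §8e–§8f compose through `conjugationDefect_add` but are not re-assembled with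
the tangent corrections here; (iv) NOT PROVED HERE and not printed sentences (record §5b): the weak equation with the
reduced source on T_Q (δ1′), the dictionary to (79)–(80) (δ3), coercivity on the segment (δ4, ML variant), and the
GAUGE HALF of the tangent space — R D*(ωu) ≠ 0 even when R D* u = 0; re-projecting ωu into {R D* = 0} costs a
Green's-function term whose decay is an input of printed TYPE ([5] Thm 3.12 as quoted on p. 285, (45)–(47)) and
requires the Agmon rate below that decay rate: new dictionary item (δ5), NOT modelled (the block model has the
Q-constraint only).  Value = kernel certificate that the mechanism «Agmon conjugation + finite-range tangent
correction» closes with mesh- and volume-free constants once (δ1′), (δ3)–(δ5) are supplied; NOT summit progress.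
[cite: Balaban1985Variational, (19)–(21) p. 281, (44)–(47) p. 285, (79)–(84) p. 290, (115) p. 294, (116)–(117) p. 295
(context: the constraints, the Green's functions, the Hessian and the fixed-point equation this is meant for)] -/

section ShapesTangent

variable {E : Type*} [AddCommGroup E] [Module ℝ E]

/-- CONSTRAINED AGMON BOUND WITH TANGENT-ONLY COERCIVITY (repair of gap-b of `agmon_constrained`, whose `hcoer`
asks coercivity on all of `E`).  `B` is m-coercive w.r.t. the gauge `N` only on the subspace `T` and Λ-continuous
everywhere (`|B v h| ≤ Λ N v N h`), `N` is non-negative and subadditive; the conjugated field `w u` is corrected into `T`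
(`w u − c₁ ∈ T`, `N c₁ ≤ θ₁ N(wu)`: dictionary c₁ = H_Q Q_k((ω − ω̄)u)); the Agmon test field `w (w u)` is corrected into
`T` (`w (w u) − c₂ ∈ T`) at form cost `|B u c₂| ≤ κ₂ N(wu)²` and source cost `|J c₂| ≤ ρ₂ N(wu)`; the weak equation
`B u v = J v` holds for `v ∈ T`; the conjugation defect of `w` is `κ`; the source has `w`-weighted dual gauge `ρ`.  Then
`N(wu) ≤ (ρ + ρ₂)/(m(1−θ₁)² − Λθ₁(2+θ₁) − κ − κ₂)`.  Algebra only: m(N(wu) − N c₁)² ≤ B(wu − c₁, wu − c₁) ≤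
B(wu, wu) + Λ(2N(wu) + N c₁)N c₁, then the chain of `agmon_weighted_response` through the corrected test field.
[folklore] [cite: Balaban1985Variational, (79)–(84) p. 290 (context: coercivity of the Hessian holds on the tangent
space of the constraints only)] -/
theorem agmon_constrained_tangent (B : E →ₗ[ℝ] E →ₗ[ℝ] ℝ) (w : E →ₗ[ℝ] E) (T : Submodule ℝ E) (N : E → ℝ)
    (J : E →ₗ[ℝ] ℝ) {m Λ κ κ₂ θ₁ ρ ρ₂ : ℝ}
    (hm : κ + κ₂ + Λ * θ₁ * (2 + θ₁) < m * (1 - θ₁) ^ 2) (hm₀ : 0 ≤ m) (hΛ : 0 ≤ Λ)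
    (hθ₁ : 0 ≤ θ₁) (hθ₁' : θ₁ ≤ 1) (hρ : 0 ≤ ρ + ρ₂)
    (hcoerT : ∀ v ∈ T, m * N v ^ 2 ≤ B v v) (hcont : ∀ v h, |B v h| ≤ Λ * N v * N h)
    (hNsub : ∀ a b, N a ≤ N (a - b) + N b) (hNnn : ∀ v, 0 ≤ N v)
    (hAg : ConjugationDefect B w N κ) {u c₁ c₂ : E}
    (hc₁T : w u - c₁ ∈ T) (hc₂T : w (w u) - c₂ ∈ T) (hc₁ : N c₁ ≤ θ₁ * N (w u))
    (hweak : ∀ v ∈ T, B u v = J v)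
    (hBc₂ : |B u c₂| ≤ κ₂ * N (w u) ^ 2) (hJc₂ : |J c₂| ≤ ρ₂ * N (w u))
    (hJ : WeightedDualBound J w N ρ) :
    N (w u) ≤ (ρ + ρ₂) / (m * (1 - θ₁) ^ 2 - Λ * θ₁ * (2 + θ₁) - κ - κ₂) := by
  set X := N (w u) with hX
  have hX0 : 0 ≤ X := hNnn _
  have hD : 0 < m * (1 - θ₁) ^ 2 - Λ * θ₁ * (2 + θ₁) - κ - κ₂ := by linarith
  -- coercivity at the corrected conjugated field
  have hco := hcoerT _ hc₁T
  have hlow : (1 - θ₁) * X ≤ N (w u - c₁) := by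
    have := hNsub (w u) c₁
    nlinarith
  have hlow2 : m * ((1 - θ₁) * X) ^ 2 ≤ m * N (w u - c₁) ^ 2 := by
    have h0 : 0 ≤ (1 - θ₁) * X := mul_nonneg (by linarith) hX0
    exact mul_le_mul_of_nonneg_left (pow_le_pow_left₀ h0 hlow 2) hm₀
  -- expand B at w u - c₁
  have hexp : B (w u - c₁) (w u - c₁) = B (w u) (w u) - B (w u) c₁ - B c₁ (w u) + B c₁ c₁ := by
    simp only [map_sub, LinearMap.sub_apply]; ring
  have e1 : -B (w u) c₁ ≤ Λ * X * (θ₁ * X) := by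
    have h := hcont (w u) c₁
    have h' := (neg_le_abs _).trans h
    have : Λ * N (w u) * N c₁ ≤ Λ * X * (θ₁ * X) :=
      mul_le_mul_of_nonneg_left hc₁ (mul_nonneg hΛ hX0)
    linarith
  have e2 : -B c₁ (w u) ≤ Λ * (θ₁ * X) * X := by
    have h := hcont c₁ (w u)
    have h' := (neg_le_abs _).trans h
    have : Λ * N c₁ * N (w u) ≤ Λ * (θ₁ * X) * X := by
      have := mul_le_mul_of_nonneg_left hc₁ hΛ
      exact mul_le_mul_of_nonneg_right this hX0
    linarith
  have e3 : B c₁ c₁ ≤ Λ * (θ₁ * X) * (θ₁ * X) := by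
    have h := hcont c₁ c₁
    have h' := (le_abs_self _).trans h
    have hc0 : 0 ≤ N c₁ := hNnn _
    have : Λ * N c₁ * N c₁ ≤ Λ * (θ₁ * X) * (θ₁ * X) := by
      have a1 : Λ * N c₁ ≤ Λ * (θ₁ * X) := mul_le_mul_of_nonneg_left hc₁ hΛ
      calc Λ * N c₁ * N c₁ ≤ Λ * (θ₁ * X) * N c₁ := mul_le_mul_of_nonneg_right a1 hc0
        _ ≤ Λ * (θ₁ * X) * (θ₁ * X) :=
          mul_le_mul_of_nonneg_left hc₁ (mul_nonneg hΛ (mul_nonneg hθ₁ hX0))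
    linarith
  -- conjugation defect and the weak equation on T
  have hA := hAg u
  have hsplit : B u (w (w u)) = J (w (w u)) - J c₂ + B u c₂ := by
    have h1 : B u (w (w u)) = B u (w (w u) - c₂) + B u c₂ := by rw [map_sub]; ring
    rw [h1, hweak _ hc₂T, map_sub]
  have e4 : J (w (w u)) ≤ ρ * X := (le_abs_self _).trans (hJ (w u))
  have e5 : -J c₂ ≤ ρ₂ * X := (neg_le_abs _).trans hJc₂
  have e6 : B u c₂ ≤ κ₂ * X ^ 2 := (le_abs_self _).trans hBc₂
  have hmain : (m * (1 - θ₁) ^ 2 - Λ * θ₁ * (2 + θ₁) - κ - κ₂) * X ^ 2 ≤ (ρ + ρ₂) * X := by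
    rw [hsplit] at hA
    nlinarith
  rw [le_div_iff₀ hD]
  rcases eq_or_lt_of_le hX0 with h0 | hpos
  · rw [← h0]; simp; exact hρ
  · nlinarith

/-- CONSTRAINED AGMON BOUND, SOURCE MEASURED IN THE DUAL WEIGHTED GAUGE (repair of gap-a of `agmon_constrained`,
whose source cost `|J (corr u)| ≤ ρ₂ N(wu)` of the NON-weighted correction is controlled by nothing printed).  Instead:
a second gauge `N′` (dictionary N′ = N ∘ w⁻¹, the gauge conjugated by the inverse weight) with `|J h| ≤ ρ N′ h` for ALL
`h` (for h = w v this is the weighted dual bound `WeightedDualBound J w N ρ`), WEIGHTED CONTINUITY of the form at the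
solution `|B u h| ≤ Λ_w N(wu) N′ h`, and the correction of the test field measured in `N′`: `N′ c₂ ≤ θ₂ N(wu)`.  Then
κ₂ = Λ_w θ₂ and ρ₂ = ρ θ₂ in `agmon_constrained_tangent`:
`N(wu) ≤ ρ(1 + θ₂)/(m(1−θ₁)² − Λθ₁(2+θ₁) − κ − Λ_w θ₂)`. [folklore] -/
theorem agmon_constrained_tangent_dual (B : E →ₗ[ℝ] E →ₗ[ℝ] ℝ) (w : E →ₗ[ℝ] E) (T : Submodule ℝ E)
    (N N' : E → ℝ) (J : E →ₗ[ℝ] ℝ) {m Λ Λw κ θ₁ θ₂ ρ : ℝ}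
    (hm : κ + Λw * θ₂ + Λ * θ₁ * (2 + θ₁) < m * (1 - θ₁) ^ 2) (hm₀ : 0 ≤ m) (hΛ : 0 ≤ Λ) (hΛw : 0 ≤ Λw)
    (hθ₁ : 0 ≤ θ₁) (hθ₁' : θ₁ ≤ 1) (hθ₂ : 0 ≤ θ₂) (hρ : 0 ≤ ρ)
    (hcoerT : ∀ v ∈ T, m * N v ^ 2 ≤ B v v) (hcont : ∀ v h, |B v h| ≤ Λ * N v * N h)
    (hNsub : ∀ a b, N a ≤ N (a - b) + N b) (hNnn : ∀ v, 0 ≤ N v)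
    (hAg : ConjugationDefect B w N κ) {u c₁ c₂ : E}
    (hwcont : ∀ h, |B u h| ≤ Λw * N (w u) * N' h) (hJ' : ∀ h, |J h| ≤ ρ * N' h)
    (hc₁T : w u - c₁ ∈ T) (hc₂T : w (w u) - c₂ ∈ T) (hc₁ : N c₁ ≤ θ₁ * N (w u))
    (hc₂ : N' c₂ ≤ θ₂ * N (w u)) (hweak : ∀ v ∈ T, B u v = J v) (hJ : WeightedDualBound J w N ρ) :
    N (w u) ≤ (ρ + ρ * θ₂) / (m * (1 - θ₁) ^ 2 - Λ * θ₁ * (2 + θ₁) - κ - Λw * θ₂) := by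
  have hX0 : 0 ≤ N (w u) := hNnn _
  have hBc₂ : |B u c₂| ≤ Λw * θ₂ * N (w u) ^ 2 := by
    refine (hwcont c₂).trans ?_
    have := mul_le_mul_of_nonneg_left hc₂ (mul_nonneg hΛw hX0)
    nlinarith
  have hJc₂ : |J c₂| ≤ ρ * θ₂ * N (w u) := by
    refine (hJ' c₂).trans ?_
    have := mul_le_mul_of_nonneg_left hc₂ hρ
    nlinarith
  have hm' : κ + Λw * θ₂ + Λ * θ₁ * (2 + θ₁) < m * (1 - θ₁) ^ 2 := hm
  exact agmon_constrained_tangent B w T N J (by linarith) hm₀ hΛ hθ₁ hθ₁' (by positivity) hcoerT hcont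
    hNsub hNnn hAg hc₁T hc₂T hc₁ hweak hBc₂ hJc₂ hJ

end ShapesTangent

section EnergyGauge

variable {G : Type*} [AddCommGroup G] [Fintype G] {ι : Type*} [Fintype ι]

/-- The model form on the diagonal: B(v, v) = Σ_i Σ_x ((c∇_i v)(x))² + s Σ_x v(x)². [folklore] -/
theorem latticeForm_self_eq (c : ℝ) (e : ι → G) (s : ℝ) (v : EuclideanSpace ℝ G) :
    latticeForm c e s v v = ∑ i, ∑ x, (c * (v (x + e i) - v x)) ^ 2 + s * ∑ x, v x ^ 2 := by
  rw [latticeForm_apply]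
  simp only [PiLp.inner_apply, fwdDiff_apply, RCLike.inner_apply, conj_trivial]
  congr 1
  · exact Finset.sum_congr rfl fun i _ => Finset.sum_congr rfl fun x _ => by ring
  · congr 1; exact Finset.sum_congr rfl fun x _ => by ring

/-- B(v, v) ≥ 0 for s ≥ 0. [folklore] -/
theorem latticeForm_self_nonneg (c : ℝ) (e : ι → G) {s : ℝ} (hs : 0 ≤ s) (v : EuclideanSpace ℝ G) :
    0 ≤ latticeForm c e s v v := by
  rw [latticeForm_self_eq]
  have h1 : 0 ≤ ∑ i, ∑ x, (c * (v (x + e i) - v x)) ^ 2 :=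
    Finset.sum_nonneg fun i _ => Finset.sum_nonneg fun x _ => sq_nonneg _
  have h2 : 0 ≤ ∑ x, v x ^ 2 := Finset.sum_nonneg fun x _ => sq_nonneg _
  positivity

/-- The ENERGY GAUGE of the model form, N(v) := √(B(v, v)) = (Σ_i ‖c∇_i v‖² + s‖v‖²)^{1/2} (dictionary: the energy norm
‖D_{U₀} W‖² + lower-order terms in which [ML-SUPPLIED §4] states coercivity; NOT the ℓ² gauge of §8d–§8f). [folklore] -/
def energyNorm (c : ℝ) (e : ι → G) (s : ℝ) (v : EuclideanSpace ℝ G) : ℝ :=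
  Real.sqrt (latticeForm c e s v v)

/-- N(v) ≥ 0. [folklore] -/
theorem energyNorm_nonneg (c : ℝ) (e : ι → G) (s : ℝ) (v : EuclideanSpace ℝ G) : 0 ≤ energyNorm c e s v :=
  Real.sqrt_nonneg _

/-- N(v)² = B(v, v) (s ≥ 0). [folklore] -/
theorem energyNorm_sq (c : ℝ) (e : ι → G) {s : ℝ} (hs : 0 ≤ s) (v : EuclideanSpace ℝ G) :
    energyNorm c e s v ^ 2 = latticeForm c e s v v :=
  Real.sq_sqrt (latticeForm_self_nonneg c e hs v)

/-- The mass term: s‖v‖² ≤ N(v)². [folklore] -/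
theorem norm_sq_le_energyNorm_sq (c : ℝ) (e : ι → G) {s : ℝ} (hs : 0 ≤ s) (v : EuclideanSpace ℝ G) :
    s * ‖v‖ ^ 2 ≤ energyNorm c e s v ^ 2 := by
  rw [energyNorm_sq c e hs]; exact latticeForm_coercive c e s v

/-- The gradient term: Σ_i ‖c∇_i v‖² ≤ N(v)². [folklore] -/
theorem sum_norm_fwdDiff_sq_le (c : ℝ) (e : ι → G) {s : ℝ} (hs : 0 ≤ s) (v : EuclideanSpace ℝ G) :
    ∑ i, ‖fwdDiff c e i v‖ ^ 2 ≤ energyNorm c e s v ^ 2 := by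
  rw [energyNorm_sq c e hs, latticeForm_apply]
  simp only [real_inner_self_eq_norm_sq]
  nlinarith [norm_nonneg v]

/-- CAUCHY–SCHWARZ in the energy gauge: |B(u, v)| ≤ N(u) N(v) (s ≥ 0) — the continuity hypothesis `hcont` with Λ = 1.
[folklore] -/
theorem latticeForm_abs_le (c : ℝ) (e : ι → G) {s : ℝ} (hs : 0 ≤ s) (u v : EuclideanSpace ℝ G) :
    |latticeForm c e s u v| ≤ energyNorm c e s u * energyNorm c e s v := by
  -- B u v = Σ_{o : Option ι} a o * b o with a none = √s‖u‖·sign?  We use vectors a, b indexed by Option ι.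
  classical
  set a : Option ι → ℝ := fun o => Option.elim o (Real.sqrt s * ‖u‖) fun i => ‖fwdDiff c e i u‖ with ha
  set b : Option ι → ℝ := fun o => Option.elim o (Real.sqrt s * ‖v‖) fun i => ‖fwdDiff c e i v‖ with hb
  have hsa : ∑ o, a o ^ 2 = latticeForm c e s u u := by
    rw [Fintype.sum_option, latticeForm_apply]
    simp only [ha, Option.elim, real_inner_self_eq_norm_sq, mul_pow, Real.sq_sqrt hs]
    ring
  have hsb : ∑ o, b o ^ 2 = latticeForm c e s v v := by
    rw [Fintype.sum_option, latticeForm_apply]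
    simp only [hb, Option.elim, real_inner_self_eq_norm_sq, mul_pow, Real.sq_sqrt hs]
    ring
  have hB : |latticeForm c e s u v| ≤ ∑ o, a o * b o := by
    rw [latticeForm_apply, Fintype.sum_option]
    simp only [ha, hb, Option.elim]
    have h1 : |s * inner ℝ u v| ≤ Real.sqrt s * ‖u‖ * (Real.sqrt s * ‖v‖) := by
      rw [abs_mul, abs_of_nonneg hs]
      have := abs_real_inner_le_norm u v
      have hss : Real.sqrt s * ‖u‖ * (Real.sqrt s * ‖v‖) = s * (‖u‖ * ‖v‖) := by
        rw [show Real.sqrt s * ‖u‖ * (Real.sqrt s * ‖v‖) = (Real.sqrt s * Real.sqrt s) * (‖u‖ * ‖v‖) by ring,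
          Real.mul_self_sqrt hs]
      rw [hss]; exact mul_le_mul_of_nonneg_left this hs
    have h2 : |∑ i, inner ℝ (fwdDiff c e i u) (fwdDiff c e i v)| ≤ ∑ i, ‖fwdDiff c e i u‖ * ‖fwdDiff c e i v‖ :=
      (Finset.abs_sum_le_sum_abs _ _).trans (Finset.sum_le_sum fun i _ => abs_real_inner_le_norm _ _)
    calc |∑ i, inner ℝ (fwdDiff c e i u) (fwdDiff c e i v) + s * inner ℝ u v|
        ≤ |∑ i, inner ℝ (fwdDiff c e i u) (fwdDiff c e i v)| + |s * inner ℝ u v| := abs_add_le _ _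
      _ ≤ Real.sqrt s * ‖u‖ * (Real.sqrt s * ‖v‖) + ∑ i, ‖fwdDiff c e i u‖ * ‖fwdDiff c e i v‖ := by linarith
  calc |latticeForm c e s u v| ≤ ∑ o, a o * b o := hB
    _ ≤ Real.sqrt (∑ o, a o ^ 2) * Real.sqrt (∑ o, b o ^ 2) := Real.sum_mul_le_sqrt_mul_sqrt _ _ _
    _ = energyNorm c e s u * energyNorm c e s v := by rw [hsa, hsb]; rfl

/-- Triangle inequality of the energy gauge (from Cauchy–Schwarz). [folklore] -/
theorem energyNorm_add_le (c : ℝ) (e : ι → G) {s : ℝ} (hs : 0 ≤ s) (a b : EuclideanSpace ℝ G) :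
    energyNorm c e s (a + b) ≤ energyNorm c e s a + energyNorm c e s b := by
  have h0 : 0 ≤ energyNorm c e s a + energyNorm c e s b :=
    add_nonneg (energyNorm_nonneg _ _ _ _) (energyNorm_nonneg _ _ _ _)
  apply le_of_sq_le_sq _ h0  -- wrong direction? use abs_le_abs / pow_le_pow_left
  · rw [energyNorm_sq c e hs]
    have hexp : latticeForm c e s (a + b) (a + b) =
        latticeForm c e s a a + latticeForm c e s a b + latticeForm c e s b a + latticeForm c e s b b := by
      simp only [map_add, LinearMap.add_apply]; ring
    rw [hexp]
    have h1 := (le_abs_self _).trans (latticeForm_abs_le c e hs a b)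
    have h2 := (le_abs_self _).trans (latticeForm_abs_le c e hs b a)
    nlinarith [energyNorm_sq c e hs a, energyNorm_sq c e hs b]

/-- N a ≤ N(a − b) + N b — the subadditivity hypothesis `hNsub`. [folklore] -/
theorem energyNorm_sub_rev (c : ℝ) (e : ι → G) {s : ℝ} (hs : 0 ≤ s) (a b : EuclideanSpace ℝ G) :
    energyNorm c e s a ≤ energyNorm c e s (a - b) + energyNorm c e s b := by
  have := energyNorm_add_le c e hs (a - b) b
  rwa [sub_add_cancel] at this

/-- N(t • v)² = t² N(v)². [folklore] -/
theorem energyNorm_smul (c : ℝ) (e : ι → G) {s : ℝ} (hs : 0 ≤ s) (t : ℝ) (v : EuclideanSpace ℝ G) :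
    energyNorm c e s (t • v) ^ 2 = t ^ 2 * energyNorm c e s v ^ 2 := by
  rw [energyNorm_sq c e hs, energyNorm_sq c e hs]
  simp only [map_smul, LinearMap.smul_apply, smul_eq_mul]; ring

/-- CONJUGATION DEFECT of the multiplication weight in the ENERGY gauge: κ = #ι·μ²/s, from `latticeForm_conjugationDefect`
(defect #ι·μ²‖ωu‖² in the ℓ² gauge) and s‖ωu‖² ≤ N(ωu)².  Mesh-uniform: for ω = e^{−μ₀φ}, φ 1-Lipschitz in BLOCK
units and c = η⁻¹, μ = (e^{μ₀η} − 1)/η ≤ μ₀e^{μ₀}. [folklore] -/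
theorem latticeForm_conjugationDefect_energy (c : ℝ) (e : ι → G) {s : ℝ} (hs : 0 < s) (ω : G → ℝ) {μ : ℝ}
    (hω : ∀ i x, c ^ 2 * (ω (x + e i) - ω x) ^ 2 ≤ μ ^ 2 * ω x ^ 2 ∧
      c ^ 2 * (ω (x + e i) - ω x) ^ 2 ≤ μ ^ 2 * ω (x + e i) ^ 2) :
    ConjugationDefect (latticeForm c e s) (mulOp ω) (energyNorm c e s) (Fintype.card ι * μ ^ 2 / s) := by
  intro u
  have h := latticeForm_conjugationDefect c e s ω hω u
  have hn := norm_sq_le_energyNorm_sq c e hs.le (mulOp ω u)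
  have hk : 0 ≤ (Fintype.card ι : ℝ) * μ ^ 2 := by positivity
  have : Fintype.card ι * μ ^ 2 / s * energyNorm c e s (mulOp ω u) ^ 2 ≥
      Fintype.card ι * μ ^ 2 * ‖mulOp ω u‖ ^ 2 := by
    rw [ge_iff_le, div_mul_eq_mul_div, le_div_iff₀ hs]
    nlinarith
  linarith

omit [AddCommGroup G] in
/-- Σ_x |A x| |B x| ≤ ‖A‖ ‖B‖ on `EuclideanSpace ℝ G`. [folklore] -/
theorem sum_abs_mul_le_norm_mul_norm (A B : EuclideanSpace ℝ G) : ∑ x, |A x| * |B x| ≤ ‖A‖ * ‖B‖ := by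
  have hA : Real.sqrt (∑ x, |A x| ^ 2) = ‖A‖ := by
    rw [EuclideanSpace.norm_eq]; simp only [Real.norm_eq_abs]
  have hB : Real.sqrt (∑ x, |B x| ^ 2) = ‖B‖ := by
    rw [EuclideanSpace.norm_eq]; simp only [Real.norm_eq_abs]
  calc ∑ x, |A x| * |B x| ≤ Real.sqrt (∑ x, |A x| ^ 2) * Real.sqrt (∑ x, |B x| ^ 2) :=
      Real.sum_mul_le_sqrt_mul_sqrt _ _ _
    _ = ‖A‖ * ‖B‖ := by rw [hA, hB]

omit [AddCommGroup G] [Fintype G] [Fintype ι] in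
/-- The BOND IDENTITY behind weighted continuity: with site values p = ω(x), q = ω(x + e) of the weight, r = c(q − p),
and V = ωv, H = ω⁻¹h, the product of differences c∇v · c∇h equals c∇V · c∇H + (r/q)(c∇V)·H(x) − (r/p)·V(x)·(c∇H)
− (r²/(pq))·V(x)H(x). [folklore] -/
theorem weighted_bond_identity (c p q v0 v1 h0 h1 : ℝ) (hp : p ≠ 0) (hq : q ≠ 0) :
    c * (v1 - v0) * (c * (h1 - h0)) =
      c * (q * v1 - p * v0) * (c * (h1 / q - h0 / p))
      + (c * (q - p) / q) * (c * (q * v1 - p * v0)) * (h0 / p)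
      - (c * (q - p) / p) * (p * v0) * (c * (h1 / q - h0 / p))
      - ((c * (q - p)) ^ 2 / (p * q)) * (p * v0) * (h0 / p) := by
  field_simp
  ring

omit [Fintype ι] in
/-- Per-direction WEIGHTED CONTINUITY DEFECT: for a positive weight with |c∇ω| ≤ μω at both ends of every bond,
|⟨c∇_i v, c∇_i h⟩ − ⟨c∇_i(ωv), c∇_i(ω⁻¹h)⟩| ≤ μ(‖c∇_i(ωv)‖ ‖ω⁻¹h‖ + ‖ωv‖ ‖c∇_i(ω⁻¹h)‖) + μ² ‖ωv‖ ‖ω⁻¹h‖ (sum the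
bond identity, Cauchy–Schwarz termwise). [folklore] -/
theorem weighted_dir_defect (c : ℝ) (e : ι → G) (i : ι) (ω : G → ℝ) (hpos : ∀ x, 0 < ω x) {μ : ℝ} (hμ : 0 ≤ μ)
    (hω : ∀ x, c ^ 2 * (ω (x + e i) - ω x) ^ 2 ≤ μ ^ 2 * ω x ^ 2 ∧
      c ^ 2 * (ω (x + e i) - ω x) ^ 2 ≤ μ ^ 2 * ω (x + e i) ^ 2) (v h : EuclideanSpace ℝ G) :
    |inner ℝ (fwdDiff c e i v) (fwdDiff c e i h)
      - inner ℝ (fwdDiff c e i (mulOp ω v)) (fwdDiff c e i (mulOp (fun x => (ω x)⁻¹) h))|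
      ≤ μ * (‖fwdDiff c e i (mulOp ω v)‖ * ‖mulOp (fun x => (ω x)⁻¹) h‖
          + ‖mulOp ω v‖ * ‖fwdDiff c e i (mulOp (fun x => (ω x)⁻¹) h)‖)
        + μ ^ 2 * (‖mulOp ω v‖ * ‖mulOp (fun x => (ω x)⁻¹) h‖) := by
  set V := mulOp ω v with hV
  set H := mulOp (fun x => (ω x)⁻¹) h with hH
  -- abbreviations for the bond coefficients
  set r : G → ℝ := fun x => c * (ω (x + e i) - ω x) with hr
  have hrq : ∀ x, |r x / ω (x + e i)| ≤ μ := by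
    intro x
    have hq := hpos (x + e i)
    rw [abs_div, abs_of_pos hq, div_le_iff₀ hq]
    have h2 := (hω x).2
    have : |r x| ^ 2 ≤ (μ * ω (x + e i)) ^ 2 := by rw [sq_abs, mul_pow]; simpa [hr, mul_pow] using h2
    exact (abs_le_of_sq_le_sq' this (by positivity)).2
  have hrp : ∀ x, |r x / ω x| ≤ μ := by
    intro x
    have hp := hpos x
    rw [abs_div, abs_of_pos hp, div_le_iff₀ hp]
    have h1 := (hω x).1
    have : |r x| ^ 2 ≤ (μ * ω x) ^ 2 := by rw [sq_abs, mul_pow]; simpa [hr, mul_pow] using h1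
    exact (abs_le_of_sq_le_sq' this (by positivity)).2
  have hrr : ∀ x, |r x ^ 2 / (ω x * ω (x + e i))| ≤ μ ^ 2 := by
    intro x
    have hp := hpos x
    have hq := hpos (x + e i)
    have e1 : r x ^ 2 / (ω x * ω (x + e i)) = (r x / ω x) * (r x / ω (x + e i)) := by
      field_simp
    rw [e1, abs_mul, sq]
    exact mul_le_mul (hrp x) (hrq x) (abs_nonneg _) hμ
  -- pointwise identity
  have hpt : ∀ x, fwdDiff c e i v x * fwdDiff c e i h x =
      fwdDiff c e i V x * fwdDiff c e i H x
      + (r x / ω (x + e i)) * fwdDiff c e i V x * H x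
      - (r x / ω x) * V x * fwdDiff c e i H x
      - (r x ^ 2 / (ω x * ω (x + e i))) * V x * H x := by
    intro x
    simp only [fwdDiff_apply, hV, hH, mulOp_apply, hr]
    have hp := (hpos x).ne'
    have hq := (hpos (x + e i)).ne'
    have key := weighted_bond_identity c (ω x) (ω (x + e i)) (v x) (v (x + e i)) (h x) (h (x + e i)) hp hq
    have e1 : h (x + e i) / ω (x + e i) = (ω (x + e i))⁻¹ * h (x + e i) := by rw [div_eq_inv_mul]
    have e2 : h x / ω x = (ω x)⁻¹ * h x := by rw [div_eq_inv_mul]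
    rw [e1, e2] at key
    linear_combination key
  -- sum over x
  have hsum : inner ℝ (fwdDiff c e i v) (fwdDiff c e i h) - inner ℝ (fwdDiff c e i V) (fwdDiff c e i H) =
      ∑ x, ((r x / ω (x + e i)) * fwdDiff c e i V x * H x)
      - ∑ x, ((r x / ω x) * V x * fwdDiff c e i H x)
      - ∑ x, ((r x ^ 2 / (ω x * ω (x + e i))) * V x * H x) := by
    simp only [PiLp.inner_apply, RCLike.inner_apply, conj_trivial]
    rw [← Finset.sum_sub_distrib, ← Finset.sum_sub_distrib, ← Finset.sum_sub_distrib]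
    refine Finset.sum_congr rfl fun x _ => ?_
    rw [mul_comm (fwdDiff c e i h x), mul_comm (fwdDiff c e i H x) (fwdDiff c e i V x), hpt x]
    ring
  have b1 : |∑ x, (r x / ω (x + e i)) * fwdDiff c e i V x * H x| ≤ μ * (‖fwdDiff c e i V‖ * ‖H‖) := by
    refine (Finset.abs_sum_le_sum_abs _ _).trans ?_
    calc ∑ x, |(r x / ω (x + e i)) * fwdDiff c e i V x * H x|
        ≤ ∑ x, μ * (|fwdDiff c e i V x| * |H x|) := Finset.sum_le_sum fun x _ => by
          rw [abs_mul, abs_mul, mul_assoc]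
          exact mul_le_mul_of_nonneg_right (hrq x) (by positivity)
      _ = μ * ∑ x, |fwdDiff c e i V x| * |H x| := by rw [Finset.mul_sum]
      _ ≤ μ * (‖fwdDiff c e i V‖ * ‖H‖) := mul_le_mul_of_nonneg_left (sum_abs_mul_le_norm_mul_norm _ _) hμ
  have b2 : |∑ x, (r x / ω x) * V x * fwdDiff c e i H x| ≤ μ * (‖V‖ * ‖fwdDiff c e i H‖) := by
    refine (Finset.abs_sum_le_sum_abs _ _).trans ?_
    calc ∑ x, |(r x / ω x) * V x * fwdDiff c e i H x|
        ≤ ∑ x, μ * (|V x| * |fwdDiff c e i H x|) := Finset.sum_le_sum fun x _ => by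
          rw [abs_mul, abs_mul, mul_assoc]
          exact mul_le_mul_of_nonneg_right (hrp x) (by positivity)
      _ = μ * ∑ x, |V x| * |fwdDiff c e i H x| := by rw [Finset.mul_sum]
      _ ≤ μ * (‖V‖ * ‖fwdDiff c e i H‖) := mul_le_mul_of_nonneg_left (sum_abs_mul_le_norm_mul_norm _ _) hμ
  have b3 : |∑ x, (r x ^ 2 / (ω x * ω (x + e i))) * V x * H x| ≤ μ ^ 2 * (‖V‖ * ‖H‖) := by
    refine (Finset.abs_sum_le_sum_abs _ _).trans ?_
    calc ∑ x, |(r x ^ 2 / (ω x * ω (x + e i))) * V x * H x|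
        ≤ ∑ x, μ ^ 2 * (|V x| * |H x|) := Finset.sum_le_sum fun x _ => by
          rw [abs_mul, abs_mul, mul_assoc]
          exact mul_le_mul_of_nonneg_right (hrr x) (by positivity)
      _ = μ ^ 2 * ∑ x, |V x| * |H x| := by rw [Finset.mul_sum]
      _ ≤ μ ^ 2 * (‖V‖ * ‖H‖) := mul_le_mul_of_nonneg_left (sum_abs_mul_le_norm_mul_norm _ _) (by positivity)
  rw [hsum]
  have t1 := abs_sub (∑ x, (r x / ω (x + e i)) * fwdDiff c e i V x * H x - ∑ x, (r x / ω x) * V x * fwdDiff c e i H x)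
    (∑ x, (r x ^ 2 / (ω x * ω (x + e i))) * V x * H x)
  have t2 := abs_sub (∑ x, (r x / ω (x + e i)) * fwdDiff c e i V x * H x) (∑ x, (r x / ω x) * V x * fwdDiff c e i H x)
  linarith

omit [AddCommGroup G] [Fintype ι] in
/-- ⟨v, h⟩ = ⟨ωv, ω⁻¹h⟩ for a positive weight. [folklore] -/
theorem inner_mulOp_inv (ω : G → ℝ) (hpos : ∀ x, 0 < ω x) (v h : EuclideanSpace ℝ G) :
    inner ℝ v h = inner ℝ (mulOp ω v) (mulOp (fun x => (ω x)⁻¹) h) := by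
  simp only [PiLp.inner_apply, mulOp_apply, RCLike.inner_apply, conj_trivial]
  refine Finset.sum_congr rfl fun x _ => ?_
  have hp := (hpos x).ne'
  field_simp

/-- WEIGHTED CONTINUITY of the model form in the energy gauge: |B(v, h)| ≤ (1 + μ√(#ι/s))² · N(ωv) · N(ω⁻¹h) for a
positive mesh-Lipschitz weight — the hypothesis `hwcont` of `agmon_constrained_tangent_dual` with N′ = N ∘ ω⁻¹ and
Λ_w = (1 + μ√(#ι/s))², independent of the mesh and the volume. [folklore] -/
theorem latticeForm_weighted_continuity (c : ℝ) (e : ι → G) {s : ℝ} (hs : 0 < s) (ω : G → ℝ)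
    (hpos : ∀ x, 0 < ω x) {μ : ℝ} (hμ : 0 ≤ μ)
    (hω : ∀ i x, c ^ 2 * (ω (x + e i) - ω x) ^ 2 ≤ μ ^ 2 * ω x ^ 2 ∧
      c ^ 2 * (ω (x + e i) - ω x) ^ 2 ≤ μ ^ 2 * ω (x + e i) ^ 2) (v h : EuclideanSpace ℝ G) :
    |latticeForm c e s v h| ≤ (1 + μ * Real.sqrt (Fintype.card ι / s)) ^ 2 *
      (energyNorm c e s (mulOp ω v) * energyNorm c e s (mulOp (fun x => (ω x)⁻¹) h)) := by
  set V := mulOp ω v with hV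
  set H := mulOp (fun x => (ω x)⁻¹) h with hH
  set d : ℝ := (Fintype.card ι : ℝ) with hd
  have hs0 := hs.le
  have hNV := energyNorm_nonneg c e s V
  have hNH := energyNorm_nonneg c e s H
  -- main term: B V H
  have hmain : |latticeForm c e s V H| ≤ energyNorm c e s V * energyNorm c e s H := latticeForm_abs_le c e hs0 V H
  -- difference B v h − B V H = Σ_i (per-direction defects); the mass parts agree
  have hdiff : latticeForm c e s v h - latticeForm c e s V H =
      ∑ i, (inner ℝ (fwdDiff c e i v) (fwdDiff c e i h) - inner ℝ (fwdDiff c e i V) (fwdDiff c e i H)) := by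
    rw [latticeForm_apply, latticeForm_apply, ← inner_mulOp_inv ω hpos v h, Finset.sum_sub_distrib]
    ring
  have hdefect : |latticeForm c e s v h - latticeForm c e s V H| ≤
      μ * ((∑ i, ‖fwdDiff c e i V‖) * ‖H‖ + ‖V‖ * ∑ i, ‖fwdDiff c e i H‖) + d * μ ^ 2 * (‖V‖ * ‖H‖) := by
    rw [hdiff]
    refine (Finset.abs_sum_le_sum_abs _ _).trans ?_
    have := Finset.sum_le_sum fun i (_ : i ∈ Finset.univ) => weighted_dir_defect c e i ω hpos hμ (hω i) v h
    refine this.trans (le_of_eq ?_)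
    rw [Finset.sum_add_distrib, Finset.sum_const, Finset.card_univ, nsmul_eq_mul, ← Finset.mul_sum,
      Finset.sum_add_distrib, Finset.sum_mul, Finset.mul_sum, ← Finset.mul_sum, hd]
    ring
  -- norms in terms of the energy gauge
  have hVn : ‖V‖ * Real.sqrt s ≤ energyNorm c e s V := by
    have h1 := norm_sq_le_energyNorm_sq c e hs0 V
    have h2 : (‖V‖ * Real.sqrt s) ^ 2 ≤ energyNorm c e s V ^ 2 := by
      rw [mul_pow, Real.sq_sqrt hs0]; linarith
    exact (abs_le_of_sq_le_sq' h2 hNV).2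
  have hHn : ‖H‖ * Real.sqrt s ≤ energyNorm c e s H := by
    have h1 := norm_sq_le_energyNorm_sq c e hs0 H
    have h2 : (‖H‖ * Real.sqrt s) ^ 2 ≤ energyNorm c e s H ^ 2 := by
      rw [mul_pow, Real.sq_sqrt hs0]; linarith
    exact (abs_le_of_sq_le_sq' h2 hNH).2
  have hDV : ∑ i, ‖fwdDiff c e i V‖ ≤ Real.sqrt d * energyNorm c e s V := by
    have h1 : (∑ i, ‖fwdDiff c e i V‖) ^ 2 ≤ d * energyNorm c e s V ^ 2 := by
      refine (sq_sum_le_card_mul_sum_sq (s := Finset.univ) (f := fun i => ‖fwdDiff c e i V‖)).trans ?_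
      rw [Finset.card_univ, ← hd]
      exact mul_le_mul_of_nonneg_left (sum_norm_fwdDiff_sq_le c e hs0 V) (by positivity)
    have h2 : (∑ i, ‖fwdDiff c e i V‖) ^ 2 ≤ (Real.sqrt d * energyNorm c e s V) ^ 2 := by
      rw [mul_pow, Real.sq_sqrt (by positivity)]; exact h1
    exact (abs_le_of_sq_le_sq' h2 (by positivity)).2
  have hDH : ∑ i, ‖fwdDiff c e i H‖ ≤ Real.sqrt d * energyNorm c e s H := by
    have h1 : (∑ i, ‖fwdDiff c e i H‖) ^ 2 ≤ d * energyNorm c e s H ^ 2 := by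
      refine (sq_sum_le_card_mul_sum_sq (s := Finset.univ) (f := fun i => ‖fwdDiff c e i H‖)).trans ?_
      rw [Finset.card_univ, ← hd]
      exact mul_le_mul_of_nonneg_left (sum_norm_fwdDiff_sq_le c e hs0 H) (by positivity)
    have h2 : (∑ i, ‖fwdDiff c e i H‖) ^ 2 ≤ (Real.sqrt d * energyNorm c e s H) ^ 2 := by
      rw [mul_pow, Real.sq_sqrt (by positivity)]; exact h1
    exact (abs_le_of_sq_le_sq' h2 (by positivity)).2
  -- assemble
  have hsq : 0 < Real.sqrt s := Real.sqrt_pos.mpr hs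
  have hVle : ‖V‖ ≤ energyNorm c e s V * (Real.sqrt s)⁻¹ := by
    rw [← div_eq_mul_inv, le_div_iff₀ hsq]; exact hVn
  have hHle : ‖H‖ ≤ energyNorm c e s H * (Real.sqrt s)⁻¹ := by
    rw [← div_eq_mul_inv, le_div_iff₀ hsq]; exact hHn
  have hdd : Real.sqrt d ^ 2 = d := Real.sq_sqrt (by positivity)
  have hfin : energyNorm c e s V * energyNorm c e s H
      + (μ * ((Real.sqrt d * energyNorm c e s V) * (energyNorm c e s H * (Real.sqrt s)⁻¹)
          + (energyNorm c e s V * (Real.sqrt s)⁻¹) * (Real.sqrt d * energyNorm c e s H))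
        + d * μ ^ 2 * ((energyNorm c e s V * (Real.sqrt s)⁻¹) * (energyNorm c e s H * (Real.sqrt s)⁻¹)))
      = (1 + μ * Real.sqrt (d / s)) ^ 2 * (energyNorm c e s V * energyNorm c e s H) := by
    rw [Real.sqrt_div (by positivity : (0:ℝ) ≤ d) s, div_eq_mul_inv]
    linear_combination (-(μ ^ 2 * energyNorm c e s V * energyNorm c e s H * (Real.sqrt s)⁻¹ ^ 2)) * hdd
  have habs : |latticeForm c e s v h| ≤ |latticeForm c e s V H| + |latticeForm c e s v h - latticeForm c e s V H| := by
    have := abs_add_le (latticeForm c e s V H) (latticeForm c e s v h - latticeForm c e s V H)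
    rwa [add_sub_cancel] at this
  have m1 : (∑ i, ‖fwdDiff c e i V‖) * ‖H‖ ≤
      (Real.sqrt d * energyNorm c e s V) * (energyNorm c e s H * (Real.sqrt s)⁻¹) :=
    mul_le_mul hDV hHle (norm_nonneg _) (by positivity)
  have m2 : ‖V‖ * ∑ i, ‖fwdDiff c e i H‖ ≤
      (energyNorm c e s V * (Real.sqrt s)⁻¹) * (Real.sqrt d * energyNorm c e s H) :=
    mul_le_mul hVle hDH (Finset.sum_nonneg fun i _ => norm_nonneg _) (by positivity)
  have m3 : ‖V‖ * ‖H‖ ≤ (energyNorm c e s V * (Real.sqrt s)⁻¹) * (energyNorm c e s H * (Real.sqrt s)⁻¹) :=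
    mul_le_mul hVle hHle (norm_nonneg _) (by positivity)
  have hd0 : 0 ≤ d * μ ^ 2 := by positivity
  rw [← hfin]
  calc |latticeForm c e s v h|
      ≤ |latticeForm c e s V H| + |latticeForm c e s v h - latticeForm c e s V H| := habs
    _ ≤ energyNorm c e s V * energyNorm c e s H
        + (μ * ((∑ i, ‖fwdDiff c e i V‖) * ‖H‖ + ‖V‖ * ∑ i, ‖fwdDiff c e i H‖) + d * μ ^ 2 * (‖V‖ * ‖H‖)) :=
        add_le_add hmain hdefect
    _ ≤ _ := add_le_add le_rfl (add_le_add (mul_le_mul_of_nonneg_left (add_le_add m1 m2) hμ)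
        (mul_le_mul_of_nonneg_left m3 hd0))

end EnergyGauge

/-! #### §8g.3 Block machinery (T_Q, exact profile families, tangent corrections), localised-energy lemmas, and the
generic assembled theorem `constrained_lattice_agmon`. -/

section Blocks

variable {G : Type*} [Fintype G] {Bk : Type*} [Fintype Bk] [DecidableEq Bk]

/-- The fibre {x : blk x = b} of a block map (dictionary: the sites of the η-lattice in the unit cube b, #fibre = L^{kd}).
[folklore] -/
def fiber (blk : G → Bk) (b : Bk) : Finset G := Finset.univ.filter (fun x => blk x = b)

omit [Fintype Bk] in
/-- Membership in a fibre. [folklore] -/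
theorem mem_fiber {blk : G → Bk} {b : Bk} {x : G} : x ∈ fiber blk b ↔ blk x = b := by
  simp [fiber]

/-- The BLOCK-SUM functional v ↦ Σ_{x ∈ block b} v(x) (dictionary: L^{kd}·(Q_k v)(b) for the plain block average; the
gauge-covariant average Q_k(U) of (19) differs by parallel transports, not modelled). [folklore]
[cite: Balaban1985Variational, (19)–(21) p. 281 (context)] -/
def blockSum (blk : G → Bk) (b : Bk) : EuclideanSpace ℝ G →ₗ[ℝ] ℝ where
  toFun v := ∑ x ∈ fiber blk b, v x
  map_add' u v := by simp [Finset.sum_add_distrib]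
  map_smul' t v := by simp [Finset.mul_sum]

omit [Fintype Bk] in
/-- Evaluation of the block sum. [folklore] -/
theorem blockSum_apply (blk : G → Bk) (b : Bk) (v : EuclideanSpace ℝ G) :
    blockSum blk b v = ∑ x ∈ fiber blk b, v x := rfl

/-- The BLOCK-TANGENT SPACE T_Q = {v : every block sum vanishes} = ker Q_k — the constraint half of the tangent space
{Q W = 0, R D* W = 0} on which [ML-SUPPLIED §4 Step B] states coercivity; the gauge half R D* W = 0 is NOT modelled
(item (δ5) of the record). [folklore] [cite: Balaban1985Variational, (19)–(21) p. 281 (context)] -/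
def blockTangent (blk : G → Bk) : Submodule ℝ (EuclideanSpace ℝ G) := ⨅ b, LinearMap.ker (blockSum blk b)

omit [Fintype Bk] in
/-- Membership in the block-tangent space. [folklore] -/
theorem mem_blockTangent {blk : G → Bk} {v : EuclideanSpace ℝ G} :
    v ∈ blockTangent blk ↔ ∀ b, blockSum blk b v = 0 := by
  simp [blockTangent, Submodule.mem_iInf, LinearMap.mem_ker]

/-- Lift of block data g along a profile family θ: Σ_b g(b) • θ_b (dictionary: a FINITE-RANGE right inverse H_Q of the
block-sum map, replacing the B-orthogonal one, whose weighted bounds would be circular). [folklore] -/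
def profileLift (θ : Bk → EuclideanSpace ℝ G) (g : Bk → ℝ) : EuclideanSpace ℝ G := ∑ b, g b • θ b

/-- EXACT RIGHT-INVERSE property of a profile family: the block sums of θ_b are δ_{b b′}. [folklore] -/
def ProfileExact (blk : G → Bk) (θ : Bk → EuclideanSpace ℝ G) : Prop :=
  ∀ b b', blockSum blk b' (θ b) = if b = b' then 1 else 0

/-- Q ∘ lift = id on block data, for an exact profile family. [folklore] -/
theorem blockSum_profileLift {blk : G → Bk} {θ : Bk → EuclideanSpace ℝ G} (hθ : ProfileExact blk θ)
    (g : Bk → ℝ) (b' : Bk) : blockSum blk b' (profileLift θ g) = g b' := by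
  have h : ∀ b, blockSum blk b' (θ b) = if b = b' then 1 else 0 := fun b => hθ b b'
  simp [profileLift, map_sum, map_smul, h, Finset.sum_ite_eq']

omit [Fintype Bk] in
/-- Block sum of ((m − m̄ ∘ blk) · u) over block b = block sum of (m · u) − m̄(b) · (block sum of u). [folklore] -/
theorem blockSum_mulOp_sub (blk : G → Bk) (b : Bk) (m : G → ℝ) (mbar : Bk → ℝ) (u : EuclideanSpace ℝ G) :
    blockSum blk b (mulOp (fun x => m x - mbar (blk x)) u) =
      blockSum blk b (mulOp m u) - mbar b * blockSum blk b u := by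
  simp only [blockSum_apply, mulOp_apply, Finset.mul_sum, ← Finset.sum_sub_distrib]
  refine Finset.sum_congr rfl fun x hx => ?_
  rw [mem_fiber.mp hx]; ring

/-- The TANGENT CORRECTION of a multiplied field: corr(u) = lift of the block sums of ((m − m̄ ∘ blk) · u) (dictionary: c₁ with
m = ω, m̄ = ω̄ the block constants of the weight; c₂ with m = ω², m̄ = ω̄²). [folklore] -/
def blockCorr (blk : G → Bk) (θ : Bk → EuclideanSpace ℝ G) (m : G → ℝ) (mbar : Bk → ℝ)
    (u : EuclideanSpace ℝ G) : EuclideanSpace ℝ G :=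
  profileLift θ (fun b => blockSum blk b (mulOp (fun x => m x - mbar (blk x)) u))

/-- TANGENCY OF THE CORRECTED FIELD: for u ∈ T_Q and an exact profile family, m · u − corr(u) ∈ T_Q (the hypotheses
`hc₁T`, `hc₂T` of `agmon_constrained_tangent`). [folklore] -/
theorem mulOp_sub_blockCorr_mem {blk : G → Bk} {θ : Bk → EuclideanSpace ℝ G} (hθ : ProfileExact blk θ)
    (m : G → ℝ) (mbar : Bk → ℝ) {u : EuclideanSpace ℝ G} (hu : u ∈ blockTangent blk) :
    mulOp m u - blockCorr blk θ m mbar u ∈ blockTangent blk := by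
  rw [mem_blockTangent] at hu ⊢
  intro b
  rw [map_sub, blockCorr, blockSum_profileLift hθ, blockSum_mulOp_sub, hu b]
  ring

omit [Fintype G] in
/-- ω · (ω · u) = ω² · u. [folklore] -/
theorem mulOp_mulOp (ω : G → ℝ) (u : EuclideanSpace ℝ G) :
    mulOp ω (mulOp ω u) = mulOp (fun x => ω x ^ 2) u := by
  ext x; simp [mulOp_apply]; ring

omit [Fintype G] in
/-- 1 · u = u. [folklore] -/
theorem mulOp_one' (u : EuclideanSpace ℝ G) : mulOp (fun _ => (1:ℝ)) u = u := by
  ext x; simp [mulOp_apply]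

omit [Fintype G] in
/-- ω · (ω⁻¹ · h) = h for a positive weight. [folklore] -/
theorem mulOp_mul_inv (ω : G → ℝ) (hpos : ∀ x, 0 < ω x) (h : EuclideanSpace ℝ G) :
    mulOp ω (mulOp (fun x => (ω x)⁻¹) h) = h := by
  ext x; simp [mulOp_apply, (hpos x).ne']

omit [Fintype G] [Fintype Bk] [DecidableEq Bk] in
/-- Evaluation of a finite sum of fields at a site. [folklore] -/
theorem sum_apply' (T : Finset Bk) (F : Bk → EuclideanSpace ℝ G) (x : G) :
    (∑ b ∈ T, F b) x = ∑ b ∈ T, F b x := by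
  induction T using Finset.cons_induction with
  | empty => simp
  | cons b T hb ih => rw [Finset.sum_cons, Finset.sum_cons, PiLp.add_apply, ih]

omit [Fintype G] [DecidableEq Bk] in
/-- (Σ_b y_b)² ≤ M · Σ_b y_b² when the y_b vanish outside a set of at most M indices (Cauchy–Schwarz). [folklore] -/
theorem sq_sum_le_of_vanish (y : Bk → ℝ) (A : Finset Bk) {Mu : ℕ} (hy : ∀ b, b ∉ A → y b = 0)
    (hA : A.card ≤ Mu) : (∑ b, y b) ^ 2 ≤ Mu * ∑ b, y b ^ 2 := by
  rw [← Finset.sum_subset (Finset.subset_univ A) (fun b _ hb => hy b hb)]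
  calc (∑ b ∈ A, y b) ^ 2 ≤ A.card * ∑ b ∈ A, y b ^ 2 := sq_sum_le_card_mul_sum_sq
    _ ≤ Mu * ∑ b ∈ A, y b ^ 2 :=
        mul_le_mul_of_nonneg_right (by exact_mod_cast hA) (Finset.sum_nonneg fun b _ => sq_nonneg _)
    _ ≤ Mu * ∑ b, y b ^ 2 := mul_le_mul_of_nonneg_left
        (Finset.sum_le_sum_of_subset_of_nonneg (Finset.subset_univ A) fun b _ _ => sq_nonneg _) (by positivity)

end Blocks

section BlockEnergy

variable {G : Type*} [AddCommGroup G] [Fintype G] [DecidableEq G] {ι : Type*} [Fintype ι]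
  {Bk : Type*} [Fintype Bk] [DecidableEq Bk]

omit [DecidableEq G] [Fintype Bk] [DecidableEq Bk] in
/-- ENERGY OF A LOCALISED FIELD: if F and its forward shifts vanish off the finite set S, |F| ≤ a and |c∇_i F| ≤ ℓ
pointwise, then N(F)² ≤ #S · (#ι · ℓ² + s · a²). [folklore] -/
theorem energyNorm_sq_le_of_support (c : ℝ) (e : ι → G) {s : ℝ} (hs : 0 ≤ s) (F : EuclideanSpace ℝ G)
    (S : Finset G) {a ℓ : ℝ} (hS : ∀ x, x ∉ S → F x = 0 ∧ ∀ i, F (x + e i) = 0)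
    (ha : ∀ x, |F x| ≤ a) (hℓ : ∀ i x, |c * (F (x + e i) - F x)| ≤ ℓ) :
    energyNorm c e s F ^ 2 ≤ S.card * (Fintype.card ι * ℓ ^ 2 + s * a ^ 2) := by
  rw [energyNorm_sq c e hs, latticeForm_self_eq]
  have h1 : ∀ i, ∑ x, (c * (F (x + e i) - F x)) ^ 2 ≤ S.card * ℓ ^ 2 := by
    intro i
    rw [← Finset.sum_subset (Finset.subset_univ S) (fun x _ hx => by simp [(hS x hx).1, (hS x hx).2 i])]
    calc ∑ x ∈ S, (c * (F (x + e i) - F x)) ^ 2 ≤ ∑ x ∈ S, ℓ ^ 2 := Finset.sum_le_sum fun x _ => by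
            rw [← sq_abs]; exact pow_le_pow_left₀ (abs_nonneg _) (hℓ i x) 2
      _ = S.card * ℓ ^ 2 := by rw [Finset.sum_const, nsmul_eq_mul]
  have h2 : ∑ x, F x ^ 2 ≤ S.card * a ^ 2 := by
    rw [← Finset.sum_subset (Finset.subset_univ S) (fun x _ hx => by simp [(hS x hx).1])]
    calc ∑ x ∈ S, F x ^ 2 ≤ ∑ x ∈ S, a ^ 2 := Finset.sum_le_sum fun x _ => by
            rw [← sq_abs]; exact pow_le_pow_left₀ (abs_nonneg _) (ha x) 2
      _ = S.card * a ^ 2 := by rw [Finset.sum_const, nsmul_eq_mul]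
  calc ∑ i, ∑ x, (c * (F (x + e i) - F x)) ^ 2 + s * ∑ x, F x ^ 2
      ≤ ∑ _i : ι, (S.card : ℝ) * ℓ ^ 2 + s * (S.card * a ^ 2) :=
        add_le_add (Finset.sum_le_sum fun i _ => h1 i) (mul_le_mul_of_nonneg_left h2 hs)
    _ = S.card * (Fintype.card ι * ℓ ^ 2 + s * a ^ 2) := by
        rw [Finset.sum_const, Finset.card_univ, nsmul_eq_mul]; ring

omit [DecidableEq Bk] in
/-- BOUNDED MULTIPLICITY: if each F_b together with its forward shifts is supported in S_b and every site lies in at most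
M of the sets S_b, then N(Σ_b F_b)² ≤ M · Σ_b N(F_b)² (sitewise Cauchy–Schwarz over the ≤ M non-zero summands).
[folklore] -/
theorem energyNorm_sq_sum_le_mult (c : ℝ) (e : ι → G) {s : ℝ} (hs : 0 ≤ s) (F : Bk → EuclideanSpace ℝ G)
    (S : Bk → Finset G) {Mu : ℕ} (hS : ∀ b x, x ∉ S b → F b x = 0 ∧ ∀ i, F b (x + e i) = 0)
    (hM : ∀ x, (Finset.univ.filter (fun b => x ∈ S b)).card ≤ Mu) :
    energyNorm c e s (∑ b, F b) ^ 2 ≤ Mu * ∑ b, energyNorm c e s (F b) ^ 2 := by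
  simp_rw [energyNorm_sq c e hs, latticeForm_self_eq]
  have hpt1 : ∀ i x, (c * ((∑ b, F b) (x + e i) - (∑ b, F b) x)) ^ 2 ≤
      Mu * ∑ b, (c * (F b (x + e i) - F b x)) ^ 2 := by
    intro i x
    have hx : c * ((∑ b, F b) (x + e i) - (∑ b, F b) x) = ∑ b, c * (F b (x + e i) - F b x) := by
      rw [sum_apply', sum_apply', ← Finset.sum_sub_distrib, Finset.mul_sum]
    rw [hx]
    refine sq_sum_le_of_vanish _ (Finset.univ.filter (fun b => x ∈ S b)) (fun b hb => ?_) (hM x)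
    have hb' : x ∉ S b := by simpa using hb
    rw [(hS b x hb').1, (hS b x hb').2 i]; ring
  have hpt2 : ∀ x, ((∑ b, F b) x) ^ 2 ≤ Mu * ∑ b, (F b x) ^ 2 := by
    intro x
    rw [sum_apply']
    refine sq_sum_le_of_vanish _ (Finset.univ.filter (fun b => x ∈ S b)) (fun b hb => ?_) (hM x)
    have hb' : x ∉ S b := by simpa using hb
    exact (hS b x hb').1
  have eA : ∑ i, ∑ x, ((Mu : ℝ) * ∑ b, (c * (F b (x + e i) - F b x)) ^ 2) =
      Mu * ∑ b, ∑ i, ∑ x, (c * (F b (x + e i) - F b x)) ^ 2 := by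
    simp only [← Finset.mul_sum]
    congr 1
    calc ∑ i, ∑ x, ∑ b, (c * (F b (x + e i) - F b x)) ^ 2
        = ∑ i, ∑ b, ∑ x, (c * (F b (x + e i) - F b x)) ^ 2 :=
          Finset.sum_congr rfl fun i _ => Finset.sum_comm
      _ = ∑ b, ∑ i, ∑ x, (c * (F b (x + e i) - F b x)) ^ 2 := Finset.sum_comm
  have eB : s * ∑ x, ((Mu : ℝ) * ∑ b, (F b x) ^ 2) = Mu * ∑ b, (s * ∑ x, (F b x) ^ 2) := by
    simp only [← Finset.mul_sum]
    rw [Finset.sum_comm]; ring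
  calc ∑ i, ∑ x, (c * ((∑ b, F b) (x + e i) - (∑ b, F b) x)) ^ 2 + s * ∑ x, ((∑ b, F b) x) ^ 2
      ≤ ∑ i, ∑ x, ((Mu : ℝ) * ∑ b, (c * (F b (x + e i) - F b x)) ^ 2) + s * ∑ x, ((Mu : ℝ) * ∑ b, (F b x) ^ 2) :=
        add_le_add (Finset.sum_le_sum fun i _ => Finset.sum_le_sum fun x _ => hpt1 i x)
          (mul_le_mul_of_nonneg_left (Finset.sum_le_sum fun x _ => hpt2 x) hs)
    _ = Mu * ∑ b, (∑ i, ∑ x, (c * (F b (x + e i) - F b x)) ^ 2 + s * ∑ x, F b x ^ 2) := by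
        rw [eA, eB, ← mul_add, ← Finset.sum_add_distrib]

omit [AddCommGroup G] [DecidableEq G] [Fintype ι] [Fintype Bk] [DecidableEq Bk] in
/-- ‖ω · u‖² = Σ_x (ω(x) u(x))². [folklore] -/
theorem norm_sq_mulOp (ω : G → ℝ) (u : EuclideanSpace ℝ G) : ‖mulOp ω u‖ ^ 2 = ∑ x, (ω x * u x) ^ 2 := by
  rw [EuclideanSpace.norm_eq, Real.sq_sqrt (Finset.sum_nonneg fun _ _ => sq_nonneg _)]
  simp [mulOp_apply, Real.norm_eq_abs, mul_pow, sq_abs]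

/-- ENERGY OF THE TANGENT CORRECTION relative to the conjugated field: if |m − m̄_b| ≤ κ_b |ω| on block b (so the block
sums of (m − m̄)u are ≤ κ_b √#b ‖ωu‖_b by Cauchy–Schwarz), the profiles with their shifts live on sets S_b of
multiplicity ≤ M, and κ_b² · #b · N(W · θ_b)² ≤ C for every block, then N(W · corr(u))² ≤ (M C / s) · N(ωu)²
(W = 1 for c₁ in the gauge N, W = ω⁻¹ for c₂ in the gauge N′ = N ∘ ω⁻¹). [folklore] -/
theorem blockCorr_energy_le (c : ℝ) (e : ι → G) {s : ℝ} (hs : 0 < s) (blk : G → Bk)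
    (θ : Bk → EuclideanSpace ℝ G) (S : Bk → Finset G) {Mu : ℕ}
    (hSθ : ∀ b x, x ∉ S b → θ b x = 0 ∧ ∀ i, θ b (x + e i) = 0)
    (hM : ∀ x, (Finset.univ.filter (fun b => x ∈ S b)).card ≤ Mu)
    (W m : G → ℝ) (mbar : Bk → ℝ) (ω : G → ℝ) (κ : Bk → ℝ) {C : ℝ} (hC : 0 ≤ C)
    (hdata : ∀ x, |m x - mbar (blk x)| ≤ κ (blk x) * |ω x|)
    (hP2 : ∀ b, κ b ^ 2 * (fiber blk b).card * energyNorm c e s (mulOp W (θ b)) ^ 2 ≤ C)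
    (u : EuclideanSpace ℝ G) :
    energyNorm c e s (mulOp W (blockCorr blk θ m mbar u)) ^ 2 ≤
      Mu * C / s * energyNorm c e s (mulOp ω u) ^ 2 := by
  set g : Bk → ℝ := fun b => blockSum blk b (mulOp (fun x => m x - mbar (blk x)) u) with hg
  have hexp : mulOp W (blockCorr blk θ m mbar u) = ∑ b, g b • mulOp W (θ b) := by
    simp only [blockCorr, profileLift, map_sum, map_smul, hg]
  have hE2 := energyNorm_sq_sum_le_mult c e hs.le (fun b => g b • mulOp W (θ b)) S (Mu := Mu)
    (fun b x hx => by
      refine ⟨?_, fun i => ?_⟩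
      · simp [mulOp_apply, (hSθ b x hx).1]
      · simp [mulOp_apply, (hSθ b x hx).2 i]) hM
  have hgb : ∀ b, g b ^ 2 ≤ κ b ^ 2 * (fiber blk b).card * ∑ x ∈ fiber blk b, (ω x * u x) ^ 2 := by
    intro b
    have h1 : |g b| ≤ κ b * ∑ x ∈ fiber blk b, |ω x * u x| := by
      simp only [hg, blockSum_apply, mulOp_apply]
      refine (Finset.abs_sum_le_sum_abs _ _).trans ?_
      rw [Finset.mul_sum]
      refine Finset.sum_le_sum fun x hx => ?_
      have hb : blk x = b := mem_fiber.mp hx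
      rw [abs_mul]
      calc |m x - mbar (blk x)| * |u x| ≤ κ (blk x) * |ω x| * |u x| :=
            mul_le_mul_of_nonneg_right (hdata x) (abs_nonneg _)
        _ = κ b * |ω x * u x| := by rw [hb, abs_mul]; ring
    have h2 : (∑ x ∈ fiber blk b, |ω x * u x|) ^ 2 ≤ (fiber blk b).card * ∑ x ∈ fiber blk b, (ω x * u x) ^ 2 := by
      have := sq_sum_le_card_mul_sum_sq (s := fiber blk b) (f := fun x => |ω x * u x|)
      simpa only [sq_abs] using this
    calc g b ^ 2 = |g b| ^ 2 := (sq_abs _).symm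
      _ ≤ (κ b * ∑ x ∈ fiber blk b, |ω x * u x|) ^ 2 := pow_le_pow_left₀ (abs_nonneg _) h1 2
      _ = κ b ^ 2 * (∑ x ∈ fiber blk b, |ω x * u x|) ^ 2 := by ring
      _ ≤ κ b ^ 2 * ((fiber blk b).card * ∑ x ∈ fiber blk b, (ω x * u x) ^ 2) :=
          mul_le_mul_of_nonneg_left h2 (sq_nonneg _)
      _ = _ := by ring
  have hsum : ∑ b, energyNorm c e s (g b • mulOp W (θ b)) ^ 2 ≤ C * ∑ x, (ω x * u x) ^ 2 := by
    calc ∑ b, energyNorm c e s (g b • mulOp W (θ b)) ^ 2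
        = ∑ b, g b ^ 2 * energyNorm c e s (mulOp W (θ b)) ^ 2 :=
          Finset.sum_congr rfl fun b _ => energyNorm_smul c e hs.le _ _
      _ ≤ ∑ b, C * ∑ x ∈ fiber blk b, (ω x * u x) ^ 2 := Finset.sum_le_sum fun b _ => by
          calc g b ^ 2 * energyNorm c e s (mulOp W (θ b)) ^ 2
              ≤ (κ b ^ 2 * (fiber blk b).card * ∑ x ∈ fiber blk b, (ω x * u x) ^ 2) *
                  energyNorm c e s (mulOp W (θ b)) ^ 2 :=
                mul_le_mul_of_nonneg_right (hgb b) (sq_nonneg _)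
            _ = (κ b ^ 2 * (fiber blk b).card * energyNorm c e s (mulOp W (θ b)) ^ 2) *
                  ∑ x ∈ fiber blk b, (ω x * u x) ^ 2 := by ring
            _ ≤ C * ∑ x ∈ fiber blk b, (ω x * u x) ^ 2 :=
                mul_le_mul_of_nonneg_right (hP2 b) (Finset.sum_nonneg fun _ _ => sq_nonneg _)
      _ = C * ∑ x, (ω x * u x) ^ 2 := by
          rw [← Finset.mul_sum]
          congr 1
          exact Finset.sum_fiberwise Finset.univ blk (fun x => (ω x * u x) ^ 2)
  have hωu : ∑ x, (ω x * u x) ^ 2 ≤ energyNorm c e s (mulOp ω u) ^ 2 / s := by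
    rw [le_div_iff₀ hs, ← norm_sq_mulOp, mul_comm]
    exact norm_sq_le_energyNorm_sq c e hs.le _
  rw [hexp]
  calc energyNorm c e s (∑ b, g b • mulOp W (θ b)) ^ 2
      ≤ Mu * ∑ b, energyNorm c e s (g b • mulOp W (θ b)) ^ 2 := hE2
    _ ≤ Mu * (C * (energyNorm c e s (mulOp ω u) ^ 2 / s)) :=
        mul_le_mul_of_nonneg_left (hsum.trans (mul_le_mul_of_nonneg_left hωu hC)) (by positivity)
    _ = Mu * C / s * energyNorm c e s (mulOp ω u) ^ 2 := by ring

omit [AddCommGroup G] [Fintype G] [DecidableEq G] [Fintype ι] [Fintype Bk] [DecidableEq Bk] in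
/-- Block comparison of a weight from its square: |p² − q²| ≤ ϑ q² with p, q > 0, 0 ≤ ϑ < 1 gives |p − q| ≤ ϑ q and
q √(1 − ϑ) ≤ p. [folklore] -/
theorem weight_block_compare {p q ϑ : ℝ} (hp : 0 < p) (hq : 0 < q) (hϑ : 0 ≤ ϑ) (hϑ1 : ϑ < 1)
    (h : |p ^ 2 - q ^ 2| ≤ ϑ * q ^ 2) :
    |p - q| ≤ ϑ * q ∧ q * Real.sqrt (1 - ϑ) ≤ p := by
  constructor
  · have hf : |p - q| * (p + q) = |p ^ 2 - q ^ 2| := by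
      rw [← abs_of_pos (by linarith : 0 < p + q), ← abs_mul]; ring_nf
    have h1 : |p - q| * (p + q) ≤ ϑ * q * (p + q) := by
      rw [hf]
      have : 0 ≤ ϑ * q * p := by positivity
      linarith
    exact le_of_mul_le_mul_right h1 (by linarith)
  · have h1 : (1 - ϑ) * q ^ 2 ≤ p ^ 2 := by
      have := (abs_le.mp h).1; nlinarith
    have h2 : (q * Real.sqrt (1 - ϑ)) ^ 2 ≤ p ^ 2 := by
      rw [mul_pow, Real.sq_sqrt (by linarith)]; linarith
    exact (abs_le_of_sq_le_sq' h2 hp.le).2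

/-- GENERIC ASSEMBLED THEOREM (items (δ1)+(δ2) of the record in the block model; any finite abelian group, any block map,
any exact profile family).  Data: the model form B = latticeForm c e s (s > 0) in its ENERGY gauge N; a positive weight ω
with |c∇_i ω| ≤ μω at both ends of every bond and BLOCK NEAR-CONSTANCY |ω² − ω̄_b²| ≤ ϑ ω̄_b² (0 ≤ ϑ < 1); an exact
profile family θ whose members with their shifts live on sets S_b of multiplicity ≤ M, with profile energies
#b · N(θ_b)² ≤ C_u and #b · ω̄_b² · N(ω⁻¹ θ_b)² ≤ C_w; a weak solution u ∈ T_Q of B(u, ·) = J on T_Q whose source has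
weighted dual gauge ρ (|J(ωv)| ≤ ρ N(v)).  Conclusion: for any θ₁ ∈ [0, 1], θ₂ ≥ 0 with θ₁² ≥ M ϑ² C_u/((1−ϑ)s),
θ₂² ≥ M ϑ² C_w/((1−ϑ)s) and positive denominator,
N(ωu) ≤ ρ(1 + θ₂)/((1−θ₁)² − θ₁(2+θ₁) − #ι·μ²/s − (1 + μ√(#ι/s))² θ₂).
Proof = `agmon_constrained_tangent_dual` with m = Λ = 1 (energy gauge), κ = #ι·μ²/s
(`latticeForm_conjugationDefect_energy`), Λ_w = (1 + μ√(#ι/s))² (`latticeForm_weighted_continuity`), N′ = N ∘ ω⁻¹,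
c₁ = blockCorr ω ω̄, c₂ = blockCorr ω² ω̄² (`mulOp_sub_blockCorr_mem`, `blockCorr_energy_le`, `weight_block_compare`).
HONEST SCOPE: in the energy gauge of B itself coercivity is global (m = 1); the tangent-only coercivity of
`agmon_constrained_tangent` is exercised abstractly, not by this instance. [folklore]
[cite: Balaban1985Variational, (79)–(84) p. 290, (115) p. 294, (116)–(117) p. 295 (context)] -/
theorem constrained_lattice_agmon (c : ℝ) (e : ι → G) {s μ ϑ Cu Cw θ₁ θ₂ ρ : ℝ} (hs : 0 < s)
    (ω : G → ℝ) (hpos : ∀ x, 0 < ω x) (hμ : 0 ≤ μ)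
    (hω : ∀ i x, c ^ 2 * (ω (x + e i) - ω x) ^ 2 ≤ μ ^ 2 * ω x ^ 2 ∧
      c ^ 2 * (ω (x + e i) - ω x) ^ 2 ≤ μ ^ 2 * ω (x + e i) ^ 2)
    (blk : G → Bk) (ωbar : Bk → ℝ) (hωbar : ∀ b, 0 < ωbar b) (hϑ : 0 ≤ ϑ) (hϑ1 : ϑ < 1)
    (hW1 : ∀ x, |ω x ^ 2 - ωbar (blk x) ^ 2| ≤ ϑ * ωbar (blk x) ^ 2)
    (θ : Bk → EuclideanSpace ℝ G) (hθ : ProfileExact blk θ) (S : Bk → Finset G) {Mu : ℕ}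
    (hSθ : ∀ b x, x ∉ S b → θ b x = 0 ∧ ∀ i, θ b (x + e i) = 0)
    (hM : ∀ x, (Finset.univ.filter (fun b => x ∈ S b)).card ≤ Mu)
    (hCu : 0 ≤ Cu) (hCw : 0 ≤ Cw)
    (hP2u : ∀ b, ((fiber blk b).card : ℝ) * energyNorm c e s (θ b) ^ 2 ≤ Cu)
    (hP2w : ∀ b, ((fiber blk b).card : ℝ) * ωbar b ^ 2 *
      energyNorm c e s (mulOp (fun x => (ω x)⁻¹) (θ b)) ^ 2 ≤ Cw)
    (hθ₁0 : 0 ≤ θ₁) (hθ₁1 : θ₁ ≤ 1) (hθ₂0 : 0 ≤ θ₂)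
    (hθ₁ : Mu * (ϑ ^ 2 / (1 - ϑ) * Cu) / s ≤ θ₁ ^ 2) (hθ₂ : Mu * (ϑ ^ 2 / (1 - ϑ) * Cw) / s ≤ θ₂ ^ 2)
    (hden : Fintype.card ι * μ ^ 2 / s + (1 + μ * Real.sqrt (Fintype.card ι / s)) ^ 2 * θ₂
      + θ₁ * (2 + θ₁) < (1 - θ₁) ^ 2)
    {u : EuclideanSpace ℝ G} (hu : u ∈ blockTangent blk) (J : EuclideanSpace ℝ G →ₗ[ℝ] ℝ) (hρ : 0 ≤ ρ)
    (hweak : ∀ v ∈ blockTangent blk, latticeForm c e s u v = J v)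
    (hJ : ∀ v, |J (mulOp ω v)| ≤ ρ * energyNorm c e s v) :
    energyNorm c e s (mulOp ω u) ≤ (ρ + ρ * θ₂) /
      ((1 - θ₁) ^ 2 - θ₁ * (2 + θ₁) - Fintype.card ι * μ ^ 2 / s
        - (1 + μ * Real.sqrt (Fintype.card ι / s)) ^ 2 * θ₂) := by
  have hs0 := hs.le
  have hsq1 : 0 < Real.sqrt (1 - ϑ) := Real.sqrt_pos.mpr (by linarith)
  -- the two corrections
  set c₁ := blockCorr blk θ ω ωbar u with hc₁def
  set c₂ := blockCorr blk θ (fun x => ω x ^ 2) (fun b => ωbar b ^ 2) u with hc₂def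
  have hc₁T : mulOp ω u - c₁ ∈ blockTangent blk := mulOp_sub_blockCorr_mem hθ _ _ hu
  have hc₂T : mulOp ω (mulOp ω u) - c₂ ∈ blockTangent blk := by
    rw [mulOp_mulOp]; exact mulOp_sub_blockCorr_mem hθ _ _ hu
  -- correction bounds
  have hdata1 : ∀ x, |ω x - ωbar (blk x)| ≤ ϑ / Real.sqrt (1 - ϑ) * |ω x| := by
    intro x
    have hwc := weight_block_compare (hpos x) (hωbar (blk x)) hϑ hϑ1 (hW1 x)
    rw [abs_of_pos (hpos x)]
    calc |ω x - ωbar (blk x)| ≤ ϑ * ωbar (blk x) := hwc.1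
      _ = ϑ / Real.sqrt (1 - ϑ) * (ωbar (blk x) * Real.sqrt (1 - ϑ)) := by field_simp
      _ ≤ ϑ / Real.sqrt (1 - ϑ) * ω x := mul_le_mul_of_nonneg_left hwc.2 (by positivity)
  have hdata2 : ∀ x, |ω x ^ 2 - ωbar (blk x) ^ 2| ≤ ϑ * ωbar (blk x) / Real.sqrt (1 - ϑ) * |ω x| := by
    intro x
    have hwc := weight_block_compare (hpos x) (hωbar (blk x)) hϑ hϑ1 (hW1 x)
    rw [abs_of_pos (hpos x)]
    calc |ω x ^ 2 - ωbar (blk x) ^ 2| ≤ ϑ * ωbar (blk x) ^ 2 := hW1 x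
      _ = ϑ * ωbar (blk x) / Real.sqrt (1 - ϑ) * (ωbar (blk x) * Real.sqrt (1 - ϑ)) := by field_simp
      _ ≤ ϑ * ωbar (blk x) / Real.sqrt (1 - ϑ) * ω x :=
          mul_le_mul_of_nonneg_left hwc.2 (by have := (hωbar (blk x)).le; positivity)
  have h1ϑ : 0 ≤ 1 - ϑ := by linarith
  have h0 : 0 ≤ ϑ ^ 2 / (1 - ϑ) := by positivity
  have hE1 := blockCorr_energy_le c e hs blk θ S hSθ hM (fun _ => (1:ℝ)) ω ωbar ω (fun _ => ϑ / Real.sqrt (1 - ϑ))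
    (C := ϑ ^ 2 / (1 - ϑ) * Cu) (by positivity) hdata1 (fun b => by
      rw [mulOp_one', div_pow, Real.sq_sqrt h1ϑ]
      have := hP2u b
      calc ϑ ^ 2 / (1 - ϑ) * (fiber blk b).card * energyNorm c e s (θ b) ^ 2
          = ϑ ^ 2 / (1 - ϑ) * ((fiber blk b).card * energyNorm c e s (θ b) ^ 2) := by ring
        _ ≤ ϑ ^ 2 / (1 - ϑ) * Cu := mul_le_mul_of_nonneg_left this h0) u
  rw [mulOp_one'] at hE1
  have hE2 := blockCorr_energy_le c e hs blk θ S hSθ hM (fun x => (ω x)⁻¹) (fun x => ω x ^ 2)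
    (fun b => ωbar b ^ 2) ω (fun b => ϑ * ωbar b / Real.sqrt (1 - ϑ))
    (C := ϑ ^ 2 / (1 - ϑ) * Cw) (by positivity) hdata2 (fun b => by
      rw [div_pow, mul_pow, Real.sq_sqrt h1ϑ]
      have := hP2w b
      calc (ϑ ^ 2 * ωbar b ^ 2 / (1 - ϑ)) * (fiber blk b).card *
            energyNorm c e s (mulOp (fun x => (ω x)⁻¹) (θ b)) ^ 2
          = ϑ ^ 2 / (1 - ϑ) * ((fiber blk b).card * ωbar b ^ 2 *
            energyNorm c e s (mulOp (fun x => (ω x)⁻¹) (θ b)) ^ 2) := by ring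
        _ ≤ ϑ ^ 2 / (1 - ϑ) * Cw := mul_le_mul_of_nonneg_left this h0) u
  have hN := energyNorm_nonneg c e s (mulOp ω u)
  have hc₁ : energyNorm c e s c₁ ≤ θ₁ * energyNorm c e s (mulOp ω u) := by
    have h1 : energyNorm c e s c₁ ^ 2 ≤ (θ₁ * energyNorm c e s (mulOp ω u)) ^ 2 := by
      rw [mul_pow]
      exact hE1.trans (mul_le_mul_of_nonneg_right hθ₁ (sq_nonneg _))
    exact (abs_le_of_sq_le_sq' h1 (by positivity)).2
  have hc₂ : energyNorm c e s (mulOp (fun x => (ω x)⁻¹) c₂) ≤ θ₂ * energyNorm c e s (mulOp ω u) := by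
    have h1 : energyNorm c e s (mulOp (fun x => (ω x)⁻¹) c₂) ^ 2 ≤ (θ₂ * energyNorm c e s (mulOp ω u)) ^ 2 := by
      rw [mul_pow]
      exact hE2.trans (mul_le_mul_of_nonneg_right hθ₂ (sq_nonneg _))
    exact (abs_le_of_sq_le_sq' h1 (by positivity)).2
  -- invoke the abstract theorem
  have key := agmon_constrained_tangent_dual (latticeForm c e s) (mulOp ω) (blockTangent blk)
    (energyNorm c e s) (fun h => energyNorm c e s (mulOp (fun x => (ω x)⁻¹) h)) J
    (m := 1) (Λ := 1) (Λw := (1 + μ * Real.sqrt (Fintype.card ι / s)) ^ 2)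
    (κ := Fintype.card ι * μ ^ 2 / s) (θ₁ := θ₁) (θ₂ := θ₂) (ρ := ρ)
    (by linarith) zero_le_one zero_le_one (by positivity) hθ₁0 hθ₁1 hθ₂0 hρ
    (fun v _ => by rw [one_mul, energyNorm_sq c e hs0])
    (fun v h => by rw [one_mul]; exact latticeForm_abs_le c e hs0 v h)
    (energyNorm_sub_rev c e hs0) (energyNorm_nonneg c e s)
    (latticeForm_conjugationDefect_energy c e hs ω hω)
    (u := u) (c₁ := c₁) (c₂ := c₂)
    (fun h => by
      have := latticeForm_weighted_continuity c e hs ω hpos hμ hω u h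
      simpa only [mul_assoc] using this)
    (fun h => by
      have := hJ (mulOp (fun x => (ω x)⁻¹) h)
      rwa [mulOp_mul_inv ω hpos] at this)
    hc₁T hc₂T hc₁ hc₂ hweak hJ
  simpa only [one_mul] using key

end BlockEnergy

/-! #### §8g.4 The one-dimensional instance: K blocks of n sites on the cycle `Fin (K * n)`, in-block parabola profiles,
every constant uniform in n and K (`constrained_lattice_agmon_1D`). -/

section OneD

variable {K n : ℕ}

/-- The in-block PARABOLA PROFILE h(j) = 6 j (n − 1 − j)/((n − 1)(n − 2)) (n ≥ 3): zero at both block ends (so its lift has NO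
FACE JUMPS — the block indicator 1_b/n has energy ≍ 1 per block from its two face jumps, not ≍ 1/n, record dead end),
Σ_{j<n} h(j) = n, 0 ≤ h ≤ 3, |h(j+1) − h(j)| ≤ 12/n. [folklore] -/
def hprof (n : ℕ) (j : ℕ) : ℝ := 6 * (j : ℝ) * ((n : ℝ) - 1 - j) / (((n : ℝ) - 1) * ((n : ℝ) - 2))

/-- h(0) = 0 (entrance face). [folklore] -/
theorem hprof_zero : hprof n 0 = 0 := by simp [hprof]

/-- h(n − 1) = 0 (exit face). [folklore] -/
theorem hprof_last (hn : 1 ≤ n) : hprof n (n - 1) = 0 := by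
  simp [hprof, Nat.cast_sub hn]

/-- 0 ≤ h(j) ≤ 3 for j < n, n ≥ 3 (AM–GM: j(n−1−j) ≤ (n−1)²/4 and (n−1)/(n−2) ≤ 2). [folklore] -/
theorem hprof_bounds (hn : 3 ≤ n) {j : ℕ} (hj : j < n) : 0 ≤ hprof n j ∧ hprof n j ≤ 3 := by
  have hN : (3:ℝ) ≤ n := by exact_mod_cast hn
  have hj' : (j:ℝ) + 1 ≤ n := by exact_mod_cast hj
  have h1 : (0:ℝ) < n - 1 := by linarith
  have h2 : (0:ℝ) < n - 2 := by linarith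
  have hden : 0 < ((n:ℝ) - 1) * ((n:ℝ) - 2) := mul_pos h1 h2
  unfold hprof
  constructor
  · apply div_nonneg _ hden.le
    have : 0 ≤ (n:ℝ) - 1 - j := by linarith
    positivity
  · rw [div_le_iff₀ hden]
    nlinarith [sq_nonneg ((n:ℝ) - 1 - 2 * j), mul_nonneg h1.le (by linarith : (0:ℝ) ≤ n - 3)]

/-- h(j+1) − h(j) = 6(n − 2 − 2j)/((n−1)(n−2)). [folklore] -/
theorem hprof_succ_sub (hn : 3 ≤ n) (j : ℕ) :
    hprof n (j + 1) - hprof n j = 6 * ((n:ℝ) - 2 - 2 * j) / (((n:ℝ) - 1) * ((n:ℝ) - 2)) := by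
  have hN : (3:ℝ) ≤ n := by exact_mod_cast hn
  have h1 : (n:ℝ) - 1 ≠ 0 := by linarith
  have h2 : (n:ℝ) - 2 ≠ 0 := by linarith
  unfold hprof
  push_cast
  field_simp
  ring

/-- |h(j+1) − h(j)| ≤ 12/n for j + 1 < n, n ≥ 3. [folklore] -/
theorem abs_hprof_succ_sub (hn : 3 ≤ n) {j : ℕ} (hj : j + 1 < n) :
    |hprof n (j + 1) - hprof n j| ≤ 12 / n := by
  have hN : (3:ℝ) ≤ n := by exact_mod_cast hn
  have hj' : (j:ℝ) + 2 ≤ n := by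
    have : j + 2 ≤ n := hj
    exact_mod_cast this
  have h1 : (0:ℝ) < n - 1 := by linarith
  have h2 : (0:ℝ) < n - 2 := by linarith
  have hden : 0 < ((n:ℝ) - 1) * ((n:ℝ) - 2) := mul_pos h1 h2
  rw [hprof_succ_sub hn, abs_div, abs_of_pos hden, div_le_div_iff₀ hden (by linarith)]
  have hab : |6 * ((n:ℝ) - 2 - 2 * j)| ≤ 6 * ((n:ℝ) - 2) := by
    rw [abs_le]; constructor <;> nlinarith [(Nat.cast_nonneg j : (0:ℝ) ≤ j)]
  nlinarith [hab]

/-- EXACT MASS: Σ_{j<n} h(j) = n (n ≥ 3), so θ_b = h/n has block sum exactly 1. [folklore] -/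
theorem sum_hprof (hn : 3 ≤ n) : ∑ j : Fin n, hprof n j = n := by
  have hN : (3:ℝ) ≤ n := by exact_mod_cast hn
  have hden : ((n:ℝ) - 1) * ((n:ℝ) - 2) ≠ 0 := by
    apply mul_ne_zero <;> linarith
  rw [Fin.sum_univ_eq_sum_range (fun j => hprof n j) n]
  simp only [hprof]
  rw [← Finset.sum_div, div_eq_iff hden]
  have : ∑ j ∈ Finset.range n, 6 * (j:ℝ) * ((n:ℝ) - 1 - j) =
      6 * (((n:ℝ) - 1) * ∑ j ∈ Finset.range n, (j:ℝ) - ∑ j ∈ Finset.range n, (j:ℝ) ^ 2) := by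
    rw [Finset.mul_sum, ← Finset.sum_sub_distrib, Finset.mul_sum]
    exact Finset.sum_congr rfl fun j _ => by ring
  have hid : ∀ m : ℕ, ∑ j ∈ Finset.range m, (j : ℝ) = m * (m - 1) / 2 := by
    intro m
    induction m with
    | zero => simp
    | succ m ih => rw [Finset.sum_range_succ, ih]; push_cast; ring
  have hsq : ∀ m : ℕ, ∑ j ∈ Finset.range m, (j : ℝ) ^ 2 = m * (m - 1) * (2 * m - 1) / 6 := by
    intro m
    induction m with
    | zero => simp
    | succ m ih => rw [Finset.sum_range_succ, ih]; push_cast; ring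
  rw [this, hid, hsq]; ring

/-! Coordinates on `Fin (K * n)`: block index `Fin.divNat`, position `Fin.modNat`. -/

/-- Block coordinate of the site (b, j) of Z/(Kn) ≅ blocks × positions. [folklore] -/
theorem divNat_finProdFinEquiv (b : Fin K) (j : Fin n) : (finProdFinEquiv (b, j)).divNat = b := by
  have := finProdFinEquiv.symm_apply_apply (b, j)
  rw [finProdFinEquiv_symm_apply] at this
  exact (Prod.ext_iff.mp this).1

/-- Position coordinate of the site (b, j). [folklore] -/
theorem modNat_finProdFinEquiv (b : Fin K) (j : Fin n) : (finProdFinEquiv (b, j)).modNat = j := by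
  have := finProdFinEquiv.symm_apply_apply (b, j)
  rw [finProdFinEquiv_symm_apply] at this
  exact (Prod.ext_iff.mp this).2

/-- The block b of Z/(Kn) is the image of the positions under j ↦ (b, j). [folklore] -/
theorem fiber_divNat_eq_image (b : Fin K) :
    fiber (Fin.divNat : Fin (K * n) → Fin K) b =
      (Finset.univ : Finset (Fin n)).image (fun j => finProdFinEquiv (b, j)) := by
  ext x
  simp only [mem_fiber, Finset.mem_image, Finset.mem_univ, true_and]
  constructor
  · intro h
    refine ⟨x.modNat, ?_⟩
    have := finProdFinEquiv.apply_symm_apply x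
    rwa [finProdFinEquiv_symm_apply, h] at this
  · rintro ⟨j, rfl⟩
    exact divNat_finProdFinEquiv b j

/-- j ↦ (b, j) is injective. [folklore] -/
theorem finProdFinEquiv_injective_right (b : Fin K) :
    Function.Injective (fun j : Fin n => finProdFinEquiv (b, j)) := by
  intro j j' h
  exact (Prod.ext_iff.mp (finProdFinEquiv.injective h)).2

/-- A sum over block b is a sum over the n positions. [folklore] -/
theorem sum_fiber_divNat (b : Fin K) (f : Fin (K * n) → ℝ) :
    ∑ x ∈ fiber Fin.divNat b, f x = ∑ j : Fin n, f (finProdFinEquiv (b, j)) := by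
  rw [fiber_divNat_eq_image, Finset.sum_image fun j _ j' _ h => finProdFinEquiv_injective_right b h]

/-- Every block has exactly n sites (dictionary: L^k sites of the η-lattice per unit interval). [folklore] -/
theorem card_fiber_divNat (b : Fin K) : (fiber (Fin.divNat : Fin (K * n) → Fin K) b).card = n := by
  rw [fiber_divNat_eq_image, Finset.card_image_of_injective _ (finProdFinEquiv_injective_right b),
    Finset.card_univ, Fintype.card_fin]

/-- Blocks are disjoint: a site lies in exactly one block (multiplicity M = 1 for in-block profiles). [folklore] -/
theorem filter_mem_fiber_divNat (x : Fin (K * n)) :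
    (Finset.univ.filter (fun b => x ∈ fiber Fin.divNat b)) = {x.divNat} := by
  ext b; simp [mem_fiber, eq_comm]

/-- The ONE-DIMENSIONAL PROFILE FAMILY θ_b(x) = h(pos x)/n on block b, 0 elsewhere: an exact finite-range right inverse of the
block-sum map (`theta_profileExact`) supported INSIDE block b (`theta_support`, multiplicity 1), with sup ≤ 3/n
(`abs_theta_le`), mesh gradient n|∇θ_b| ≤ 12/n including both faces (`abs_diff_theta_le`), hence profile energy
n · N(θ_b)² ≤ 144 + 9s uniformly in n and K (`theta_energy_le`). [folklore] -/
def theta (n : ℕ) (b : Fin K) : EuclideanSpace ℝ (Fin (K * n)) :=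
  WithLp.toLp 2 (fun x => if x.divNat = b then hprof n x.modNat / n else 0)

/-- Evaluation of θ_b. [folklore] -/
theorem theta_apply (b : Fin K) (x : Fin (K * n)) :
    theta n b x = if x.divNat = b then hprof n x.modNat / n else 0 := rfl

/-- EXACTNESS: the block sums of θ_b are δ_{b b′} (`sum_hprof`). [folklore] -/
theorem theta_profileExact (hn : 3 ≤ n) : ProfileExact (Fin.divNat : Fin (K * n) → Fin K) (theta n) := by
  intro b b'
  rw [blockSum_apply, sum_fiber_divNat]
  simp only [theta_apply, divNat_finProdFinEquiv, modNat_finProdFinEquiv]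
  by_cases h : b' = b
  · subst h
    have hn0 : (n:ℝ) ≠ 0 := by exact_mod_cast (show n ≠ 0 by omega)
    simp only [↓reduceIte]
    rw [← Finset.sum_div, sum_hprof hn, div_self hn0]
  · simp [h, Ne.symm h]

/-- SUP BOUND: |θ_b| ≤ 3/n. [folklore] -/
theorem abs_theta_le (hn : 3 ≤ n) (b : Fin K) (x : Fin (K * n)) : |theta n b x| ≤ 3 / n := by
  have hN3 : (3:ℝ) ≤ n := by exact_mod_cast hn
  have hN : (0:ℝ) < n := by linarith
  rw [theta_apply]
  by_cases h : x.divNat = b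
  · have hb := hprof_bounds hn x.modNat.isLt
    rw [if_pos h, abs_of_nonneg (div_nonneg hb.1 hN.le)]
    exact div_le_div_of_nonneg_right hb.2 hN.le
  · rw [if_neg h, abs_zero]; positivity

variable [NeZero K] [NeZero n]

/-- The generator 1 of Z/(Kn) has value 1 when Kn > 1. [folklore] -/
theorem one_val_eq (hKn : 1 < K * n) : ((1 : Fin (K * n)) : ℕ) = 1 := by
  rw [Fin.val_one', Nat.mod_eq_of_lt hKn]

/-- Successor in block coordinates: the position of x + 1 is (pos x + 1) mod n. [folklore] -/
theorem modNat_add_one (hKn : 1 < K * n) (h1n : 1 < n) (x : Fin (K * n)) :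
    ((x + 1).modNat : ℕ) = ((x.modNat : ℕ) + 1) % n := by
  rw [Fin.coe_modNat, Fin.coe_modNat, Fin.val_add, one_val_eq hKn, Nat.mod_mul_left_mod, Nat.add_mod,
    Nat.mod_eq_of_lt h1n]

/-- Successor inside a block: if pos x + 1 < n then x + 1 lies in the same block. [folklore] -/
theorem divNat_add_one_of_lt (hKn : 1 < K * n) (x : Fin (K * n)) (h : (x.modNat : ℕ) + 1 < n) :
    (x + 1).divNat = x.divNat := by
  apply Fin.ext
  rw [Fin.coe_divNat, Fin.coe_divNat, Fin.val_add, one_val_eq hKn]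
  have hq : (x : ℕ) / n < K := x.divNat.isLt
  have hx : (x : ℕ) % n + 1 < n := h
  have hdm := Nat.div_add_mod (x : ℕ) n
  have h1 : n * ((x : ℕ) / n + 1) ≤ n * K := Nat.mul_le_mul_left n hq
  have hlt : (x : ℕ) + 1 < K * n := by nlinarith
  rw [Nat.mod_eq_of_lt hlt]
  apply Nat.div_eq_of_lt_le
  · exact (Nat.div_mul_le_self _ _).trans (Nat.le_succ _)
  · have hdm' : (x : ℕ) / n * n + (x : ℕ) % n = x := by rw [Nat.mul_comm]; exact hdm
    calc (x : ℕ) + 1 = (x : ℕ) / n * n + ((x : ℕ) % n + 1) := by omega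
      _ < (x : ℕ) / n * n + n := by omega
      _ = ((x : ℕ) / n + 1) * n := by ring

/-- If x + 1 lies in another block than x, then pos x = n − 1 (x is the exit face of its block). [folklore] -/
theorem modNat_eq_last_of_exit (hKn : 1 < K * n) (x : Fin (K * n)) (h : (x + 1).divNat ≠ x.divNat) :
    (x.modNat : ℕ) = n - 1 := by
  have h1 : ¬ ((x.modNat : ℕ) + 1 < n) := fun h' => h (divNat_add_one_of_lt hKn x h')
  have h2 : (x.modNat : ℕ) < n := x.modNat.isLt
  omega

/-- … and then x + 1 has position 0 (the entrance face of the next block). [folklore] -/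
theorem modNat_add_one_of_exit (hKn : 1 < K * n) (h1n : 1 < n) (x : Fin (K * n))
    (h : (x + 1).divNat ≠ x.divNat) : ((x + 1).modNat : ℕ) = 0 := by
  rw [modNat_add_one hKn h1n, modNat_eq_last_of_exit hKn x h, Nat.sub_add_cancel h1n.le, Nat.mod_self]

/-- LOCALISATION: θ_b and its forward shift vanish at every site outside block b (the shift re-enters only through an
entrance face, where h(0) = 0). [folklore] -/
theorem theta_support (hKn : 1 < K * n) (h1n : 1 < n) (b : Fin K) (x : Fin (K * n))
    (hx : x ∉ fiber Fin.divNat b) :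
    theta n b x = 0 ∧ ∀ _i : Fin 1, theta n b (x + 1) = 0 := by
  rw [mem_fiber] at hx
  refine ⟨by simp [theta_apply, hx], fun _ => ?_⟩
  rw [theta_apply]
  by_cases h' : (x + 1).divNat = b
  · have hne : (x + 1).divNat ≠ x.divNat := by rw [h']; exact Ne.symm hx
    have h0 : ((x + 1).modNat : ℕ) = 0 := modNat_add_one_of_exit hKn h1n x hne
    rw [if_pos h', h0, hprof_zero, zero_div]
  · rw [if_neg h']

/-- MESH-GRADIENT BOUND: n · |θ_b(x + 1) − θ_b(x)| ≤ 12/n at every site — interior bonds by `abs_hprof_succ_sub`, the exit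
bond because h(n − 1) = 0 matches the value 0 outside, bonds off the block trivially. [folklore] -/
theorem abs_diff_theta_le (hn : 3 ≤ n) (b : Fin K) (x : Fin (K * n)) :
    |(n:ℝ) * (theta n b (x + 1) - theta n b x)| ≤ 12 / n := by
  have hN3 : (3:ℝ) ≤ n := by exact_mod_cast hn
  have hN : (0:ℝ) < n := by linarith
  have h1n : 1 < n := by omega
  have hKn : 1 < K * n := lt_of_lt_of_le h1n (Nat.le_mul_of_pos_left n (NeZero.pos K))
  by_cases hb : x.divNat = b
  · by_cases hj : (x.modNat : ℕ) + 1 < n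
    · have hd := divNat_add_one_of_lt hKn x hj
      have hm : ((x + 1).modNat : ℕ) = (x.modNat : ℕ) + 1 := by
        rw [modNat_add_one hKn h1n, Nat.mod_eq_of_lt hj]
      rw [theta_apply, theta_apply, hd, if_pos hb, if_pos hb, hm, ← sub_div, mul_div_cancel₀ _ hN.ne']
      exact abs_hprof_succ_sub hn hj
    · -- exit of the block: both values vanish
      have hlast : (x.modNat : ℕ) = n - 1 := by have := x.modNat.isLt; omega
      have hx0 : theta n b x = 0 := by rw [theta_apply, if_pos hb, hlast, hprof_last h1n.le, zero_div]
      have hx1 : theta n b (x + 1) = 0 := by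
        rw [theta_apply]
        by_cases h' : (x + 1).divNat = b
        · have hm0 : ((x + 1).modNat : ℕ) = 0 := by
            rw [modNat_add_one hKn h1n, hlast, Nat.sub_add_cancel h1n.le, Nat.mod_self]
          rw [if_pos h', hm0, hprof_zero, zero_div]
        · rw [if_neg h']
      rw [hx0, hx1]; simp; positivity
  · have hs := theta_support hKn h1n b x (by rwa [mem_fiber])
    rw [hs.1, hs.2 0]; simp; positivity

/-- PROFILE ENERGY (hypothesis `hP2u` with C_u = 144 + 9s): #b · N(θ_b)² ≤ n · n · ((12/n)² + s (3/n)²) = 144 + 9s, uniformly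
in n and K. [folklore] -/
theorem theta_energy_le (hn : 3 ≤ n) {s : ℝ} (hs : 0 ≤ s) (b : Fin K) :
    ((fiber (Fin.divNat : Fin (K * n) → Fin K) b).card : ℝ) *
      energyNorm (n : ℝ) (fun _ : Fin 1 => (1 : Fin (K * n))) s (theta n b) ^ 2 ≤ 144 + 9 * s := by
  have hN3 : (3:ℝ) ≤ n := by exact_mod_cast hn
  have hN : (0:ℝ) < n := by linarith
  have h1n : 1 < n := by omega
  have hKn : 1 < K * n := lt_of_lt_of_le h1n (Nat.le_mul_of_pos_left n (NeZero.pos K))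
  have hE := energyNorm_sq_le_of_support (n : ℝ) (fun _ : Fin 1 => (1 : Fin (K * n))) hs (theta n b)
    (fiber Fin.divNat b) (a := 3 / n) (ℓ := 12 / n) (theta_support hKn h1n b) (abs_theta_le hn b)
    (fun _ x => abs_diff_theta_le hn b x)
  rw [card_fiber_divNat, Fintype.card_fin] at hE
  simp only [Nat.cast_one, one_mul] at hE
  rw [card_fiber_divNat]
  calc (n : ℝ) * energyNorm (n : ℝ) (fun _ : Fin 1 => (1 : Fin (K * n))) s (theta n b) ^ 2
      ≤ n * (n * ((12 / n) ^ 2 + s * (3 / n) ^ 2)) := mul_le_mul_of_nonneg_left hE hN.le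
    _ = 144 + 9 * s := by field_simp; ring

/-- WEIGHTED PROFILE ENERGY (hypothesis `hP2w` with C_w = ((12 + 3μ)² + 9s)/(1 − ϑ)): #b · ω̄_b² · N(ω⁻¹ θ_b)² ≤
((12 + 3μ)² + 9s)/(1 − ϑ), uniformly in n and K — on block b, ω ≥ ω̄_b √(1−ϑ) (`weight_block_compare`), the mesh
gradient of ω⁻¹θ_b is ≤ (12 + 3μ)/(n ω_min,b) by the Leibniz rule (n|∇θ_b| ≤ 12/n, |θ_b| ≤ 3/n, and
n|ω(x+1)⁻¹ − ω(x)⁻¹| ≤ μ ω(x)⁻¹ from the mesh-Lipschitz bound at the far end; the exit bond carries θ_b = 0 at both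
ends), and |ω⁻¹θ_b| ≤ 3/(n ω_min,b). [folklore] -/
theorem theta_weighted_energy_le (hn : 3 ≤ n) {s μ ϑ : ℝ} (hs : 0 ≤ s) (hμ : 0 ≤ μ)
    (ω : Fin (K * n) → ℝ) (hpos : ∀ x, 0 < ω x)
    (hω : ∀ x, (n : ℝ) ^ 2 * (ω (x + 1) - ω x) ^ 2 ≤ μ ^ 2 * ω x ^ 2 ∧
      (n : ℝ) ^ 2 * (ω (x + 1) - ω x) ^ 2 ≤ μ ^ 2 * ω (x + 1) ^ 2)
    (ωbar : Fin K → ℝ) (hωbar : ∀ b, 0 < ωbar b) (hϑ : 0 ≤ ϑ) (hϑ1 : ϑ < 1)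
    (hW1 : ∀ x, |ω x ^ 2 - ωbar x.divNat ^ 2| ≤ ϑ * ωbar x.divNat ^ 2) (b : Fin K) :
    ((fiber (Fin.divNat : Fin (K * n) → Fin K) b).card : ℝ) * ωbar b ^ 2 *
      energyNorm (n : ℝ) (fun _ : Fin 1 => (1 : Fin (K * n))) s
        (mulOp (fun x => (ω x)⁻¹) (theta n b)) ^ 2 ≤ ((12 + 3 * μ) ^ 2 + 9 * s) / (1 - ϑ) := by
  have hN3 : (3:ℝ) ≤ n := by exact_mod_cast hn
  have hN : (0:ℝ) < n := by linarith
  have h1n : 1 < n := by omega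
  have hKn : 1 < K * n := lt_of_lt_of_le h1n (Nat.le_mul_of_pos_left n (NeZero.pos K))
  have h1ϑ : 0 < 1 - ϑ := by linarith
  have hsq : 0 < Real.sqrt (1 - ϑ) := Real.sqrt_pos.mpr h1ϑ
  set Γ : ℝ := 1 / (ωbar b * Real.sqrt (1 - ϑ)) with hΓ
  have hΓ0 : 0 ≤ Γ := by have := (hωbar b).le; positivity
  -- on the fibre of b, ω⁻¹ ≤ Γ
  have hinv : ∀ x : Fin (K * n), x.divNat = b → (ω x)⁻¹ ≤ Γ := by
    intro x hx
    have hwc := (weight_block_compare (hpos x) (hωbar x.divNat) hϑ hϑ1 (hW1 x)).2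
    rw [hx] at hwc
    rw [hΓ, inv_eq_one_div]
    exact one_div_le_one_div_of_le (by have := hωbar b; positivity) hwc
  set F := mulOp (fun x => (ω x)⁻¹) (theta n b) with hF
  have hFx : ∀ x, F x = (ω x)⁻¹ * theta n b x := fun x => by simp [hF, mulOp_apply]
  -- support
  have hsupp : ∀ x, x ∉ fiber Fin.divNat b → F x = 0 ∧ ∀ _i : Fin 1, F (x + 1) = 0 := by
    intro x hx
    have := theta_support hKn h1n b x hx
    exact ⟨by rw [hFx, this.1, mul_zero], fun i => by rw [hFx, this.2 i, mul_zero]⟩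
  -- sup bound
  have ha : ∀ x, |F x| ≤ 3 * Γ / n := by
    intro x
    rw [hFx]
    by_cases hb : x.divNat = b
    · rw [abs_mul, abs_of_pos (inv_pos.mpr (hpos x))]
      calc (ω x)⁻¹ * |theta n b x| ≤ Γ * (3 / n) :=
            mul_le_mul (hinv x hb) (abs_theta_le hn b x) (abs_nonneg _) hΓ0
        _ = 3 * Γ / n := by ring
    · rw [theta_apply, if_neg hb, mul_zero, abs_zero]; positivity
  -- difference bound
  have hℓ : ∀ _i : Fin 1, ∀ x, |(n:ℝ) * (F (x + 1) - F x)| ≤ (12 + 3 * μ) * Γ / n := by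
    intro _ x
    have hpos0 := hpos x
    have hpos1 := hpos (x + 1)
    by_cases hb : x.divNat = b
    · by_cases hj : (x.modNat : ℕ) + 1 < n
      · have hd := divNat_add_one_of_lt hKn x hj
        have hb1 : (x + 1).divNat = b := hd.trans hb
        have hdi : |(n:ℝ) * ((ω (x + 1))⁻¹ - (ω x)⁻¹)| ≤ μ * Γ := by
          have e1 : (n:ℝ) * ((ω (x + 1))⁻¹ - (ω x)⁻¹) =
              -((n:ℝ) * (ω (x + 1) - ω x)) * ((ω x)⁻¹ * (ω (x + 1))⁻¹) := by
            field_simp; ring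
          have hnum : |(n:ℝ) * (ω (x + 1) - ω x)| ≤ μ * ω (x + 1) := by
            have : ((n:ℝ) * (ω (x + 1) - ω x)) ^ 2 ≤ (μ * ω (x + 1)) ^ 2 := by
              rw [mul_pow, mul_pow]; exact (hω x).2
            exact abs_le.mpr (abs_le_of_sq_le_sq' this (by positivity))
          rw [e1, abs_mul, abs_neg, abs_of_pos (by positivity : (0:ℝ) < (ω x)⁻¹ * (ω (x + 1))⁻¹)]
          calc |(n:ℝ) * (ω (x + 1) - ω x)| * ((ω x)⁻¹ * (ω (x + 1))⁻¹)
              ≤ μ * ω (x + 1) * ((ω x)⁻¹ * (ω (x + 1))⁻¹) :=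
                mul_le_mul_of_nonneg_right hnum (by positivity)
            _ = μ * (ω x)⁻¹ := by field_simp
            _ ≤ μ * Γ := mul_le_mul_of_nonneg_left (hinv x hb) hμ
        have heq : (n:ℝ) * (F (x + 1) - F x) =
            (ω (x + 1))⁻¹ * ((n:ℝ) * (theta n b (x + 1) - theta n b x))
            + ((n:ℝ) * ((ω (x + 1))⁻¹ - (ω x)⁻¹)) * theta n b x := by
          rw [hFx, hFx]; ring
        rw [heq]
        calc |(ω (x + 1))⁻¹ * ((n:ℝ) * (theta n b (x + 1) - theta n b x))
              + ((n:ℝ) * ((ω (x + 1))⁻¹ - (ω x)⁻¹)) * theta n b x|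
            ≤ |(ω (x + 1))⁻¹ * ((n:ℝ) * (theta n b (x + 1) - theta n b x))|
              + |((n:ℝ) * ((ω (x + 1))⁻¹ - (ω x)⁻¹)) * theta n b x| := abs_add_le _ _
          _ ≤ Γ * (12 / n) + μ * Γ * (3 / n) := by
              refine add_le_add ?_ ?_
              · rw [abs_mul, abs_of_pos (inv_pos.mpr hpos1)]
                exact mul_le_mul (hinv (x + 1) hb1) (abs_diff_theta_le hn b x) (abs_nonneg _) hΓ0
              · rw [abs_mul]
                exact mul_le_mul hdi (abs_theta_le hn b x) (abs_nonneg _) (by positivity)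
          _ = (12 + 3 * μ) * Γ / n := by ring
      · -- exit of the block: both values vanish
        have hlast : (x.modNat : ℕ) = n - 1 := by have := x.modNat.isLt; omega
        have hx0 : theta n b x = 0 := by rw [theta_apply, if_pos hb, hlast, hprof_last h1n.le, zero_div]
        have hx1 : theta n b (x + 1) = 0 := by
          rw [theta_apply]
          by_cases h' : (x + 1).divNat = b
          · have hm0 : ((x + 1).modNat : ℕ) = 0 := by
              rw [modNat_add_one hKn h1n, hlast, Nat.sub_add_cancel h1n.le, Nat.mod_self]
            rw [if_pos h', hm0, hprof_zero, zero_div]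
          · rw [if_neg h']
        rw [hFx, hFx, hx0, hx1]; simp; positivity
    · have hs' := hsupp x (by rwa [mem_fiber])
      rw [hs'.1, hs'.2 0]; simp; positivity
  have hE := energyNorm_sq_le_of_support (n : ℝ) (fun _ : Fin 1 => (1 : Fin (K * n))) hs F
    (fiber Fin.divNat b) hsupp ha hℓ
  rw [card_fiber_divNat, Fintype.card_fin] at hE
  simp only [Nat.cast_one, one_mul] at hE
  rw [card_fiber_divNat]
  have hΓ2 : ωbar b ^ 2 * Γ ^ 2 = 1 / (1 - ϑ) := by
    rw [hΓ, div_pow, mul_pow, Real.sq_sqrt h1ϑ.le]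
    have := (hωbar b).ne'
    field_simp
  calc (n:ℝ) * ωbar b ^ 2 * energyNorm (n : ℝ) (fun _ : Fin 1 => (1 : Fin (K * n))) s F ^ 2
      ≤ (n:ℝ) * ωbar b ^ 2 * (n * (((12 + 3 * μ) * Γ / n) ^ 2 + s * (3 * Γ / n) ^ 2)) :=
        mul_le_mul_of_nonneg_left hE (by positivity)
    _ = ωbar b ^ 2 * Γ ^ 2 * ((12 + 3 * μ) ^ 2 + 9 * s) := by field_simp; ring
    _ = ((12 + 3 * μ) ^ 2 + 9 * s) / (1 - ϑ) := by rw [hΓ2]; ring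

/-- THE ONE-DIMENSIONAL MODEL THEOREM (item (δ2) of the record — kernel witness that the constrained Agmon bound holds
UNIFORMLY IN THE MESH AND THE VOLUME).  Setting: the cycle Z/(Kn) = K unit blocks of n ≥ 3 sites each (dictionary:
n = L^k = η⁻¹, K = side of the torus in unit blocks), mesh derivative scaled by c = n (block = unit length), model form
B(v, v) = ‖n∇v‖² + s‖v‖² (s > 0) in its energy gauge N, block-tangent space T_Q = {block sums = 0}; a weight ω > 0 with
n|ω(x+1) − ω(x)| ≤ μ ω at both ends of every bond and |ω² − ω̄_b²| ≤ ϑ ω̄_b² on block b (0 ≤ ϑ < 1; e.g. ω = e^{−μ₀·dist}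
in block units, ϑ = e^{2μ₀} − 1); a weak solution u ∈ T_Q of B(u, v) = J v (v ∈ T_Q) with |J(ωv)| ≤ ρ N(v).  Then for
all θ₁ ∈ [0, 1], θ₂ ≥ 0 with θ₁² ≥ ϑ²(144 + 9s)/((1−ϑ)s), θ₂² ≥ ϑ²((12 + 3μ)² + 9s)/((1−ϑ)²s) and positive denominator:
N(ωu) ≤ ρ(1 + θ₂)/((1−θ₁)² − θ₁(2+θ₁) − μ²/s − (1 + μ√(1/s))² θ₂).
EVERY CONSTANT IS INDEPENDENT OF n AND K: the exponential decay of the constrained response at rate μ₀ per unit block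
survives η = 1/n → 0 and K → ∞ (for μ₀ small depending on s only).  `constrained_lattice_agmon` with the parabola
profile family `theta` (M = 1, C_u = 144 + 9s, C_w = ((12 + 3μ)² + 9s)/(1 − ϑ)).  HONEST SCOPE: d = 1; the
d-dimensional profile family (θ ⊗ block indicators, multiplicity 1) is routine but NOT done here; coercivity is the
global one of the energy gauge (see `constrained_lattice_agmon`); the gauge half of the tangent space and the
dictionary to (79)–(80) are items (δ5), (δ3) of the record, not kernel facts. [folklore]
[cite: Balaban1985Variational, (115) p. 294, (116)–(117) p. 295 (context: the fixed-point equation whose linearised,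
constrained response this models); (19)–(21) p. 281 (context: the constraints)] -/
theorem constrained_lattice_agmon_1D (hn : 3 ≤ n) {s μ ϑ θ₁ θ₂ ρ : ℝ} (hs : 0 < s) (hμ : 0 ≤ μ)
    (ω : Fin (K * n) → ℝ) (hpos : ∀ x, 0 < ω x)
    (hω : ∀ x, (n : ℝ) ^ 2 * (ω (x + 1) - ω x) ^ 2 ≤ μ ^ 2 * ω x ^ 2 ∧
      (n : ℝ) ^ 2 * (ω (x + 1) - ω x) ^ 2 ≤ μ ^ 2 * ω (x + 1) ^ 2)
    (ωbar : Fin K → ℝ) (hωbar : ∀ b, 0 < ωbar b) (hϑ : 0 ≤ ϑ) (hϑ1 : ϑ < 1)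
    (hW1 : ∀ x, |ω x ^ 2 - ωbar x.divNat ^ 2| ≤ ϑ * ωbar x.divNat ^ 2)
    (hθ₁0 : 0 ≤ θ₁) (hθ₁1 : θ₁ ≤ 1) (hθ₂0 : 0 ≤ θ₂)
    (hθ₁ : ϑ ^ 2 / (1 - ϑ) * (144 + 9 * s) / s ≤ θ₁ ^ 2)
    (hθ₂ : ϑ ^ 2 / (1 - ϑ) ^ 2 * ((12 + 3 * μ) ^ 2 + 9 * s) / s ≤ θ₂ ^ 2)
    (hden : μ ^ 2 / s + (1 + μ * Real.sqrt (1 / s)) ^ 2 * θ₂ + θ₁ * (2 + θ₁) < (1 - θ₁) ^ 2)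
    {u : EuclideanSpace ℝ (Fin (K * n))} (hu : u ∈ blockTangent Fin.divNat)
    (J : EuclideanSpace ℝ (Fin (K * n)) →ₗ[ℝ] ℝ) (hρ : 0 ≤ ρ)
    (hweak : ∀ v ∈ blockTangent Fin.divNat,
      latticeForm (n : ℝ) (fun _ : Fin 1 => (1 : Fin (K * n))) s u v = J v)
    (hJ : ∀ v, |J (mulOp ω v)| ≤ ρ * energyNorm (n : ℝ) (fun _ : Fin 1 => (1 : Fin (K * n))) s v) :
    energyNorm (n : ℝ) (fun _ : Fin 1 => (1 : Fin (K * n))) s (mulOp ω u) ≤ (ρ + ρ * θ₂) /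
      ((1 - θ₁) ^ 2 - θ₁ * (2 + θ₁) - μ ^ 2 / s - (1 + μ * Real.sqrt (1 / s)) ^ 2 * θ₂) := by
  have h1n : 1 < n := by omega
  have hKn : 1 < K * n := lt_of_lt_of_le h1n (Nat.le_mul_of_pos_left n (NeZero.pos K))
  have h1ϑ : 0 < 1 - ϑ := by linarith
  have key := constrained_lattice_agmon (n : ℝ) (fun _ : Fin 1 => (1 : Fin (K * n))) hs ω hpos hμ
    (fun _ x => hω x) Fin.divNat ωbar hωbar hϑ hϑ1 hW1 (theta n) (theta_profileExact hn)
    (fun b => fiber Fin.divNat b) (Mu := 1) (theta_support hKn h1n)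
    (fun x => by rw [filter_mem_fiber_divNat]; simp)
    (Cu := 144 + 9 * s) (Cw := ((12 + 3 * μ) ^ 2 + 9 * s) / (1 - ϑ)) (by positivity) (by positivity)
    (theta_energy_le hn hs.le) (theta_weighted_energy_le hn hs.le hμ ω hpos hω ωbar hωbar hϑ hϑ1 hW1)
    hθ₁0 hθ₁1 hθ₂0
    (by rw [Nat.cast_one, one_mul]; exact hθ₁)
    (by
      rw [Nat.cast_one, one_mul]
      have h1 : (1 - ϑ) ≠ 0 := h1ϑ.ne'
      have h2 : s ≠ 0 := hs.ne'
      calc ϑ ^ 2 / (1 - ϑ) * (((12 + 3 * μ) ^ 2 + 9 * s) / (1 - ϑ)) / s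
          = ϑ ^ 2 / (1 - ϑ) ^ 2 * ((12 + 3 * μ) ^ 2 + 9 * s) / s := by rw [div_mul_div_comm, ← sq]; ring
        _ ≤ θ₂ ^ 2 := hθ₂)
    (by simpa using hden) hu J hρ hweak hJ
  simpa using key

end OneD

/-! ### §8h — (δ2′)+(δ1′): SUB-MASS / MASSLESS FORMS WITH TANGENT-ONLY COERCIVITY (block Poincaré), AND SOURCES KNOWN ONLY ON THE TANGENT SPACE (v1.1, APPEND-ONLY; all [folklore])

WHY.  In §8g the model form is measured in ITS OWN energy gauge, so it is coercive on all of ℓ²(G) with m = 1 and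
the tangent-only hypothesis `hcoerT` of `agmon_constrained_tangent` is exercised only abstractly; and the source
bound `hJ` of `constrained_lattice_agmon(_1D)` is assumed for all fields `ωv`, whereas the weak equation — and any
cube-wise source bound — only ever see TANGENT test fields.  Both are repaired here IN THE MODEL:
(δ2′) the form may carry a smaller mass `s₀ ∈ [0, s]` than the gauge — for `s₀ = 0` it is the MASSLESS difference
form, not coercive on ℓ² (constants) — and coercivity on `T_Q` comes from the BLOCK POINCARÉ INEQUALITY
(`poincare_range`, `block_poincare_1D`: zero block sums ⇒ ‖v‖² ≤ Σ‖c∇v‖², interior bonds only), giving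
`m = 1/(1+s)` uniformly in mesh and volume (`coercive_of_poincare`, `coercive_blockTangent_1D`,
`constrained_lattice_agmon_of_le`, `constrained_lattice_agmon_1D_of_le`);
(δ1′) a source bounded only on `T_Q` in the dual weighted gauge is extended by the finite-range tangent projection
`P_θ` (`tangentProj`, `profileLift_blockSum_energy_le`, `tangent_source_extension`) at the cost
`ρ ↦ ρ(1 + √((1+ϑ)C_w/s))`, and the 1D theorem is restated with the tangent-only source bound
(`constrained_lattice_agmon_1D_tangentSource`).
HONEST SCOPE.  d = 1 instance as in §8g; the (δ3) kernel/transport terms of `T4ConvexResponse` §8e–§8f are not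
re-assembled here (they add through `conjugationDefect_add`); the gauge half (δ5) of Bałaban's tangent space (the
RD*-constraint and its regauging Green's function) is NOT modelled; nothing printed is asserted; NOT summit progress. -/

section SubMass

variable {G : Type*} [AddCommGroup G] [Fintype G] {ι : Type*} [Fintype ι]

/-- Sub-mass bookkeeping: `B_{s₀}(u,v) = B_s(u,v) + (s₀ − s)⟨u,v⟩` (both are `Σ_i ⟨c∇_i u, c∇_i v⟩ + mass·⟨u,v⟩`,
`latticeForm_apply`). [folklore] -/
theorem latticeForm_eq_add_inner (c : ℝ) (e : ι → G) (s₀ s : ℝ) (u v : EuclideanSpace ℝ G) :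
    latticeForm c e s₀ u v = latticeForm c e s u v + (s₀ - s) * inner ℝ u v := by
  rw [latticeForm_apply, latticeForm_apply]; ring

/-- `Σ_i ‖c∇_i v‖² ≤ B_{s₀}(v,v)` for `0 ≤ s₀`. [folklore] -/
theorem sum_norm_fwdDiff_sq_le_latticeForm (c : ℝ) (e : ι → G) {s₀ : ℝ} (hs₀ : 0 ≤ s₀)
    (v : EuclideanSpace ℝ G) : ∑ i, ‖fwdDiff c e i v‖ ^ 2 ≤ latticeForm c e s₀ v v := by
  rw [latticeForm_apply]
  simp only [real_inner_self_eq_norm_sq]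
  nlinarith [norm_nonneg v]

/-- `B_{s₀}(v,v) ≤ B_s(v,v)` for `s₀ ≤ s`. [folklore] -/
theorem latticeForm_self_mono (c : ℝ) (e : ι → G) {s₀ s : ℝ} (h : s₀ ≤ s) (v : EuclideanSpace ℝ G) :
    latticeForm c e s₀ v v ≤ latticeForm c e s v v := by
  rw [latticeForm_eq_add_inner c e s₀ s, real_inner_self_eq_norm_sq]
  nlinarith [norm_nonneg v]

/-- `B_{s₀}(v,v) ≤ N_s(v)²` for `0 ≤ s₀ ≤ s`. [folklore] -/
theorem latticeForm_self_le_energyNorm_sq (c : ℝ) (e : ι → G) {s₀ s : ℝ} (hs₀ : 0 ≤ s₀) (h : s₀ ≤ s)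
    (v : EuclideanSpace ℝ G) : latticeForm c e s₀ v v ≤ energyNorm c e s v ^ 2 := by
  rw [energyNorm_sq c e (hs₀.trans h)]; exact latticeForm_self_mono c e h v

/-- CAUCHY–SCHWARZ for a SUB-MASS form in the LARGER energy gauge: `|B_{s₀}(u,v)| ≤ N_s(u)·N_s(v)` for
`0 ≤ s₀ ≤ s` (continuity modulus Λ = 1 of `agmon_constrained_tangent` in the dictionary B = B_{s₀}, N = N_s; the point
of `s₀ < s` — in particular the MASSLESS difference form `s₀ = 0` — is that B is then NOT coercive on all of ℓ²(G)
(constants), only on the block tangent space, §8h part 3). [folklore] -/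
theorem latticeForm_abs_le_of_le (c : ℝ) (e : ι → G) {s₀ s : ℝ} (hs₀ : 0 ≤ s₀) (h : s₀ ≤ s)
    (u v : EuclideanSpace ℝ G) :
    |latticeForm c e s₀ u v| ≤ energyNorm c e s u * energyNorm c e s v := by
  classical
  have hs : 0 ≤ s := hs₀.trans h
  set a : Option ι → ℝ := fun o => Option.elim o (Real.sqrt s * ‖u‖) fun i => ‖fwdDiff c e i u‖ with ha
  set b : Option ι → ℝ := fun o => Option.elim o (Real.sqrt s * ‖v‖) fun i => ‖fwdDiff c e i v‖ with hb
  have hsa : ∑ o, a o ^ 2 = latticeForm c e s u u := by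
    rw [Fintype.sum_option, latticeForm_apply]
    simp only [ha, Option.elim, real_inner_self_eq_norm_sq, mul_pow, Real.sq_sqrt hs]
    ring
  have hsb : ∑ o, b o ^ 2 = latticeForm c e s v v := by
    rw [Fintype.sum_option, latticeForm_apply]
    simp only [hb, Option.elim, real_inner_self_eq_norm_sq, mul_pow, Real.sq_sqrt hs]
    ring
  have hB : |latticeForm c e s₀ u v| ≤ ∑ o, a o * b o := by
    rw [latticeForm_apply, Fintype.sum_option]
    simp only [ha, hb, Option.elim]
    have h1 : |s₀ * inner ℝ u v| ≤ Real.sqrt s * ‖u‖ * (Real.sqrt s * ‖v‖) := by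
      rw [abs_mul, abs_of_nonneg hs₀]
      have hi := abs_real_inner_le_norm u v
      have hss : Real.sqrt s * ‖u‖ * (Real.sqrt s * ‖v‖) = s * (‖u‖ * ‖v‖) := by
        rw [show Real.sqrt s * ‖u‖ * (Real.sqrt s * ‖v‖) = (Real.sqrt s * Real.sqrt s) * (‖u‖ * ‖v‖) by ring,
          Real.mul_self_sqrt hs]
      rw [hss]
      have h0 : 0 ≤ ‖u‖ * ‖v‖ := by positivity
      calc s₀ * |inner ℝ u v| ≤ s₀ * (‖u‖ * ‖v‖) := mul_le_mul_of_nonneg_left hi hs₀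
        _ ≤ s * (‖u‖ * ‖v‖) := mul_le_mul_of_nonneg_right h h0
    have h2 : |∑ i, inner ℝ (fwdDiff c e i u) (fwdDiff c e i v)| ≤ ∑ i, ‖fwdDiff c e i u‖ * ‖fwdDiff c e i v‖ :=
      (Finset.abs_sum_le_sum_abs _ _).trans (Finset.sum_le_sum fun i _ => abs_real_inner_le_norm _ _)
    calc |∑ i, inner ℝ (fwdDiff c e i u) (fwdDiff c e i v) + s₀ * inner ℝ u v|
        ≤ |∑ i, inner ℝ (fwdDiff c e i u) (fwdDiff c e i v)| + |s₀ * inner ℝ u v| := abs_add_le _ _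
      _ ≤ Real.sqrt s * ‖u‖ * (Real.sqrt s * ‖v‖) + ∑ i, ‖fwdDiff c e i u‖ * ‖fwdDiff c e i v‖ := by linarith
  calc |latticeForm c e s₀ u v| ≤ ∑ o, a o * b o := hB
    _ ≤ Real.sqrt (∑ o, a o ^ 2) * Real.sqrt (∑ o, b o ^ 2) := Real.sum_mul_le_sqrt_mul_sqrt _ _ _
    _ = energyNorm c e s u * energyNorm c e s v := by rw [hsa, hsb]; rfl

/-- Conjugation defect of a sub-mass form in the larger energy gauge: `ConjugationDefect B_{s₀} (ω·) N_s (#ι·μ²/s)`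
for ANY real `s₀` and `s > 0` — from the ℓ²-defect `latticeForm_conjugationDefect` (valid for every mass) and
`s‖v‖² ≤ N_s(v)²`. [folklore] -/
theorem latticeForm_conjugationDefect_energy_of_le (c : ℝ) (e : ι → G) (s₀ : ℝ) {s : ℝ} (hs : 0 < s)
    (ω : G → ℝ) {μ : ℝ}
    (hω : ∀ i x, c ^ 2 * (ω (x + e i) - ω x) ^ 2 ≤ μ ^ 2 * ω x ^ 2 ∧
      c ^ 2 * (ω (x + e i) - ω x) ^ 2 ≤ μ ^ 2 * ω (x + e i) ^ 2) :
    ConjugationDefect (latticeForm c e s₀) (mulOp ω) (energyNorm c e s) (Fintype.card ι * μ ^ 2 / s) := by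
  intro u
  have h := latticeForm_conjugationDefect c e s₀ ω hω u
  have hn := norm_sq_le_energyNorm_sq c e hs.le (mulOp ω u)
  have hk : 0 ≤ (Fintype.card ι : ℝ) * μ ^ 2 := by positivity
  have : Fintype.card ι * μ ^ 2 / s * energyNorm c e s (mulOp ω u) ^ 2 ≥
      Fintype.card ι * μ ^ 2 * ‖mulOp ω u‖ ^ 2 := by
    rw [ge_iff_le, div_mul_eq_mul_div, le_div_iff₀ hs]
    nlinarith
  linarith

/-- WEIGHTED CONTINUITY of a sub-mass form in the larger energy gauge: `|B_{s₀}(v,h)| ≤ (1 + μ√(#ι/s))²·N_s(ωv)·N_s(ω⁻¹h)`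
for `0 ≤ s₀ ≤ s`, `0 < s`, weights with `|c∇ω| ≤ μω` bondwise — same bond identity as
`latticeForm_weighted_continuity` (the mass parts of `B_{s₀}(v,h)` and `B_{s₀}(ωv, ω⁻¹h)` agree), main term by
`latticeForm_abs_le_of_le`. [folklore] -/
theorem latticeForm_weighted_continuity_of_le (c : ℝ) (e : ι → G) {s₀ s : ℝ} (hs₀ : 0 ≤ s₀)
    (hle : s₀ ≤ s) (hs : 0 < s) (ω : G → ℝ)
    (hpos : ∀ x, 0 < ω x) {μ : ℝ} (hμ : 0 ≤ μ)
    (hω : ∀ i x, c ^ 2 * (ω (x + e i) - ω x) ^ 2 ≤ μ ^ 2 * ω x ^ 2 ∧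
      c ^ 2 * (ω (x + e i) - ω x) ^ 2 ≤ μ ^ 2 * ω (x + e i) ^ 2) (v h : EuclideanSpace ℝ G) :
    |latticeForm c e s₀ v h| ≤ (1 + μ * Real.sqrt (Fintype.card ι / s)) ^ 2 *
      (energyNorm c e s (mulOp ω v) * energyNorm c e s (mulOp (fun x => (ω x)⁻¹) h)) := by
  set V := mulOp ω v with hV
  set H := mulOp (fun x => (ω x)⁻¹) h with hH
  set d : ℝ := (Fintype.card ι : ℝ) with hd
  have hs0 := hs.le
  have hNV := energyNorm_nonneg c e s V
  have hNH := energyNorm_nonneg c e s H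
  have hmain : |latticeForm c e s₀ V H| ≤ energyNorm c e s V * energyNorm c e s H :=
    latticeForm_abs_le_of_le c e hs₀ hle V H
  have hdiff : latticeForm c e s₀ v h - latticeForm c e s₀ V H =
      ∑ i, (inner ℝ (fwdDiff c e i v) (fwdDiff c e i h) - inner ℝ (fwdDiff c e i V) (fwdDiff c e i H)) := by
    rw [latticeForm_apply, latticeForm_apply, ← inner_mulOp_inv ω hpos v h, Finset.sum_sub_distrib]
    ring
  have hdefect : |latticeForm c e s₀ v h - latticeForm c e s₀ V H| ≤
      μ * ((∑ i, ‖fwdDiff c e i V‖) * ‖H‖ + ‖V‖ * ∑ i, ‖fwdDiff c e i H‖) + d * μ ^ 2 * (‖V‖ * ‖H‖) := by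
    rw [hdiff]
    refine (Finset.abs_sum_le_sum_abs _ _).trans ?_
    have := Finset.sum_le_sum fun i (_ : i ∈ Finset.univ) => weighted_dir_defect c e i ω hpos hμ (hω i) v h
    refine this.trans (le_of_eq ?_)
    rw [Finset.sum_add_distrib, Finset.sum_const, Finset.card_univ, nsmul_eq_mul, ← Finset.mul_sum,
      Finset.sum_add_distrib, Finset.sum_mul, Finset.mul_sum, ← Finset.mul_sum, hd]
    ring
  have hVn : ‖V‖ * Real.sqrt s ≤ energyNorm c e s V := by
    have h1 := norm_sq_le_energyNorm_sq c e hs0 V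
    have h2 : (‖V‖ * Real.sqrt s) ^ 2 ≤ energyNorm c e s V ^ 2 := by
      rw [mul_pow, Real.sq_sqrt hs0]; linarith
    exact (abs_le_of_sq_le_sq' h2 hNV).2
  have hHn : ‖H‖ * Real.sqrt s ≤ energyNorm c e s H := by
    have h1 := norm_sq_le_energyNorm_sq c e hs0 H
    have h2 : (‖H‖ * Real.sqrt s) ^ 2 ≤ energyNorm c e s H ^ 2 := by
      rw [mul_pow, Real.sq_sqrt hs0]; linarith
    exact (abs_le_of_sq_le_sq' h2 hNH).2
  have hDV : ∑ i, ‖fwdDiff c e i V‖ ≤ Real.sqrt d * energyNorm c e s V := by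
    have h1 : (∑ i, ‖fwdDiff c e i V‖) ^ 2 ≤ d * energyNorm c e s V ^ 2 := by
      refine (sq_sum_le_card_mul_sum_sq (s := Finset.univ) (f := fun i => ‖fwdDiff c e i V‖)).trans ?_
      rw [Finset.card_univ, ← hd]
      exact mul_le_mul_of_nonneg_left (sum_norm_fwdDiff_sq_le c e hs0 V) (by positivity)
    have h2 : (∑ i, ‖fwdDiff c e i V‖) ^ 2 ≤ (Real.sqrt d * energyNorm c e s V) ^ 2 := by
      rw [mul_pow, Real.sq_sqrt (by positivity)]; exact h1
    exact (abs_le_of_sq_le_sq' h2 (by positivity)).2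
  have hDH : ∑ i, ‖fwdDiff c e i H‖ ≤ Real.sqrt d * energyNorm c e s H := by
    have h1 : (∑ i, ‖fwdDiff c e i H‖) ^ 2 ≤ d * energyNorm c e s H ^ 2 := by
      refine (sq_sum_le_card_mul_sum_sq (s := Finset.univ) (f := fun i => ‖fwdDiff c e i H‖)).trans ?_
      rw [Finset.card_univ, ← hd]
      exact mul_le_mul_of_nonneg_left (sum_norm_fwdDiff_sq_le c e hs0 H) (by positivity)
    have h2 : (∑ i, ‖fwdDiff c e i H‖) ^ 2 ≤ (Real.sqrt d * energyNorm c e s H) ^ 2 := by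
      rw [mul_pow, Real.sq_sqrt (by positivity)]; exact h1
    exact (abs_le_of_sq_le_sq' h2 (by positivity)).2
  have hsq : 0 < Real.sqrt s := Real.sqrt_pos.mpr hs
  have hVle : ‖V‖ ≤ energyNorm c e s V * (Real.sqrt s)⁻¹ := by
    rw [← div_eq_mul_inv, le_div_iff₀ hsq]; exact hVn
  have hHle : ‖H‖ ≤ energyNorm c e s H * (Real.sqrt s)⁻¹ := by
    rw [← div_eq_mul_inv, le_div_iff₀ hsq]; exact hHn
  have hdd : Real.sqrt d ^ 2 = d := Real.sq_sqrt (by positivity)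
  have hfin : energyNorm c e s V * energyNorm c e s H
      + (μ * ((Real.sqrt d * energyNorm c e s V) * (energyNorm c e s H * (Real.sqrt s)⁻¹)
          + (energyNorm c e s V * (Real.sqrt s)⁻¹) * (Real.sqrt d * energyNorm c e s H))
        + d * μ ^ 2 * ((energyNorm c e s V * (Real.sqrt s)⁻¹) * (energyNorm c e s H * (Real.sqrt s)⁻¹)))
      = (1 + μ * Real.sqrt (d / s)) ^ 2 * (energyNorm c e s V * energyNorm c e s H) := by
    rw [Real.sqrt_div (by positivity : (0:ℝ) ≤ d) s, div_eq_mul_inv]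
    linear_combination (-(μ ^ 2 * energyNorm c e s V * energyNorm c e s H * (Real.sqrt s)⁻¹ ^ 2)) * hdd
  have habs : |latticeForm c e s₀ v h| ≤
      |latticeForm c e s₀ V H| + |latticeForm c e s₀ v h - latticeForm c e s₀ V H| := by
    have := abs_add_le (latticeForm c e s₀ V H) (latticeForm c e s₀ v h - latticeForm c e s₀ V H)
    rwa [add_sub_cancel] at this
  have m1 : (∑ i, ‖fwdDiff c e i V‖) * ‖H‖ ≤
      (Real.sqrt d * energyNorm c e s V) * (energyNorm c e s H * (Real.sqrt s)⁻¹) :=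
    mul_le_mul hDV hHle (norm_nonneg _) (by positivity)
  have m2 : ‖V‖ * ∑ i, ‖fwdDiff c e i H‖ ≤
      (energyNorm c e s V * (Real.sqrt s)⁻¹) * (Real.sqrt d * energyNorm c e s H) :=
    mul_le_mul hVle hDH (Finset.sum_nonneg fun i _ => norm_nonneg _) (by positivity)
  have m3 : ‖V‖ * ‖H‖ ≤ (energyNorm c e s V * (Real.sqrt s)⁻¹) * (energyNorm c e s H * (Real.sqrt s)⁻¹) :=
    mul_le_mul hVle hHle (norm_nonneg _) (by positivity)
  have hd0 : 0 ≤ d * μ ^ 2 := by positivity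
  rw [← hfin]
  calc |latticeForm c e s₀ v h|
      ≤ |latticeForm c e s₀ V H| + |latticeForm c e s₀ v h - latticeForm c e s₀ V H| := habs
    _ ≤ energyNorm c e s V * energyNorm c e s H
        + (μ * ((∑ i, ‖fwdDiff c e i V‖) * ‖H‖ + ‖V‖ * ∑ i, ‖fwdDiff c e i H‖) + d * μ ^ 2 * (‖V‖ * ‖H‖)) :=
        add_le_add hmain hdefect
    _ ≤ _ := add_le_add le_rfl (add_le_add (mul_le_mul_of_nonneg_left (add_le_add m1 m2) hμ)
        (mul_le_mul_of_nonneg_left m3 hd0))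

/-- TANGENT-ONLY COERCIVITY FROM A POINCARÉ INEQUALITY: if `‖v‖² ≤ C_P·Σ_i‖c∇_i v‖²` on a subspace `T`, then
`(1/(1 + s·C_P))·N_s(v)² ≤ B_{s₀}(v,v)` on `T` for all `0 ≤ s₀`, `0 ≤ s` — the dictionary shape `hcoerT` of
`agmon_constrained_tangent` with `m = 1/(1 + sC_P)`, for a form that need not be coercive off `T`. [folklore] -/
theorem coercive_of_poincare (c : ℝ) (e : ι → G) {s₀ s CP : ℝ} (hs₀ : 0 ≤ s₀) (hs : 0 ≤ s) (hCP : 0 ≤ CP)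
    (T : Submodule ℝ (EuclideanSpace ℝ G))
    (hP : ∀ v ∈ T, ‖v‖ ^ 2 ≤ CP * ∑ i, ‖fwdDiff c e i v‖ ^ 2) :
    ∀ v ∈ T, 1 / (1 + s * CP) * energyNorm c e s v ^ 2 ≤ latticeForm c e s₀ v v := by
  intro v hv
  have h1 := hP v hv
  have h2 := sum_norm_fwdDiff_sq_le_latticeForm c e hs₀ v
  have h3 : energyNorm c e s v ^ 2 = ∑ i, ‖fwdDiff c e i v‖ ^ 2 + s * ‖v‖ ^ 2 := by
    rw [energyNorm_sq c e hs, latticeForm_apply]; simp only [real_inner_self_eq_norm_sq]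
  have hpos : 0 < 1 + s * CP := by positivity
  rw [div_mul_eq_mul_div, one_mul, div_le_iff₀ hpos, h3]
  have h4 : s * ‖v‖ ^ 2 ≤ s * (CP * ∑ i, ‖fwdDiff c e i v‖ ^ 2) := mul_le_mul_of_nonneg_left h1 hs
  have h5 : 0 ≤ latticeForm c e s₀ v v - ∑ i, ‖fwdDiff c e i v‖ ^ 2 := by linarith
  nlinarith [mul_nonneg hs hCP]

end SubMass

/-! ### §8h part 2 — generic assembled theorem for a sub-mass form with tangent-only coercivity -/

section BlockEnergySub

variable {G : Type*} [AddCommGroup G] [Fintype G] [DecidableEq G] {ι : Type*} [Fintype ι]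
  {Bk : Type*} [Fintype Bk] [DecidableEq Bk]

/-- GENERIC ASSEMBLED THEOREM, SUB-MASS FORM, TANGENT-ONLY COERCIVITY ((δ2′) of the record).  As
`constrained_lattice_agmon` but with the form `B = latticeForm c e s₀`, `0 ≤ s₀ ≤ s`, measured in the gauge
`N = energyNorm c e s`, and coercivity ASSUMED ON THE BLOCK TANGENT SPACE ONLY (`hcoerT : m·N(v)² ≤ B(v,v)` for
`v ∈ T_Q` — in the model supplied by a block Poincaré inequality, `coercive_of_poincare`; in the dictionary this is ML,
and the lattice form stays NON-coercive off `T_Q` when `s₀ = 0`): with the profile data of `constrained_lattice_agmon`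
and `#ι·μ²/s + (1 + μ√(#ι/s))²θ₂ + θ₁(2+θ₁) < m(1−θ₁)²`, every `u ∈ T_Q` solving `B(u,v) = J(v)` on `T_Q` with
`|J(ωv)| ≤ ρN(v)` obeys `N(ωu) ≤ ρ(1+θ₂)/(m(1−θ₁)² − θ₁(2+θ₁) − #ι·μ²/s − (1 + μ√(#ι/s))²θ₂)`.  Proof =
`agmon_constrained_tangent_dual` with Λ = 1 (`latticeForm_abs_le_of_le`), κ = #ι·μ²/s
(`latticeForm_conjugationDefect_energy_of_le`), Λ_w (`latticeForm_weighted_continuity_of_le`), corrections `blockCorr`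
exactly as in `constrained_lattice_agmon`. [folklore] -/
theorem constrained_lattice_agmon_of_le (c : ℝ) (e : ι → G) {s μ ϑ Cu Cw θ₁ θ₂ ρ : ℝ} (hs : 0 < s)
    (ω : G → ℝ) (hpos : ∀ x, 0 < ω x) (hμ : 0 ≤ μ)
    (hω : ∀ i x, c ^ 2 * (ω (x + e i) - ω x) ^ 2 ≤ μ ^ 2 * ω x ^ 2 ∧
      c ^ 2 * (ω (x + e i) - ω x) ^ 2 ≤ μ ^ 2 * ω (x + e i) ^ 2)
    (blk : G → Bk) (ωbar : Bk → ℝ) (hωbar : ∀ b, 0 < ωbar b) (hϑ : 0 ≤ ϑ) (hϑ1 : ϑ < 1)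
    (hW1 : ∀ x, |ω x ^ 2 - ωbar (blk x) ^ 2| ≤ ϑ * ωbar (blk x) ^ 2)
    (θ : Bk → EuclideanSpace ℝ G) (hθ : ProfileExact blk θ) (S : Bk → Finset G) {Mu : ℕ}
    (hSθ : ∀ b x, x ∉ S b → θ b x = 0 ∧ ∀ i, θ b (x + e i) = 0)
    (hM : ∀ x, (Finset.univ.filter (fun b => x ∈ S b)).card ≤ Mu)
    (hCu : 0 ≤ Cu) (hCw : 0 ≤ Cw)
    (hP2u : ∀ b, ((fiber blk b).card : ℝ) * energyNorm c e s (θ b) ^ 2 ≤ Cu)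
    (hP2w : ∀ b, ((fiber blk b).card : ℝ) * ωbar b ^ 2 *
      energyNorm c e s (mulOp (fun x => (ω x)⁻¹) (θ b)) ^ 2 ≤ Cw)
    (hθ₁0 : 0 ≤ θ₁) (hθ₁1 : θ₁ ≤ 1) (hθ₂0 : 0 ≤ θ₂)
    (hθ₁ : Mu * (ϑ ^ 2 / (1 - ϑ) * Cu) / s ≤ θ₁ ^ 2) (hθ₂ : Mu * (ϑ ^ 2 / (1 - ϑ) * Cw) / s ≤ θ₂ ^ 2)
    {s₀ m : ℝ} (hs₀ : 0 ≤ s₀) (hs₀s : s₀ ≤ s) (hm0 : 0 ≤ m)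
    (hcoerT : ∀ v ∈ blockTangent blk, m * energyNorm c e s v ^ 2 ≤ latticeForm c e s₀ v v)
    (hden : Fintype.card ι * μ ^ 2 / s + (1 + μ * Real.sqrt (Fintype.card ι / s)) ^ 2 * θ₂
      + θ₁ * (2 + θ₁) < m * (1 - θ₁) ^ 2)
    {u : EuclideanSpace ℝ G} (hu : u ∈ blockTangent blk) (J : EuclideanSpace ℝ G →ₗ[ℝ] ℝ) (hρ : 0 ≤ ρ)
    (hweak : ∀ v ∈ blockTangent blk, latticeForm c e s₀ u v = J v)
    (hJ : ∀ v, |J (mulOp ω v)| ≤ ρ * energyNorm c e s v) :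
    energyNorm c e s (mulOp ω u) ≤ (ρ + ρ * θ₂) /
      (m * (1 - θ₁) ^ 2 - θ₁ * (2 + θ₁) - Fintype.card ι * μ ^ 2 / s
        - (1 + μ * Real.sqrt (Fintype.card ι / s)) ^ 2 * θ₂) := by
  have hs0 := hs.le
  have hsq1 : 0 < Real.sqrt (1 - ϑ) := Real.sqrt_pos.mpr (by linarith)
  set c₁ := blockCorr blk θ ω ωbar u with hc₁def
  set c₂ := blockCorr blk θ (fun x => ω x ^ 2) (fun b => ωbar b ^ 2) u with hc₂def
  have hc₁T : mulOp ω u - c₁ ∈ blockTangent blk := mulOp_sub_blockCorr_mem hθ _ _ hu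
  have hc₂T : mulOp ω (mulOp ω u) - c₂ ∈ blockTangent blk := by
    rw [mulOp_mulOp]; exact mulOp_sub_blockCorr_mem hθ _ _ hu
  have hdata1 : ∀ x, |ω x - ωbar (blk x)| ≤ ϑ / Real.sqrt (1 - ϑ) * |ω x| := by
    intro x
    have hwc := weight_block_compare (hpos x) (hωbar (blk x)) hϑ hϑ1 (hW1 x)
    rw [abs_of_pos (hpos x)]
    calc |ω x - ωbar (blk x)| ≤ ϑ * ωbar (blk x) := hwc.1
      _ = ϑ / Real.sqrt (1 - ϑ) * (ωbar (blk x) * Real.sqrt (1 - ϑ)) := by field_simp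
      _ ≤ ϑ / Real.sqrt (1 - ϑ) * ω x := mul_le_mul_of_nonneg_left hwc.2 (by positivity)
  have hdata2 : ∀ x, |ω x ^ 2 - ωbar (blk x) ^ 2| ≤ ϑ * ωbar (blk x) / Real.sqrt (1 - ϑ) * |ω x| := by
    intro x
    have hwc := weight_block_compare (hpos x) (hωbar (blk x)) hϑ hϑ1 (hW1 x)
    rw [abs_of_pos (hpos x)]
    calc |ω x ^ 2 - ωbar (blk x) ^ 2| ≤ ϑ * ωbar (blk x) ^ 2 := hW1 x
      _ = ϑ * ωbar (blk x) / Real.sqrt (1 - ϑ) * (ωbar (blk x) * Real.sqrt (1 - ϑ)) := by field_simp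
      _ ≤ ϑ * ωbar (blk x) / Real.sqrt (1 - ϑ) * ω x :=
          mul_le_mul_of_nonneg_left hwc.2 (by have := (hωbar (blk x)).le; positivity)
  have h1ϑ : 0 ≤ 1 - ϑ := by linarith
  have h0 : 0 ≤ ϑ ^ 2 / (1 - ϑ) := by positivity
  have hE1 := blockCorr_energy_le c e hs blk θ S hSθ hM (fun _ => (1:ℝ)) ω ωbar ω (fun _ => ϑ / Real.sqrt (1 - ϑ))
    (C := ϑ ^ 2 / (1 - ϑ) * Cu) (by positivity) hdata1 (fun b => by
      rw [mulOp_one', div_pow, Real.sq_sqrt h1ϑ]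
      have := hP2u b
      calc ϑ ^ 2 / (1 - ϑ) * (fiber blk b).card * energyNorm c e s (θ b) ^ 2
          = ϑ ^ 2 / (1 - ϑ) * ((fiber blk b).card * energyNorm c e s (θ b) ^ 2) := by ring
        _ ≤ ϑ ^ 2 / (1 - ϑ) * Cu := mul_le_mul_of_nonneg_left this h0) u
  rw [mulOp_one'] at hE1
  have hE2 := blockCorr_energy_le c e hs blk θ S hSθ hM (fun x => (ω x)⁻¹) (fun x => ω x ^ 2)
    (fun b => ωbar b ^ 2) ω (fun b => ϑ * ωbar b / Real.sqrt (1 - ϑ))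
    (C := ϑ ^ 2 / (1 - ϑ) * Cw) (by positivity) hdata2 (fun b => by
      rw [div_pow, mul_pow, Real.sq_sqrt h1ϑ]
      have := hP2w b
      calc (ϑ ^ 2 * ωbar b ^ 2 / (1 - ϑ)) * (fiber blk b).card *
            energyNorm c e s (mulOp (fun x => (ω x)⁻¹) (θ b)) ^ 2
          = ϑ ^ 2 / (1 - ϑ) * ((fiber blk b).card * ωbar b ^ 2 *
            energyNorm c e s (mulOp (fun x => (ω x)⁻¹) (θ b)) ^ 2) := by ring
        _ ≤ ϑ ^ 2 / (1 - ϑ) * Cw := mul_le_mul_of_nonneg_left this h0) u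
  have hN := energyNorm_nonneg c e s (mulOp ω u)
  have hc₁ : energyNorm c e s c₁ ≤ θ₁ * energyNorm c e s (mulOp ω u) := by
    have h1 : energyNorm c e s c₁ ^ 2 ≤ (θ₁ * energyNorm c e s (mulOp ω u)) ^ 2 := by
      rw [mul_pow]
      exact hE1.trans (mul_le_mul_of_nonneg_right hθ₁ (sq_nonneg _))
    exact (abs_le_of_sq_le_sq' h1 (by positivity)).2
  have hc₂ : energyNorm c e s (mulOp (fun x => (ω x)⁻¹) c₂) ≤ θ₂ * energyNorm c e s (mulOp ω u) := by
    have h1 : energyNorm c e s (mulOp (fun x => (ω x)⁻¹) c₂) ^ 2 ≤ (θ₂ * energyNorm c e s (mulOp ω u)) ^ 2 := by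
      rw [mul_pow]
      exact hE2.trans (mul_le_mul_of_nonneg_right hθ₂ (sq_nonneg _))
    exact (abs_le_of_sq_le_sq' h1 (by positivity)).2
  have key := agmon_constrained_tangent_dual (latticeForm c e s₀) (mulOp ω) (blockTangent blk)
    (energyNorm c e s) (fun h => energyNorm c e s (mulOp (fun x => (ω x)⁻¹) h)) J
    (m := m) (Λ := 1) (Λw := (1 + μ * Real.sqrt (Fintype.card ι / s)) ^ 2)
    (κ := Fintype.card ι * μ ^ 2 / s) (θ₁ := θ₁) (θ₂ := θ₂) (ρ := ρ)
    (by linarith) hm0 zero_le_one (by positivity) hθ₁0 hθ₁1 hθ₂0 hρ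
    hcoerT
    (fun v h => by rw [one_mul]; exact latticeForm_abs_le_of_le c e hs₀ hs₀s v h)
    (energyNorm_sub_rev c e hs0) (energyNorm_nonneg c e s)
    (latticeForm_conjugationDefect_energy_of_le c e s₀ hs ω hω)
    (u := u) (c₁ := c₁) (c₂ := c₂)
    (fun h => by
      have := latticeForm_weighted_continuity_of_le c e hs₀ hs₀s hs ω hpos hμ hω u h
      simpa only [mul_assoc] using this)
    (fun h => by
      have := hJ (mulOp (fun x => (ω x)⁻¹) h)
      rwa [mulOp_mul_inv ω hpos] at this)
    hc₁T hc₂T hc₁ hc₂ hweak hJ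
  simpa only [one_mul] using key

end BlockEnergySub

/-! ### §8h part 2b — (δ1′) sources known only on the tangent space: the finite-range tangent
projection `P_θ h = h − lift_θ(Q h)` and the extension `J ∘ P_θ`. -/

section TangentSource

variable {G : Type*} [AddCommGroup G] [Fintype G] [DecidableEq G] {ι : Type*} [Fintype ι]
  {Bk : Type*} [Fintype Bk] [DecidableEq Bk]

omit [AddCommGroup G] [DecidableEq G] in
/-- (δ1′) The FINITE-RANGE PROJECTION onto the block tangent space along the profile lift:
`P_θ := id − Σ_b (Q_b ·)•θ_b`, i.e. `P_θ h = h − lift_θ(Q h)` (`tangentProj_apply`).  With an exact profile family it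
is a projection onto `T_Q` (`tangentProj_mem`, `tangentProj_of_mem`).  Dictionary: the extension `J̃ := J ∘ P_θ` of a
source known only on the tangent space (the weak equation (82)–(84) p. 290 tests tangent directions (83) only).
[folklore] -/
def tangentProj (blk : G → Bk) (θ : Bk → EuclideanSpace ℝ G) :
    EuclideanSpace ℝ G →ₗ[ℝ] EuclideanSpace ℝ G :=
  LinearMap.id - ∑ b, (blockSum blk b).smulRight (θ b)

omit [AddCommGroup G] [DecidableEq G] in
/-- `P_θ h = h − lift_θ(b ↦ Σ_{x ∈ b} h x)`. [folklore] -/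
theorem tangentProj_apply (blk : G → Bk) (θ : Bk → EuclideanSpace ℝ G) (h : EuclideanSpace ℝ G) :
    tangentProj blk θ h = h - profileLift θ (fun b => blockSum blk b h) := by
  simp [tangentProj, profileLift, LinearMap.sum_apply, LinearMap.smulRight_apply]

omit [AddCommGroup G] [DecidableEq G] in
/-- `P_θ v = v` for `v ∈ T_Q` (zero block sums). [folklore] -/
theorem tangentProj_of_mem {blk : G → Bk} (θ : Bk → EuclideanSpace ℝ G) {v : EuclideanSpace ℝ G}
    (hv : v ∈ blockTangent blk) : tangentProj blk θ v = v := by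
  rw [tangentProj_apply]
  have h0 : (fun b => blockSum blk b v) = fun _ => (0 : ℝ) := funext fun b => (mem_blockTangent.mp hv) b
  rw [h0]
  simp [profileLift]

omit [AddCommGroup G] [DecidableEq G] in
/-- `P_θ h ∈ T_Q` for every `h`, when the profile family is exact (`Q_b θ_{b′} = δ_{bb′}`). [folklore] -/
theorem tangentProj_mem {blk : G → Bk} {θ : Bk → EuclideanSpace ℝ G} (hθ : ProfileExact blk θ)
    (h : EuclideanSpace ℝ G) : tangentProj blk θ h ∈ blockTangent blk := by
  rw [tangentProj_apply, mem_blockTangent]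
  intro b
  rw [map_sub, blockSum_profileLift hθ, sub_self]

omit [AddCommGroup G] [Fintype G] [DecidableEq G] in
/-- `ω⁻¹·(ω·v) = v` for positive weights. [folklore] -/
theorem mulOp_inv_mul (ω : G → ℝ) (hpos : ∀ x, 0 < ω x) (v : EuclideanSpace ℝ G) :
    mulOp (fun x => (ω x)⁻¹) (mulOp ω v) = v := by
  ext x; simp [mulOp_apply, (hpos x).ne']

omit [DecidableEq G] in
/-- `N_s(−v) = N_s(v)`. [folklore] -/
theorem energyNorm_neg (c : ℝ) (e : ι → G) {s : ℝ} (hs : 0 ≤ s) (v : EuclideanSpace ℝ G) :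
    energyNorm c e s (-v) = energyNorm c e s v := by
  have h := energyNorm_smul c e hs (-1) v
  rw [neg_one_smul] at h
  have h2 : energyNorm c e s (-v) ^ 2 = energyNorm c e s v ^ 2 := by rw [h]; ring
  have h3 := (abs_le_of_sq_le_sq' h2.le (energyNorm_nonneg _ _ _ _)).2
  have h4 := (abs_le_of_sq_le_sq' h2.ge (energyNorm_nonneg _ _ _ _)).2
  exact le_antisymm h3 h4

omit [DecidableEq G] in
/-- `N_s(a − b) ≤ N_s(a) + N_s(b)`. [folklore] -/
theorem energyNorm_sub_le (c : ℝ) (e : ι → G) {s : ℝ} (hs : 0 ≤ s) (a b : EuclideanSpace ℝ G) :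
    energyNorm c e s (a - b) ≤ energyNorm c e s a + energyNorm c e s b := by
  have := energyNorm_add_le c e hs a (-b)
  rwa [← sub_eq_add_neg, energyNorm_neg c e hs] at this

/-- ENERGY OF THE LIFTED BLOCK SUMS in the DUAL weighted gauge `N′ = N_s ∘ ω⁻¹`: for weights block-comparable
from above (`ω² ≤ (1+ϑ)ω̄_b²`, from `hW1`), profiles with `#b·ω̄_b²·N_s(ω⁻¹θ_b)² ≤ C_w` and supports of
multiplicity `≤ M`: `N′(lift_θ(Q h))² ≤ M(1+ϑ)C_w/s · N′(h)²` — `blockCorr_energy_le` with `m = ω`, `m̄ = 0`,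
comparison weight `1`, applied to `ω⁻¹h`. [folklore] -/
theorem profileLift_blockSum_energy_le (c : ℝ) (e : ι → G) {s : ℝ} (hs : 0 < s) (blk : G → Bk)
    (θ : Bk → EuclideanSpace ℝ G) (S : Bk → Finset G) {Mu : ℕ}
    (hSθ : ∀ b x, x ∉ S b → θ b x = 0 ∧ ∀ i, θ b (x + e i) = 0)
    (hM : ∀ x, (Finset.univ.filter (fun b => x ∈ S b)).card ≤ Mu)
    (ω : G → ℝ) (hpos : ∀ x, 0 < ω x) (ωbar : Bk → ℝ) (hωbar : ∀ b, 0 < ωbar b) {ϑ : ℝ} (hϑ : 0 ≤ ϑ)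
    (hW1 : ∀ x, |ω x ^ 2 - ωbar (blk x) ^ 2| ≤ ϑ * ωbar (blk x) ^ 2) {Cw : ℝ} (hCw : 0 ≤ Cw)
    (hP2w : ∀ b, ((fiber blk b).card : ℝ) * ωbar b ^ 2 *
      energyNorm c e s (mulOp (fun x => (ω x)⁻¹) (θ b)) ^ 2 ≤ Cw)
    (h : EuclideanSpace ℝ G) :
    energyNorm c e s (mulOp (fun x => (ω x)⁻¹) (profileLift θ (fun b => blockSum blk b h))) ^ 2 ≤
      Mu * ((1 + ϑ) * Cw) / s * energyNorm c e s (mulOp (fun x => (ω x)⁻¹) h) ^ 2 := by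
  have hrw : profileLift θ (fun b => blockSum blk b h) =
      blockCorr blk θ ω (fun _ => 0) (mulOp (fun x => (ω x)⁻¹) h) := by
    unfold blockCorr
    congr 1
    funext b
    congr 1
    ext x
    simp [mulOp_apply, (hpos x).ne']
  have hdata : ∀ x, |ω x - (fun _ : Bk => (0:ℝ)) (blk x)| ≤
      (ωbar (blk x) * Real.sqrt (1 + ϑ)) * |(fun _ : G => (1:ℝ)) x| := by
    intro x
    simp only [sub_zero, abs_one, mul_one]
    rw [abs_of_pos (hpos x)]
    have h1 : ω x ^ 2 ≤ (1 + ϑ) * ωbar (blk x) ^ 2 := by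
      have := (abs_le.mp (hW1 x)).2; linarith
    have h2 : ω x ^ 2 ≤ (ωbar (blk x) * Real.sqrt (1 + ϑ)) ^ 2 := by
      rw [mul_pow, Real.sq_sqrt (by linarith)]; linarith
    exact (abs_le_of_sq_le_sq' h2 (by have := (hωbar (blk x)).le; positivity)).2
  have key := blockCorr_energy_le c e hs blk θ S hSθ hM (fun x => (ω x)⁻¹) ω (fun _ => (0:ℝ))
    (fun _ => (1:ℝ)) (fun b => ωbar b * Real.sqrt (1 + ϑ)) (C := (1 + ϑ) * Cw) (by positivity) hdata
    (fun b => by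
      rw [mul_pow, Real.sq_sqrt (by linarith)]
      have := hP2w b
      calc ωbar b ^ 2 * (1 + ϑ) * (fiber blk b).card * energyNorm c e s (mulOp (fun x => (ω x)⁻¹) (θ b)) ^ 2
          = (1 + ϑ) * ((fiber blk b).card * ωbar b ^ 2 *
              energyNorm c e s (mulOp (fun x => (ω x)⁻¹) (θ b)) ^ 2) := by ring
        _ ≤ (1 + ϑ) * Cw := mul_le_mul_of_nonneg_left this (by linarith))
    (mulOp (fun x => (ω x)⁻¹) h)
  rw [mulOp_one'] at key
  rw [hrw]; exact key

/-- (δ1′) THE TANGENT SOURCE EXTENSION.  If the source functional is bounded ONLY ON TANGENT TEST FIELDS in the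
dual weighted gauge — `|J φ| ≤ ρ·N_s(ω⁻¹φ)` for `φ ∈ T_Q` (dictionary: what a cube-wise bound on tangent fields plus
the finite-overlap bookkeeping `T4ConvexResponse.weightedDual_of_local` deliver) — then `J̃ := J ∘ P_θ` (i) agrees
with `J` on `T_Q` (so the weak equation on `T_Q` is unchanged) and (ii) satisfies
`|J̃ h| ≤ ρ(1 + √(M(1+ϑ)C_w/s))·N_s(ω⁻¹h)` for ALL `h` — hence also `|J̃(ωv)| ≤ ρ′N_s(v)` for all `v`
(`mulOp_inv_mul`): both source hypotheses of `agmon_constrained_tangent_dual` / `constrained_lattice_agmon(_of_le)`.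
[folklore] -/
theorem tangent_source_extension (c : ℝ) (e : ι → G) {s : ℝ} (hs : 0 < s) (blk : G → Bk)
    (θ : Bk → EuclideanSpace ℝ G) (hθ : ProfileExact blk θ) (S : Bk → Finset G) {Mu : ℕ}
    (hSθ : ∀ b x, x ∉ S b → θ b x = 0 ∧ ∀ i, θ b (x + e i) = 0)
    (hM : ∀ x, (Finset.univ.filter (fun b => x ∈ S b)).card ≤ Mu)
    (ω : G → ℝ) (hpos : ∀ x, 0 < ω x) (ωbar : Bk → ℝ) (hωbar : ∀ b, 0 < ωbar b) {ϑ : ℝ} (hϑ : 0 ≤ ϑ)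
    (hW1 : ∀ x, |ω x ^ 2 - ωbar (blk x) ^ 2| ≤ ϑ * ωbar (blk x) ^ 2) {Cw : ℝ} (hCw : 0 ≤ Cw)
    (hP2w : ∀ b, ((fiber blk b).card : ℝ) * ωbar b ^ 2 *
      energyNorm c e s (mulOp (fun x => (ω x)⁻¹) (θ b)) ^ 2 ≤ Cw)
    (J : EuclideanSpace ℝ G →ₗ[ℝ] ℝ) {ρ : ℝ} (hρ : 0 ≤ ρ)
    (hJT : ∀ φ ∈ blockTangent blk, |J φ| ≤ ρ * energyNorm c e s (mulOp (fun x => (ω x)⁻¹) φ)) :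
    (∀ v ∈ blockTangent blk, (J ∘ₗ tangentProj blk θ) v = J v) ∧
    (∀ h, |(J ∘ₗ tangentProj blk θ) h| ≤ ρ * (1 + Real.sqrt (Mu * ((1 + ϑ) * Cw) / s)) *
        energyNorm c e s (mulOp (fun x => (ω x)⁻¹) h)) := by
  refine ⟨fun v hv => by rw [LinearMap.comp_apply, tangentProj_of_mem θ hv], fun h => ?_⟩
  rw [LinearMap.comp_apply]
  have hmem := tangentProj_mem hθ h
  refine (hJT _ hmem).trans ?_
  rw [tangentProj_apply, map_sub]
  have hsub := energyNorm_sub_le c e hs.le (mulOp (fun x => (ω x)⁻¹) h)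
    (mulOp (fun x => (ω x)⁻¹) (profileLift θ (fun b => blockSum blk b h)))
  have hlift := profileLift_blockSum_energy_le c e hs blk θ S hSθ hM ω hpos ωbar hωbar hϑ hW1 hCw hP2w h
  set A := energyNorm c e s (mulOp (fun x => (ω x)⁻¹) h) with hA
  set L := energyNorm c e s (mulOp (fun x => (ω x)⁻¹) (profileLift θ (fun b => blockSum blk b h))) with hL
  have hA0 : 0 ≤ A := energyNorm_nonneg _ _ _ _
  have hK0 : 0 ≤ (Mu : ℝ) * ((1 + ϑ) * Cw) / s := by positivity
  have hL1 : L ≤ Real.sqrt (Mu * ((1 + ϑ) * Cw) / s) * A := by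
    have h1 : L ^ 2 ≤ (Real.sqrt (Mu * ((1 + ϑ) * Cw) / s) * A) ^ 2 := by
      rw [mul_pow, Real.sq_sqrt hK0]; exact hlift
    exact (abs_le_of_sq_le_sq' h1 (by positivity)).2
  calc ρ * energyNorm c e s (mulOp (fun x => (ω x)⁻¹) h -
        mulOp (fun x => (ω x)⁻¹) (profileLift θ fun b => blockSum blk b h))
      ≤ ρ * (A + L) := mul_le_mul_of_nonneg_left hsub hρ
    _ ≤ ρ * (A + Real.sqrt (Mu * ((1 + ϑ) * Cw) / s) * A) := by
        exact mul_le_mul_of_nonneg_left (add_le_add le_rfl hL1) hρ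
    _ = ρ * (1 + Real.sqrt (Mu * ((1 + ϑ) * Cw) / s)) * A := by ring

end TangentSource

/-! ### §8h part 3 — block Poincaré inequality and the one-dimensional sub-mass / massless instance -/

section OneDSub

/-- DISCRETE POINCARÉ INEQUALITY ON A PATH (crude constant): for `g : ℕ → ℝ` with `Σ_{j<n} g j = 0`,
`Σ_{j<n} (g j)² ≤ n²·Σ_{l<n−1} (g(l+1) − g l)²` — zero mean ⇒ `|g j| ≤ Σ_l |g(l+1) − g l|` (telescoping) ⇒
Cauchy–Schwarz.  (The sharp constant `1/(2 − 2cos(π/n)) ≈ n²/π²` is not needed.) [folklore] -/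
theorem poincare_range (n : ℕ) (g : ℕ → ℝ) (hsum : ∑ j ∈ Finset.range n, g j = 0) :
    ∑ j ∈ Finset.range n, g j ^ 2 ≤
      (n : ℝ) ^ 2 * ∑ l ∈ Finset.range (n - 1), (g (l + 1) - g l) ^ 2 := by
  set D := ∑ l ∈ Finset.range (n - 1), |g (l + 1) - g l| with hD
  have hD0 : 0 ≤ D := Finset.sum_nonneg fun _ _ => abs_nonneg _
  have htel : ∀ j k, j ≤ k → k < n → |g k - g j| ≤ D := by
    intro j k hjk hkn
    have h1 : ∑ l ∈ Finset.Ico j k, (g (l + 1) - g l) = g k - g j := by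
      rw [Finset.sum_Ico_eq_sum_range]
      have h := Finset.sum_range_sub (fun i => g (j + i)) (k - j)
      simp only [add_zero] at h
      rw [Nat.add_sub_cancel' hjk] at h
      rw [← h]
      exact Finset.sum_congr rfl fun i _ => by rw [add_assoc]
    rw [← h1]
    calc |∑ l ∈ Finset.Ico j k, (g (l + 1) - g l)|
        ≤ ∑ l ∈ Finset.Ico j k, |g (l + 1) - g l| := Finset.abs_sum_le_sum_abs _ _
      _ ≤ D := Finset.sum_le_sum_of_subset_of_nonneg (fun l hl => by
            simp only [Finset.mem_Ico] at hl; simp only [Finset.mem_range]; omega)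
          (fun _ _ _ => abs_nonneg _)
  have htel' : ∀ j k, j < n → k < n → |g k - g j| ≤ D := by
    intro j k hj hk
    rcases le_total j k with h | h
    · exact htel j k h hk
    · rw [abs_sub_comm]; exact htel k j h hj
  have hpt : ∀ j, j < n → |g j| ≤ D := by
    intro j hj
    have hn : (0:ℝ) < n := by exact_mod_cast (show 0 < n by omega)
    have h1 : (n : ℝ) * g j = ∑ k ∈ Finset.range n, (g j - g k) := by
      rw [Finset.sum_sub_distrib, hsum, Finset.sum_const, Finset.card_range, nsmul_eq_mul, sub_zero]
    have h2 : |(n:ℝ) * g j| ≤ n * D := by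
      rw [h1]
      calc |∑ k ∈ Finset.range n, (g j - g k)| ≤ ∑ k ∈ Finset.range n, |g j - g k| :=
            Finset.abs_sum_le_sum_abs _ _
        _ ≤ ∑ k ∈ Finset.range n, D :=
            Finset.sum_le_sum fun k hk => htel' k j (Finset.mem_range.mp hk) hj
        _ = n * D := by rw [Finset.sum_const, Finset.card_range, nsmul_eq_mul]
    rw [abs_mul, Nat.abs_cast] at h2
    exact le_of_mul_le_mul_left h2 hn
  have hDsq : D ^ 2 ≤ (n : ℝ) * ∑ l ∈ Finset.range (n - 1), (g (l + 1) - g l) ^ 2 := by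
    have h1 := sq_sum_le_card_mul_sum_sq (s := Finset.range (n - 1)) (f := fun l => |g (l + 1) - g l|)
    simp only [sq_abs, Finset.card_range] at h1
    refine h1.trans (mul_le_mul_of_nonneg_right ?_ (Finset.sum_nonneg fun _ _ => sq_nonneg _))
    exact_mod_cast Nat.sub_le n 1
  calc ∑ j ∈ Finset.range n, g j ^ 2 ≤ ∑ j ∈ Finset.range n, D ^ 2 :=
        Finset.sum_le_sum fun j hj => by
          have := hpt j (Finset.mem_range.mp hj)
          rw [← sq_abs]; exact pow_le_pow_left₀ (abs_nonneg _) this 2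
    _ = n * D ^ 2 := by rw [Finset.sum_const, Finset.card_range, nsmul_eq_mul]
    _ ≤ n * (n * ∑ l ∈ Finset.range (n - 1), (g (l + 1) - g l) ^ 2) :=
        mul_le_mul_of_nonneg_left hDsq (Nat.cast_nonneg n)
    _ = (n : ℝ) ^ 2 * ∑ l ∈ Finset.range (n - 1), (g (l + 1) - g l) ^ 2 := by ring

variable {K n : ℕ} [NeZero K] [NeZero n]

/-- In-block successor: `finProdFinEquiv (b, l+1) = finProdFinEquiv (b, l) + 1` in `Fin (K·n)` for `l + 1 < n`.
[folklore] -/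
theorem finProdFinEquiv_succ (hKn : 1 < K * n) (h1n : 1 < n) (b : Fin K) (l : ℕ) (hl : l + 1 < n) :
    finProdFinEquiv (b, (⟨l + 1, hl⟩ : Fin n)) =
      finProdFinEquiv (b, (⟨l, (Nat.lt_succ_self l).trans hl⟩ : Fin n)) + 1 := by
  have hxm : ((finProdFinEquiv (b, (⟨l, (Nat.lt_succ_self l).trans hl⟩ : Fin n))).modNat : ℕ) = l := by
    rw [modNat_finProdFinEquiv]
  have hxd := divNat_finProdFinEquiv b (⟨l, (Nat.lt_succ_self l).trans hl⟩ : Fin n)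
  have h1 : (finProdFinEquiv (b, (⟨l, (Nat.lt_succ_self l).trans hl⟩ : Fin n)) + 1).divNat = b := by
    rw [divNat_add_one_of_lt hKn _ (by rw [hxm]; exact hl), hxd]
  have h2 : ((finProdFinEquiv (b, (⟨l, (Nat.lt_succ_self l).trans hl⟩ : Fin n)) + 1).modNat : ℕ) =
      l + 1 := by
    rw [modNat_add_one hKn h1n, hxm, Nat.mod_eq_of_lt hl]
  have h3 : (finProdFinEquiv (b, (⟨l, (Nat.lt_succ_self l).trans hl⟩ : Fin n)) + 1).modNat = ⟨l + 1, hl⟩ :=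
    Fin.ext h2
  have := finProdFinEquiv.apply_symm_apply
    (finProdFinEquiv (b, (⟨l, (Nat.lt_succ_self l).trans hl⟩ : Fin n)) + 1)
  rw [finProdFinEquiv_symm_apply, h1, h3] at this
  exact this

/-- BLOCK POINCARÉ INEQUALITY on `Z/(Kn)` (`Fin (K * n)`, blocks = fibres of `Fin.divNat`, mesh rescaling `c = n`,
one direction `e = 1`): `‖v‖² ≤ Σ_i ‖c∇_i v‖²` for every `v` with zero block sums — per block `poincare_range`
(only the `n − 1` INTERIOR bonds of each block are used, the face bonds are dropped; `finProdFinEquiv_succ`),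
constant `n²·(1/c)² = 1` uniformly in `n` and `K`.  Dictionary: the averaging constraint gives the massless fluctuation
form an O(1) mass in block units — the model mechanism behind ML's tangent-only coercivity. [folklore] -/
theorem block_poincare_1D (h1n : 1 < n) (v : EuclideanSpace ℝ (Fin (K * n)))
    (hv : v ∈ blockTangent (Fin.divNat : Fin (K * n) → Fin K)) :
    ‖v‖ ^ 2 ≤ ∑ i : Fin 1, ‖fwdDiff (n : ℝ) (fun _ : Fin 1 => (1 : Fin (K * n))) i v‖ ^ 2 := by
  have hKn : 1 < K * n := lt_of_lt_of_le h1n (Nat.le_mul_of_pos_left n (NeZero.pos K))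
  rw [Fin.sum_univ_one]
  have hR : ‖fwdDiff (n : ℝ) (fun _ : Fin 1 => (1 : Fin (K * n))) 0 v‖ ^ 2 =
      ∑ x, ((n : ℝ) * (v (x + 1) - v x)) ^ 2 := by
    rw [EuclideanSpace.norm_eq, Real.sq_sqrt (Finset.sum_nonneg fun _ _ => sq_nonneg _)]
    simp only [Real.norm_eq_abs, sq_abs, fwdDiff_apply]
  have hL : ‖v‖ ^ 2 = ∑ x, v x ^ 2 := by
    rw [EuclideanSpace.norm_eq, Real.sq_sqrt (Finset.sum_nonneg fun _ _ => sq_nonneg _)]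
    simp only [Real.norm_eq_abs, sq_abs]
  rw [hL, hR, ← Finset.sum_fiberwise Finset.univ (Fin.divNat : Fin (K * n) → Fin K) (fun x => v x ^ 2),
    ← Finset.sum_fiberwise Finset.univ (Fin.divNat : Fin (K * n) → Fin K)
      (fun x => ((n : ℝ) * (v (x + 1) - v x)) ^ 2)]
  refine Finset.sum_le_sum fun b _ => ?_
  change ∑ x ∈ fiber Fin.divNat b, v x ^ 2 ≤ ∑ x ∈ fiber Fin.divNat b, ((n : ℝ) * (v (x + 1) - v x)) ^ 2
  rw [sum_fiber_divNat, sum_fiber_divNat]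
  set g : ℕ → ℝ := fun l => if h : l < n then v (finProdFinEquiv (b, (⟨l, h⟩ : Fin n))) else 0 with hg
  have hgj : ∀ j : Fin n, g j = v (finProdFinEquiv (b, j)) := fun j => by
    simp only [hg, dif_pos j.isLt, Fin.eta]
  have hsum0 : ∑ l ∈ Finset.range n, g l = 0 := by
    rw [Finset.sum_range]
    have hb := (mem_blockTangent.mp hv) b
    rw [blockSum_apply, sum_fiber_divNat] at hb
    rw [← hb]
    exact Finset.sum_congr rfl fun j _ => hgj j
  have hLb : ∑ j : Fin n, v (finProdFinEquiv (b, j)) ^ 2 = ∑ l ∈ Finset.range n, g l ^ 2 := by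
    rw [Finset.sum_range]
    exact Finset.sum_congr rfl fun j _ => by rw [hgj]
  have hP := poincare_range n g hsum0
  set t : ℕ → ℝ := fun l => if h : l < n then
      ((n : ℝ) * (v (finProdFinEquiv (b, (⟨l, h⟩ : Fin n)) + 1) - v (finProdFinEquiv (b, (⟨l, h⟩ : Fin n))))) ^ 2
    else 0 with ht
  have htj : ∀ j : Fin n,
      t j = ((n : ℝ) * (v (finProdFinEquiv (b, j) + 1) - v (finProdFinEquiv (b, j)))) ^ 2 :=
    fun j => by simp only [ht, dif_pos j.isLt, Fin.eta]
  have hRb : (n : ℝ) ^ 2 * ∑ l ∈ Finset.range (n - 1), (g (l + 1) - g l) ^ 2 ≤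
      ∑ j : Fin n, ((n : ℝ) * (v (finProdFinEquiv (b, j) + 1) - v (finProdFinEquiv (b, j)))) ^ 2 := by
    have h1 : ∑ j : Fin n, ((n : ℝ) * (v (finProdFinEquiv (b, j) + 1) - v (finProdFinEquiv (b, j)))) ^ 2 =
        ∑ l ∈ Finset.range n, t l := by
      rw [Finset.sum_range]; exact Finset.sum_congr rfl fun j _ => (htj j).symm
    have h2 : ∀ l ∈ Finset.range (n - 1), (n : ℝ) ^ 2 * (g (l + 1) - g l) ^ 2 = t l := by
      intro l hl
      have hl' : l + 1 < n := by simp only [Finset.mem_range] at hl; omega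
      have hl'' : l < n := (Nat.lt_succ_self l).trans hl'
      simp only [ht, hg, dif_pos hl', dif_pos hl'']
      rw [finProdFinEquiv_succ hKn h1n b l hl']; ring
    rw [h1, Finset.mul_sum]
    calc ∑ l ∈ Finset.range (n - 1), (n : ℝ) ^ 2 * (g (l + 1) - g l) ^ 2
        = ∑ l ∈ Finset.range (n - 1), t l := Finset.sum_congr rfl h2
      _ ≤ ∑ l ∈ Finset.range n, t l := Finset.sum_le_sum_of_subset_of_nonneg
          (Finset.range_mono (Nat.sub_le n 1))
          (fun l _ _ => by simp only [ht]; split_ifs <;> positivity)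
  calc ∑ j : Fin n, v (finProdFinEquiv (b, j)) ^ 2 = ∑ l ∈ Finset.range n, g l ^ 2 := hLb
    _ ≤ (n : ℝ) ^ 2 * ∑ l ∈ Finset.range (n - 1), (g (l + 1) - g l) ^ 2 := hP
    _ ≤ _ := hRb

/-- TANGENT-ONLY COERCIVITY in the 1D block model: for every `0 ≤ s₀` — in particular the MASSLESS form `s₀ = 0`,
which is NOT coercive on ℓ² (constants) — `(1/(1+s))·N_s(v)² ≤ B_{s₀}(v,v)` for all `v ∈ T_Q`, uniformly in `n`
and `K` (`coercive_of_poincare` + `block_poincare_1D`). [folklore] -/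
theorem coercive_blockTangent_1D (h1n : 1 < n) {s₀ s : ℝ} (hs₀ : 0 ≤ s₀) (hs : 0 ≤ s) :
    ∀ v ∈ blockTangent (Fin.divNat : Fin (K * n) → Fin K),
      1 / (1 + s) * energyNorm (n : ℝ) (fun _ : Fin 1 => (1 : Fin (K * n))) s v ^ 2 ≤
        latticeForm (n : ℝ) (fun _ : Fin 1 => (1 : Fin (K * n))) s₀ v v := by
  have := coercive_of_poincare (n : ℝ) (fun _ : Fin 1 => (1 : Fin (K * n))) hs₀ hs zero_le_one
    (blockTangent Fin.divNat) (fun v hv => by rw [one_mul]; exact block_poincare_1D h1n v hv)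
  simpa only [mul_one] using this

/-- THE ONE-DIMENSIONAL MODEL THEOREM, SUB-MASS / MASSLESS FORM, TANGENT-ONLY COERCIVITY ((δ2′)): on `Z/(Kn)`
with `K` blocks of `n ≥ 3` sites, `c = n`, form `B = latticeForm n e s₀` with `0 ≤ s₀ ≤ s` (e.g. `s₀ = 0`), gauge
`N = energyNorm n e s` (`s > 0` a free gauge parameter), weights and block data as in `constrained_lattice_agmon_1D`,
and `μ²/s + (1 + μ√(1/s))²θ₂ + θ₁(2+θ₁) < (1−θ₁)²/(1+s)`: every `u ∈ T_Q` solving `B(u,v) = J(v)` on `T_Q` with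
`|J(ωv)| ≤ ρN(v)` obeys `N(ωu) ≤ ρ(1+θ₂)/((1−θ₁)²/(1+s) − θ₁(2+θ₁) − μ²/s − (1 + μ√(1/s))²θ₂)` — EVERY
CONSTANT INDEPENDENT OF `n` AND `K`; coercivity enters ONLY on `T_Q` (`coercive_blockTangent_1D`, m = 1/(1+s)).
[folklore] -/
theorem constrained_lattice_agmon_1D_of_le (hn : 3 ≤ n) {s₀ s μ ϑ θ₁ θ₂ ρ : ℝ} (hs : 0 < s)
    (hs₀ : 0 ≤ s₀) (hs₀s : s₀ ≤ s) (hμ : 0 ≤ μ)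
    (ω : Fin (K * n) → ℝ) (hpos : ∀ x, 0 < ω x)
    (hω : ∀ x, (n : ℝ) ^ 2 * (ω (x + 1) - ω x) ^ 2 ≤ μ ^ 2 * ω x ^ 2 ∧
      (n : ℝ) ^ 2 * (ω (x + 1) - ω x) ^ 2 ≤ μ ^ 2 * ω (x + 1) ^ 2)
    (ωbar : Fin K → ℝ) (hωbar : ∀ b, 0 < ωbar b) (hϑ : 0 ≤ ϑ) (hϑ1 : ϑ < 1)
    (hW1 : ∀ x, |ω x ^ 2 - ωbar x.divNat ^ 2| ≤ ϑ * ωbar x.divNat ^ 2)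
    (hθ₁0 : 0 ≤ θ₁) (hθ₁1 : θ₁ ≤ 1) (hθ₂0 : 0 ≤ θ₂)
    (hθ₁ : ϑ ^ 2 / (1 - ϑ) * (144 + 9 * s) / s ≤ θ₁ ^ 2)
    (hθ₂ : ϑ ^ 2 / (1 - ϑ) ^ 2 * ((12 + 3 * μ) ^ 2 + 9 * s) / s ≤ θ₂ ^ 2)
    (hden : μ ^ 2 / s + (1 + μ * Real.sqrt (1 / s)) ^ 2 * θ₂ + θ₁ * (2 + θ₁) <
      1 / (1 + s) * (1 - θ₁) ^ 2)
    {u : EuclideanSpace ℝ (Fin (K * n))} (hu : u ∈ blockTangent Fin.divNat)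
    (J : EuclideanSpace ℝ (Fin (K * n)) →ₗ[ℝ] ℝ) (hρ : 0 ≤ ρ)
    (hweak : ∀ v ∈ blockTangent Fin.divNat,
      latticeForm (n : ℝ) (fun _ : Fin 1 => (1 : Fin (K * n))) s₀ u v = J v)
    (hJ : ∀ v, |J (mulOp ω v)| ≤ ρ * energyNorm (n : ℝ) (fun _ : Fin 1 => (1 : Fin (K * n))) s v) :
    energyNorm (n : ℝ) (fun _ : Fin 1 => (1 : Fin (K * n))) s (mulOp ω u) ≤ (ρ + ρ * θ₂) /
      (1 / (1 + s) * (1 - θ₁) ^ 2 - θ₁ * (2 + θ₁) - μ ^ 2 / s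
        - (1 + μ * Real.sqrt (1 / s)) ^ 2 * θ₂) := by
  have h1n : 1 < n := by omega
  have hKn : 1 < K * n := lt_of_lt_of_le h1n (Nat.le_mul_of_pos_left n (NeZero.pos K))
  have h1ϑ : 0 < 1 - ϑ := by linarith
  have key := constrained_lattice_agmon_of_le (n : ℝ) (fun _ : Fin 1 => (1 : Fin (K * n))) hs ω hpos hμ
    (fun _ x => hω x) Fin.divNat ωbar hωbar hϑ hϑ1 hW1 (theta n) (theta_profileExact hn)
    (fun b => fiber Fin.divNat b) (Mu := 1) (theta_support hKn h1n)
    (fun x => by rw [filter_mem_fiber_divNat]; simp)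
    (Cu := 144 + 9 * s) (Cw := ((12 + 3 * μ) ^ 2 + 9 * s) / (1 - ϑ)) (by positivity) (by positivity)
    (theta_energy_le hn hs.le) (theta_weighted_energy_le hn hs.le hμ ω hpos hω ωbar hωbar hϑ hϑ1 hW1)
    hθ₁0 hθ₁1 hθ₂0
    (by rw [Nat.cast_one, one_mul]; exact hθ₁)
    (by
      rw [Nat.cast_one, one_mul]
      have h1 : (1 - ϑ) ≠ 0 := h1ϑ.ne'
      have h2 : s ≠ 0 := hs.ne'
      calc ϑ ^ 2 / (1 - ϑ) * (((12 + 3 * μ) ^ 2 + 9 * s) / (1 - ϑ)) / s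
          = ϑ ^ 2 / (1 - ϑ) ^ 2 * ((12 + 3 * μ) ^ 2 + 9 * s) / s := by rw [div_mul_div_comm, ← sq]; ring
        _ ≤ θ₂ ^ 2 := hθ₂)
    hs₀ hs₀s (m := 1 / (1 + s)) (by positivity) (coercive_blockTangent_1D h1n hs₀ hs.le)
    (by simpa using hden) hu J hρ hweak hJ
  simpa using key

/-- THE ONE-DIMENSIONAL MODEL THEOREM WITH A TANGENT-ONLY SOURCE BOUND ((δ1′)+(δ2′) together): as
`constrained_lattice_agmon_1D_of_le`, but the source is assumed bounded ONLY on tangent test fields in the dual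
weighted gauge, `|J φ| ≤ ρ·N(ω⁻¹φ)` for `φ ∈ T_Q`; conclusion with `ρ′ = ρ(1 + √((1+ϑ)C_w/s))`,
`C_w = ((12+3μ)² + 9s)/(1−ϑ)` (`tangent_source_extension` with the parabola profiles, multiplicity 1):
`N(ωu) ≤ ρ′(1+θ₂)/((1−θ₁)²/(1+s) − θ₁(2+θ₁) − μ²/s − (1 + μ√(1/s))²θ₂)`, n- and K-free.  This is the model form
of the full (δ1)+(δ2) mechanism: massless fluctuation form, averaging constraint, Agmon weight, source tested on
tangent fields only. [folklore] -/
theorem constrained_lattice_agmon_1D_tangentSource (hn : 3 ≤ n) {s₀ s μ ϑ θ₁ θ₂ ρ : ℝ} (hs : 0 < s)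
    (hs₀ : 0 ≤ s₀) (hs₀s : s₀ ≤ s) (hμ : 0 ≤ μ)
    (ω : Fin (K * n) → ℝ) (hpos : ∀ x, 0 < ω x)
    (hω : ∀ x, (n : ℝ) ^ 2 * (ω (x + 1) - ω x) ^ 2 ≤ μ ^ 2 * ω x ^ 2 ∧
      (n : ℝ) ^ 2 * (ω (x + 1) - ω x) ^ 2 ≤ μ ^ 2 * ω (x + 1) ^ 2)
    (ωbar : Fin K → ℝ) (hωbar : ∀ b, 0 < ωbar b) (hϑ : 0 ≤ ϑ) (hϑ1 : ϑ < 1)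
    (hW1 : ∀ x, |ω x ^ 2 - ωbar x.divNat ^ 2| ≤ ϑ * ωbar x.divNat ^ 2)
    (hθ₁0 : 0 ≤ θ₁) (hθ₁1 : θ₁ ≤ 1) (hθ₂0 : 0 ≤ θ₂)
    (hθ₁ : ϑ ^ 2 / (1 - ϑ) * (144 + 9 * s) / s ≤ θ₁ ^ 2)
    (hθ₂ : ϑ ^ 2 / (1 - ϑ) ^ 2 * ((12 + 3 * μ) ^ 2 + 9 * s) / s ≤ θ₂ ^ 2)
    (hden : μ ^ 2 / s + (1 + μ * Real.sqrt (1 / s)) ^ 2 * θ₂ + θ₁ * (2 + θ₁) <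
      1 / (1 + s) * (1 - θ₁) ^ 2)
    {u : EuclideanSpace ℝ (Fin (K * n))} (hu : u ∈ blockTangent Fin.divNat)
    (J : EuclideanSpace ℝ (Fin (K * n)) →ₗ[ℝ] ℝ) (hρ : 0 ≤ ρ)
    (hweak : ∀ v ∈ blockTangent Fin.divNat,
      latticeForm (n : ℝ) (fun _ : Fin 1 => (1 : Fin (K * n))) s₀ u v = J v)
    (hJT : ∀ φ ∈ blockTangent (Fin.divNat : Fin (K * n) → Fin K), |J φ| ≤
      ρ * energyNorm (n : ℝ) (fun _ : Fin 1 => (1 : Fin (K * n))) s (mulOp (fun x => (ω x)⁻¹) φ)) :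
    energyNorm (n : ℝ) (fun _ : Fin 1 => (1 : Fin (K * n))) s (mulOp ω u) ≤
      (ρ * (1 + Real.sqrt ((1 + ϑ) * (((12 + 3 * μ) ^ 2 + 9 * s) / (1 - ϑ)) / s)) * (1 + θ₂)) /
      (1 / (1 + s) * (1 - θ₁) ^ 2 - θ₁ * (2 + θ₁) - μ ^ 2 / s
        - (1 + μ * Real.sqrt (1 / s)) ^ 2 * θ₂) := by
  have h1n : 1 < n := by omega
  have hKn : 1 < K * n := lt_of_lt_of_le h1n (Nat.le_mul_of_pos_left n (NeZero.pos K))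
  have h1ϑ : 0 < 1 - ϑ := by linarith
  set Cw : ℝ := ((12 + 3 * μ) ^ 2 + 9 * s) / (1 - ϑ) with hCw
  have hCw0 : 0 ≤ Cw := by positivity
  obtain ⟨hagree, hbound⟩ := tangent_source_extension (n : ℝ) (fun _ : Fin 1 => (1 : Fin (K * n))) hs
    Fin.divNat (theta n) (theta_profileExact hn) (fun b => fiber Fin.divNat b) (Mu := 1)
    (theta_support hKn h1n) (fun x => by rw [filter_mem_fiber_divNat]; simp) ω hpos ωbar hωbar hϑ hW1
    hCw0 (theta_weighted_energy_le hn hs.le hμ ω hpos hω ωbar hωbar hϑ hϑ1 hW1) J hρ hJT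
  set ρ' : ℝ := ρ * (1 + Real.sqrt ((1 + ϑ) * Cw / s)) with hρ'
  have hρ'0 : 0 ≤ ρ' := by positivity
  have key := constrained_lattice_agmon_1D_of_le hn hs hs₀ hs₀s hμ ω hpos hω ωbar hωbar hϑ hϑ1 hW1
    hθ₁0 hθ₁1 hθ₂0 hθ₁ hθ₂ hden hu (J ∘ₗ tangentProj Fin.divNat (theta n)) hρ'0
    (fun v hv => by rw [hagree v hv]; exact hweak v hv)
    (fun v => by
      have := hbound (mulOp ω v)
      rw [mulOp_inv_mul ω hpos, Nat.cast_one, one_mul] at this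
      exact this)
  have hnum : ρ' + ρ' * θ₂ = ρ * (1 + Real.sqrt ((1 + ϑ) * Cw / s)) * (1 + θ₂) := by rw [hρ']; ring
  rw [hnum] at key
  exact key

end OneDSub

end Literature.MathematicalPhysics.QuantumFieldTheory.Balaban1983to89.T4ConstrainedAgmon

end
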